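import Mathlib

/-!
# Dimock, *The renormalization group according to Balaban* I, §5 "the flow": LEMMA 23 and THEOREM 24 (gsf) — the
counterterm trajectory `μ_K = 0`, `E_0 = 0` by contraction on the weighted sequence ball — PROVED over abstract Banach
spaces from the shapes of THEOREM 14 (lanky) and LEMMA 22 (smooth), with every "for L large / λ_k small" explicit

**Citation header (reproduction of PUBLISHED work; template of the Balaban lattice Yang–Mills cell).**
J. Dimock, *The renormalization group according to Balaban. I. Small fields*, Rev. Math. Phys. **25** (2013) 1330010
(= arXiv:1108.1335v2) [Dimock2013]: §4.1 Theorem 14 \label{lanky} (TeX L1924–1952; the recursion eq. (recursive)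
L1932–1939 and the bounds L1940–1951), §4.9 Lemma 22 \label{smooth} (TeX L2693–2703), §5 "the flow" (TeX L2740–3053:
eq. (recursive3) L2749–2755, the boundary conditions (bc) L2777–2779, the backward form (recursive4) L2784–2791, the
sequence space 𝖡 with its norm L2796–2811, 𝖡₀ and 𝖡₁ L2812–2823, the map T = eq. (recursive5) L2826–2834, Lemma 23
L2854–2860 with proof L2863–2997 ((1.) = (jelly) L2863–2895, (2.) L2898–2997), Theorem 24 \label{gsf} L3006–3018 with
proof L3021–3053 (eqs. (somewhat) L3010–3013, (eg) L3015–3017, (out) L3041–3043)).  Theorem∕lemma numbers are those of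
the shared counter `\newtheorem{thm}{Theorem}`, `\newtheorem{lem}[thm]{Lemma}` of the arXiv source (TeX L15–18; Theorem
1 = (major), Theorem 14 = (lanky), Lemma 22 = (smooth), Lemma 23 = the fixed-point lemma, Theorem 24 = (gsf)).  TeX line
numbers refer to the arXiv source held by the cell (`inputs/files/dimock/src/1108.1335/1108.1335.tex`); every quotation
below was read there this session.  Dimock's papers are published and refereed and are the cell's TEMPLATE, not
manuscripts under audit; no quantity of the Bałaban series is touched.  Dimock on provenance (footnote, TeX L2744–2746):
*"This section is not particularly due to Balaban. We study the RG flow by a discrete dynamical systems approach.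
Somewhat similar methods can be found in [BDH98], [Bry07]. However those papers are concerned with infrared problems, not
ultraviolet problems of the type considered here."*

**Why this module.**  The cell's TEMPLATE.md (v8.18 §4.1, row "D1 §5 the flow, Thm gsf (L2740–3053) | existence of
counterterm trajectory by contraction | … | N | template-less (GAPS G1)") lists the flow theorem of [Dimock2013] among the
template statements that are NOT kernel; of the remaining non-kernel template items it is the only one that is not
analytic (it consumes the single RG step only through the six bounds of Theorem 14 and the four derivative bounds of
Lemma 22).  Dimock's Theorem 1 (major), TeX L237 ff., is Theorem 14 iterated along the trajectory this section
constructs; this module kernel-checks the construction — Lemma 23 and Theorem 24 — from those bounds on.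

**What is reproduced here (kernel-checked; Mathlib only).**
* Part 1 — the single-step DATA as abstract maps between abstract real Banach spaces `E k` (print: Re(𝒦_k^{norm}), TeX
  L1542–1545), `StepMaps`; the bounds of Theorem 14 and Lemma 22 as HYPOTHESIS SHAPES `StepBounds` (Lemma 22 in the
  two-point Lipschitz form in which the proof consumes it, reading (ii)); the parameter conditions `FlowSmall` (reading
  (v)) and their algebra (`FlowSmall.succ_rpow`, `…w_le_half_sqrt`, the exponent identities `ident_a`–`ident_f`).
* Part 2 — the weighted sequence space in RESCALED coordinates `m_k = λ_k^{−½−β}μ_k`, `e_k = λ_k^{−β}E_k` (so that the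
  printed norm TeX L2807–2810 *"‖ξ‖ = sup_{0≤k≤K} {λ_k^{−½−β}|μ_k|, λ_k^{−β}‖E_k‖_{k,κ}}"* is the sup norm of the pi type
  `Seq K E`), the map `T` of eq. (recursive5) with the boundary conditions (bc) built in (`muNext`, `eNext`, `T`), and
  **LEMMA 23 PROVED**: (1) `norm_T_le_one` (= (jelly) and the `E′` estimate, TeX L2867–2895: T maps the closed unit ball
  to itself) and (2) `norm_T_sub_T_le` (TeX L2901–2997: `‖Tξ₁ − Tξ₂‖ ≤ ½‖ξ₁ − ξ₂‖` on the ball), step by step as printed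
  (first term `L^{β−3/2}[…]`, second term `L^{−2}λ_k^{6ε}[…]`, third term by Lemma 22; `E`-terms `L^{−β}[…]` + Lemma 22).
* Part 3 — the FIXED POINT (`exists_fixedPoint`, by Mathlib's `ContractingWith.exists_fixedPoint'` on the complete
  closed ball, = TeX L2899 *"By the standard fixed point theorem in a complete metric space it suffices to show that the
  mapping is a contraction"*; `fixedPoint_unique`), the dictionary fixed point ⟺ flow (`IsFlow` = (recursive3) for
  `μ, E` with (bc), TeX L2833–2834 *"Then ξ is a solution of (bc), (recursive4) iff it is a fixed point for T on 𝖡₀"*;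
  `isFlow_unscale`, `rescale_fixed`), and **THEOREM 24 PROVED** in the original variables: `flow_exists_unique` — under
  `StepBounds` and `FlowSmall` there is a flow `(μ_k, E_k)_{k=0..K}` with `μ_K = 0`, `E_0 = 0`, `|μ_k| ≤ λ_k^{½+β}`,
  `‖E_k‖ ≤ λ_k^β` (= (somewhat)), unique among flows satisfying these bounds.
* Part 4 — the VACUUM ENERGY (eg): `vacuumEnergy_bound` (= (out) ⇒ (eg): a backward recursion `|x_k| ≤ L^{−3}|x_{k+1}| +
  bλ_k^β`, `x_K = 0`, gives `|x_k| ≤ b∕(1 − L^{β−3}) · λ_k^β`, TeX L3035–3053), `vacuumEnergy_step` (the printed `b = 𝒪(1)`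
  as `b = 1 + A` from `|𝓛₁E_k| ≤ ‖E_k‖ ≤ λ_k^β` and `|L^{−3}ε_k^*| ≤ Aλ_k^{¼−10ε} ≤ Aλ_k^β`, TeX L3033–3034), and
  `vacuumEnergy_of_flow` (for the flow of Part 3 — indeed for any `(μ, E)` in the ball — and ANY real `ε` with `ε_K = 0`
  obeying the backward form *"ε_k = L^{−3}(ε_{k+1} − 𝓛₁(E_k) − ε_k^*)"* (TeX L3029–3031) of the first line of (recursive3):
  `|ε_k| ≤ (1+A)∕(1 − L^{β−3}) · λ_k^β`, under the explicit `L ≥ 1`, `L^{β−3} < 1`, `β ≤ ¼ − 10ε`).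
* Part 5 (v1.3, REDUCED at v1.5) — the SANITY instance `StepBounds.zero` (the zero single-step data inhabit the shape
  `StepBounds` — NOT Dimock's step).  LOCATED SELF-ERRATUM (cell record E-TM98-2): v1.3's regime theorems
  (`FlowSmall.of_thresholds` ∕ `of_explicit` ∕ `satisfiable` ∕ `satisfiable_nat`, `thm24_hypotheses_satisfiable` and their
  private helpers) DUPLICATED the sibling leaf `…Dimock2011to13.SmallFieldFlowRegime` (unit `b2b-balaban-template` gen 18,
  2026-08-19: `flowSmall_regime` with explicit `L₀(β) = max(4, 4^{1/β})`, `λ₀ = exp(−ellFlow L A ε β)`; `exists_flowSmall`;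
  `flow_exists_unique_regime`; and the NECESSITY `quarter10_of_flowSmall` of the print's `β < ¼ − 10ε`), which is where
  reading (v)'s *"only serves to make the conditions satisfiable"* and reading (viii)'s *"how a consumer satisfies
  `FlowSmall`"* were ALREADY theorems; they are WITHDRAWN here (nothing referenced them).
* Part 6 (v1.4) — DEPENDENCE OF THE FIXED POINT ON THE STEP DATA: `fixedPoint_sub_fixedPoint_le` (two step data, the
  first obeying `StepBounds`, whose maps `T`, `T′` differ by `≤ δ` on the closed unit ball of 𝖡 have fixed points `≤ 2δ`
  apart — `‖ξ − ξ′‖ ≤ ½‖ξ − ξ′‖ + δ`, the standard companion of Lemma 23 (2)'s `½`-contraction) and `flow_sub_flow_le`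
  (in original variables: `|μ_k − μ′_k| ≤ 2δλ_k^{½+β}`, `‖E_k − E′_k‖ ≤ 2δλ_k^β`).  Recorded because the counterterms the
  print selects are the fixed point for step maps living on the tori `𝕋⁰_{𝖬+𝖭−k}` (TeX L2756–2757) while I Theorem 1
  indexes them by `𝖭` alone (*"counterterms E^𝖭, μ^𝖭 … for all 𝖬, 𝖭"*, TeX L237–249; cell record Q-TM98-1): any
  `𝖬`-uniformity of `(μ^𝖭₀, E)` is inherited, by this lemma, from the `𝖬`-closeness of the step maps on the unit ball —
  about which nothing is asserted here.
* Part 7 (v1.6) — TEMPERED CONTRACTION AND SCALE-LOCALISED DEPENDENCE (NOT statements of the print; the standard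
  weighted-norm refinement of Lemma 23 (2) through the BANDED structure of (recursive5) — `μ′_k` reads levels `k + 1`
  (coefficient `L^{β−3/2} ≤ ¼`, `FlowSmall.j1`) and `k`, `E′_k` reads level `k − 1` (coefficient `≤ ½`, `FlowSmall.c2`)):
  `muNext_sub_muNext_le` ∕ `eNext_sub_eNext_le` (Lemma 23 (2) level by level), `tempered_T_sub_T_le` (`T` contracts by `ρ/2`
  in every `ρ`-tempered weighted sup-norm, `ρ ≥ 1`), `tempered_fixedPoint_sub_le` (fixed points of `T`, `T′` whose maps
  differ by `δ_k` at level `k`: `w_k‖ξ_k − ξ′_k‖ ≤ (1 − ρ/2)⁻¹ sup_k w_kδ_k`, `ρ < 2`; Part 6 is `ρ = 1`), and the two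
  geometric instances `fixedPoint_sub_le_of_agree_below` ∕ `…_above` with `flow_sub_flow_le_of_agree_below` ∕ `…_above` in
  the original variables (`ρ = 3/2`): single-step data agreeing at all levels `< j` (resp. `≥ j`) and `δ`-close on the ball
  give flows with `|μ_k − μ′_k| ≤ 4δ(2/3)^{j−k}λ_k^{½+β}`, `‖E_k − E′_k‖ ≤ 4δ(2/3)^{j−k}λ_k^β` (resp. `(2/3)^{k−j}`) — the
  ultraviolet counterterms (in particular `μ^𝖭_0`) forget infrared modifications of the step maps geometrically (the
  sharpened abstract half of cell record Q-TM98-1: the volume exponent `𝖬` enters the tori `𝕋⁰_{𝖬+𝖭−k}` at every level),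
  and the infrared end of the trajectory forgets ultraviolet modifications geometrically (the Markovian-template form of a
  fading memory across scales, which the cell's T⁴ spine hypothesises for Bałaban's history-dependent functionals,
  `…Balaban1983to89.T4OutputRate.FadingMemory` — an analogy of mechanism, cell record C1-TM3; here a theorem of the
  hyperbolic structure modulo the single-step shapes).  Nothing about Dimock's actual step maps is asserted.
* Part 8 (v1.7) — THE SHARP ULTRAVIOLET RATE (NOT statements of the print): two-ratio tempering `tempered₂_T_sub_T_le` ∕
  `tempered₂_fixedPoint_sub_le` (weights with `w_i ≤ ρᵤw_{i+1}`, `w_{i+1} ≤ ρ_dw_i`; contraction number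
  `θ ≥ max(L^{β−3/2}ρᵤ + ½ − L^{β−3/2}, ρ_d/2)`; Part 7 is `ρᵤ = ρ_d`), whence `fixedPoint_sub_le_of_agree_below_sharp`
  (weights decreasing towards the infrared are admissible with `ρ` up to `1 + ½L^{3/2−β}`, the hyperbolic rate of the
  relevant direction) and `flow_sub_flow_le_of_agree_below_sharp` (`ρ = ¼L^{3/2−β} ≥ 1` by `FlowSmall.j1`): step data
  agreeing at all levels `< j` and `δ`-close on the ball give `|μ_k − μ′_k| ≤ 4δ(4L^{β−3/2})^{j−k}λ_k^{½+β}`,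
  `‖E_k − E′_k‖ ≤ 4δ(4L^{β−3/2})^{j−k}λ_k^β` — the ultraviolet counterterms forget infrared modifications of the step maps at
  the power-counting rate `(4L^{−(3/2−β)})^{distance}` (Part 7's `(2/3)^{distance}` is what the E-direction allows towards
  the infrared; towards the ultraviolet only the μ-chain propagates, with the printed coefficient `L^{β−3/2}`).
* Part 9 (v1.8) — δ-FREE FORMS FOR TWO ADMISSIBLE DATA (NOT statements of the print): `norm_T_sub_T'_le_two` (two data
  obeying `StepBounds` have maps `2`-close on the ball, by Lemma 23 (1) twice), whence `flow_sub_flow_le_of_agree_below_adm`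
  ∕ `…_adm'` (data coinciding at all levels `< j` ⇒ `|μ_k − μ′_k| ≤ 8(4L^{β−3/2})^{j−k}λ_k^{½+β}`, resp. `8(2/3)^{j−k}`,
  WHATEVER the data are at the levels `≥ j`: the initial counterterm `μ^𝖭_0` is determined by the first `j` step maps up
  to the fraction `8(4L^{β−3/2})^{j}` of `λ_0^{½+β}`, uniformly over all admissible infrared completions) and
  `flow_sub_flow_le_of_agree_above_adm` (data coinciding at all levels `≥ j` ⇒ `|μ_k − μ′_k| ≤ 8(2/3)^{k−j}λ_k^{½+β}`,
  whatever the ultraviolet levels: the Markovian template's form of the convergence of renormalised trajectories at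
  fixed infrared scale — under the IDEALISATION that the level-`k` maps of two cut-offs coincide, whereas in print they
  also depend on the fine spacing `L^{−k}`, the η-effect of cell records C1-TM2 ∕ NE5).

**Readings / divergences (declared).**  (i) ABSTRACT SPACES AND MAPS: `E k` is any family of real Banach spaces and
(𝓛_i, ε^*, μ^*, E^*) any maps with the printed bounds; nothing of §§2–4 (densities, polymer norms, the fluctuation
integral, analyticity) is typed, and `λ_k` is a parameter sequence `lam` with `lam (k+1) = L · lam k` (TeX L1936, L2747
*"We continue to treat λ_k as a parameter, not a dynamical variable"*), `0 < lam k ≤ 1`.  (ii) LEMMA 22 IN LIPSCHITZ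
FORM: the print states Cauchy-type derivative bounds on the half-region and USES them only through the mean-value
interpolation TeX L2931–2955 and L2972–2994 (*"we write with μ(t) = tμ_{1,k} + (1−t)μ_{2,k} and E(t) = tE_{1,k} +
(1−t)E_{2,k} … ∫₀¹ ∂μ^*_k∕∂μ_k(μ(t), E_{1,k})(μ_{1,k} − μ_{2,k}) dt + …"*); the shape `StepBounds.mus_lip`∕`Es_lip` records
the RESULT of that interpolation (two-point Lipschitz bounds on the convex half-region with the printed rates) — weaker
than the printed differentiability, and exactly what is consumed.  (iii) THE BALL IS CLOSED: print 𝖡₁ = 𝖡₀ ∩ {‖ξ‖ < 1}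
(TeX L2822) while the fixed-point theorem is invoked *"in a complete metric space"* (L2899) and (1.) proves `‖Tξ‖ ≤ 1`
(L2877, L2895); the module works on the CLOSED unit ball (complete), on which (1.) and (2.) hold verbatim, and the
conclusion (somewhat) is the non-strict bound printed in Theorem 24.  (iv) CONSTANTS: *"replacing 𝒪(1)L^{−ε} by 1"* (TeX
L2863–2864) is adopted for 𝓛₁, 𝓛₂, 𝓛₃ (`StepBounds.L1_le`–`L3_le`), and the six `𝒪(1)` of Theorem 14 ∕ Lemma 22 are ONE
constant `A ≥ 0`.  (v) EXPLICIT SMALLNESS: every *"for L large"* ∕ *"for λ_k small (depending on L)"* of the printed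
proof is a named field of `FlowSmall`, quantified over all levels `k ≤ K` (print: `λ_k ≤ λ_K` small, TeX L2845–2850):
`j1`–`j3` (TeX L2880–2883), `e1`–`e2` (L2885–2894), `c1` (L2956), `c2` (L2995), and the tacit `half` (`λ_k^β ≤ ½`, which
puts the ball inside the half-region of Lemma 22 and inside the region of Theorem 14, cf. TeX L2846–2850 *"which is well
within the allowed region"*); `0 < β` is kept; the printed upper bound `β < ¼ − 10ε` (TeX L2803) is NOT a field of `FlowSmall` —
for the flow (Parts 2–3) it only serves to make the conditions satisfiable for small `λ_K` — and enters exactly once, in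
Part 4, as the explicit hypothesis `β ≤ ¼ − 10ε` of `vacuumEnergy_step` ∕ `vacuumEnergy_of_flow` (print, TeX L3034:
*"|L^{−3}ε_k^*| ≤ 𝒪(1)λ_k^{1/4−10ε} ≤ 𝒪(1)λ_k^β"*).  A located misprint, records only (cell list T-G22,
Dimock-internal): in (jelly), TeX L2875, the middle term is printed *"L^{−2}λ_k^{1∕4+6ε}[λ_k^{−β}‖E_k‖_{k,κ}]"* where the
algebra (λ_k^{−½−β} · L^{−2} · λ_k^{½+6ε}‖E_k‖) and the next sentence (L2881 *"that L^{−2}λ_k^{6ε} ≤ 1∕4"*) give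
`L^{−2}λ_k^{6ε}[…]`; the module proves the correct line.  (vi) THE ε-COMPONENT is treated separately, as in print (TeX
L2782–2783 *"we temporarily drop ε_k as a variable since it does not afffect [sic] the others"*), by Part 4, for any real
sequence obeying the first line of (recursive3) with `ε_K = 0`; existence∕uniqueness of that sequence (a backward linear
recursion from `ε_K = 0`, TeX L3026–3032) is trivial and left to the consumer as data.  (vii) UNIQUENESS is stated, as
printed, among sequences satisfying (bc) and (somewhat) (= fixed points of T in the closed ball); (viii) `K ≥ 0` is
arbitrary (`Fin (K+1)` levels); the print's `K = 𝖭 − Δ` and the choice of `Δ` making `λ_K = L^{−Δ}λ` small (TeX L2838–2845)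
are how a consumer satisfies `FlowSmall`, not hypotheses of the module.

**What is NOT claimed.**  Theorem 14 and Lemma 22 themselves (the single RG step with its bounds, §§3–4) are hypothesis
shapes, not asserted; the flow of `λ_k` is not dynamical; Theorem 1 (major) — Theorem 14 iterated along the trajectory —
is not assembled here; no statement about 𝒪(1)-sharpness (Dimock's Remark TeX L3058 ff.) is made.  Value = kernel closure
of the template's flow theorem modulo the single-step shapes, NOT summit progress (the Bałaban series' own flow, B12
Theorem 2, is a different, marginal mechanism — TEMPLATE §16.2, GAPS G1 — and YM₄ on T⁴ ∕ infinite volume ∕ mass gap are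
elsewhere and out of scope).

Cell records: TEMPLATE.md §4.1 (row D1 §5), §15.2 (kernel status), §16.2 (why the YM flow is template-less); GAPS.md G1 and
this module's row C-tmpl16-2; unit `b2b-balaban-template` gen 16, journal claim D1-FLOW-THM24-KERNEL.  The cell's
numbers-only shape `…Balaban1983to89.Step.GsfShape` (Theorem 24's conclusion (somewhat) ∧ (eg) as a HYPOTHESIS shape on
`(ε_k, μ_k, ‖E_k‖)`, module `Step` Part B5) is neither imported nor restated; for the flow constructed here its three
bounds are the conclusions of `flow_exists_unique` and `vacuumEnergy_of_flow`.  NEW leaf; imports Mathlib only;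
sub-namespace `…Dimock2011to13.SmallFieldFlow`; modifies nothing.  v1.1 (same seat): docstring-only — the rôle of the
printed bound `β < ¼ − 10ε` stated uniformly (header reading (v), Part 4 bullet, `FlowSmall` docstring); declarations and
proofs byte-identical to v1.  v1.2 (same seat): docstring-only fold of XREAD C-pv11g11-2 (pv11-g11: ok — ABSOLUTE-RULE 0,
misquotations 0, objections 0; DOCFIX D1 = the section locator of Theorem 14, §4.1 «the theorem» (TeX L1845–1847), mis-cited
«§3.4» in v1∕v1.1; INFO I3: the print's global «‖E_k‖_k» (L2694, L2761) is shorthand for ‖·‖_{k,κ} (L1333) — the module's one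
abstract norm per level; INFO I4: further Dimock-internal slips in the proof of Lemma 23 (2), records only — L2984 writes
«λ_{k−1}^{1/4−10ε}» in a level-k bound, L2969∕L2987 the subscript «k−1, κ» on E^*_{k−1} ∈ 𝒦_k, L2830 a stray «)», L3008
«satisfying of») — declarations and proofs byte-identical to v1.  v1.3 (unit `b2b-balaban-template` gen 98): APPEND-ONLY —
Part 5 (the regime theorems and the sanity instance listed above; Mathlib only, `open Filter Topology` locally); every
v1.2 declaration, docstring and proof byte-identical; the header gains the Part 5 bullet and this sentence.  v1.4 (same
seat): APPEND-ONLY — Part 6 (two theorems, Mathlib + this file); every v1.3 declaration, docstring and proof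
byte-identical; the header gains the Part 6 bullet and this sentence.  v1.5 (same seat): Part 5 REDUCED to
`StepBounds.zero` — the v1.3 regime theorems withdrawn as duplicates of the sibling leaf `SmallFieldFlowRegime` (E-TM98-2);
`open Filter Topology` dropped; Parts 1–4 and 6 byte-identical to v1.4.  v1.6 (unit `b2b-balaban-template` gen 99):
APPEND-ONLY — Part 7 (section `Tempered`: eight theorems and four private helpers, Mathlib + this file); every v1.5
declaration, docstring and proof byte-identical; the header gains the Part 7 bullet and this sentence.  v1.7 (same seat):
APPEND-ONLY — Part 8 (section `TemperedSharp`: four theorems, Mathlib + this file); every v1.6 declaration, docstring and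
proof byte-identical; the header gains the Part 8 bullet and this sentence.  v1.8 (same seat): (i) located
self-erratum E-TM99-1, DOCSTRING-ONLY: two Part 7∕8 docstrings (`muNext_sub_muNext_le`, `tempered₂_T_sub_T_le`) cited the
coefficient `L^{β−3/2}` to «TeX L2905» with a paraphrase inside quotation marks; the printed sentence is TeX L2921–2924
*"The first term is L^{β−3/2}[λ_{k+1}^{−½−β}|μ_{1,k+1} − μ_{2,k+1}|] ≤ L^{β−3/2}‖ξ₁ − ξ₂‖"*, now quoted verbatim;
(ii) APPEND-ONLY — Part 9 (section `Admissible`: four theorems, Mathlib + this file); every v1.7 declaration and proof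
byte-identical; the header gains the Part 9 bullet and this sentence.
-/

noncomputable section

open Real

namespace Literature.MathematicalPhysics.QuantumFieldTheory.Dimock2011to13.SmallFieldFlow

/-! ## Part 1. The single-step data and the printed bounds as hypothesis shapes -/

/-- THE SINGLE-STEP MAPS of the small-field RG flow of [Dimock2013] Theorem 14 (lanky), eq. (recursive) (TeX L1932–1939),
verbatim: *"ε_{k+1} = L³ε_k + 𝓛₁E_k + ε_k^*(λ_k, μ_k, E_k),  μ_{k+1} = L²μ_k + 𝓛₂E_k + μ_k^*(λ_k, μ_k, E_k),  λ_{k+1} = Lλ_k,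
E_{k+1} = 𝓛₃E_k + E^*_k(λ_k, μ_k, E_k)"*, *"where the 𝓛_i are linear operators"* (TeX L1940): the spaces of
normalized polymer activities `E k` (print: Re(𝒦_k^{norm}), TeX L1542–1545, one Banach space per level `k`), the linear
parts `L1 k, L2 k : E_k → ℝ`, `L3 k : E_k → E_{k+1}` and the higher-order parts `eps k, mus k : ℝ × E_k → ℝ`,
`Es k : ℝ × E_k → E_{k+1}` (the dependence on `λ_k` is a parameter, *"We continue to treat λ_k as a parameter, not a
dynamical variable"*, TeX L2747).  ABSTRACT DATA: nothing of the construction of these maps (the fluctuation integral,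
§4) is formalised. [cite: Dimock2013, Theorem 14 eq. (recursive) (arXiv:1108.1335v2 TeX L1924–1952)] -/
structure StepMaps (E : ℕ → Type*) [∀ k, NormedAddCommGroup (E k)] [∀ k, NormedSpace ℝ (E k)] where
  /-- `𝓛₁ : E_k → ℝ` (vacuum-energy part) -/
  L1 : (k : ℕ) → E k →L[ℝ] ℝ
  /-- `𝓛₂ : E_k → ℝ` (mass part) -/
  L2 : (k : ℕ) → E k →L[ℝ] ℝ
  /-- `𝓛₃ : E_k → E_{k+1}` -/
  L3 : (k : ℕ) → E k →L[ℝ] E (k + 1)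
  /-- `ε_k^*(μ_k, E_k)` -/
  eps : (k : ℕ) → ℝ → E k → ℝ
  /-- `μ_k^*(μ_k, E_k)` -/
  mus : (k : ℕ) → ℝ → E k → ℝ
  /-- `E_k^*(μ_k, E_k)` -/
  Es : (k : ℕ) → ℝ → E k → E (k + 1)

variable {E : ℕ → Type*} [∀ k, NormedAddCommGroup (E k)] [∀ k, NormedSpace ℝ (E k)]

/-- **THE BOUNDS OF THEOREM 14 (lanky) AND LEMMA 22 (smooth) as hypothesis shapes, in the form the flow proof uses them**
(TeX L2863–2864: *"We use the bounds of theorem 14 for 𝓛₂, 𝓛₃ (replacing 𝒪(1)L^{−ε} by 1) and for μ_k^*, E_k^*"*).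
Theorem 14, verbatim (TeX L1925–1951): *"Let L, M be sufficiently large, let λ_k be sufficiently small (depending on L, M).
Suppose ρ_k(Φ_k) has the representation (basic)–(basic3) for Φ_k ∈ 𝒮_k and |μ_k| ≤ λ_k^{1/2}, ‖E_k‖_{k,κ} ≤ 1. Then …
|𝓛₁E_k| ≤ 𝒪(1)L^{−ε}‖E_k‖_{k,κ}, |𝓛₂E_k| ≤ 𝒪(1)L^{−ε}λ_k^{1/2+6ε}‖E_k‖_{k,κ}, ‖𝓛₃E_k‖_{k+1,κ} ≤ 𝒪(1)L^{−ε}‖E_k‖_{k,κ} and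
where |ε_k^*| ≤ 𝒪(1)L³λ_k^{1/4−10ε}, |μ_k^*| ≤ 𝒪(1)L³λ_k^{3/4−4ε}, ‖E^*_k‖_{k+1,κ} ≤ 𝒪(1)L³λ_k^{1/4−10ε}"*; Lemma 22,
verbatim (TeX L2693–2703): *"In the region |μ_k| ≤ ½λ_k^{1/2} and ‖E_k‖_k ≤ ½ we have |∂μ_k^*/∂μ_k| ≤ 𝒪(1)L³λ_k^{1/4−4ε},
‖∂μ_k^*/∂E_k‖ ≤ 𝒪(1)L³λ_k^{3/4−4ε}, |∂E_k^*/∂μ_k| ≤ 𝒪(1)L³λ_k^{−1/4−10ε}, ‖∂E_k^*/∂E_k‖ ≤ 𝒪(1)L³λ_k^{1/4−10ε}"*.  TYPED: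
`𝒪(1) ↦ A`; the derivative bounds of Lemma 22 in the two-point LIPSCHITZ form on the (convex) half-region, which is how the
flow proof consumes them (TeX L2931–2955 and L2972–2994: *"we write with μ(t) = tμ_{1,k} + (1−t)μ_{2,k} and E(t) = tE_{1,k} +
(1−t)E_{2,k} … ∫₀¹ ∂μ^*_k/∂μ_k(μ(t), E_{1,k})(μ_{1,k} − μ_{2,k}) dt + …"*; reading (ii) of the header).  NOT asserted: these
are the outputs of [Dimock2013] §4 (the fluctuation integral) and §4.9 (Cauchy bounds). [cite: Dimock2013, Theorem 14 and Lemma 22 (arXiv:1108.1335v2 TeX L1924–1952, L2693–2703)] -/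
structure StepBounds (S : StepMaps E) (lam : ℕ → ℝ) (Lr A eps : ℝ) : Prop where
  /-- `|𝓛₁E_k| ≤ ‖E_k‖` -/
  L1_le : ∀ k (e : E k), |S.L1 k e| ≤ ‖e‖
  /-- `|𝓛₂E_k| ≤ λ_k^{1/2+6ε}‖E_k‖` -/
  L2_le : ∀ k (e : E k), |S.L2 k e| ≤ lam k ^ (1 / 2 + 6 * eps) * ‖e‖
  /-- `‖𝓛₃E_k‖ ≤ ‖E_k‖` -/
  L3_le : ∀ k (e : E k), ‖S.L3 k e‖ ≤ ‖e‖
  /-- `|ε_k^*| ≤ 𝒪(1)L³λ_k^{1/4−10ε}` on the region of Theorem 14 -/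
  eps_le : ∀ k (μ : ℝ) (e : E k), |μ| ≤ lam k ^ (1 / 2 : ℝ) → ‖e‖ ≤ 1 →
    |S.eps k μ e| ≤ A * Lr ^ 3 * lam k ^ (1 / 4 - 10 * eps)
  /-- `|μ_k^*| ≤ 𝒪(1)L³λ_k^{3/4−4ε}` on the region of Theorem 14 -/
  mus_le : ∀ k (μ : ℝ) (e : E k), |μ| ≤ lam k ^ (1 / 2 : ℝ) → ‖e‖ ≤ 1 →
    |S.mus k μ e| ≤ A * Lr ^ 3 * lam k ^ (3 / 4 - 4 * eps)
  /-- `‖E_k^*‖ ≤ 𝒪(1)L³λ_k^{1/4−10ε}` on the region of Theorem 14 -/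
  Es_le : ∀ k (μ : ℝ) (e : E k), |μ| ≤ lam k ^ (1 / 2 : ℝ) → ‖e‖ ≤ 1 →
    ‖S.Es k μ e‖ ≤ A * Lr ^ 3 * lam k ^ (1 / 4 - 10 * eps)
  /-- Lemma 22 for `μ_k^*`, Lipschitz form on the half-region -/
  mus_lip : ∀ k (μ₁ μ₂ : ℝ) (e₁ e₂ : E k), |μ₁| ≤ lam k ^ (1 / 2 : ℝ) / 2 → |μ₂| ≤ lam k ^ (1 / 2 : ℝ) / 2 →
    ‖e₁‖ ≤ 1 / 2 → ‖e₂‖ ≤ 1 / 2 →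
    |S.mus k μ₁ e₁ - S.mus k μ₂ e₂| ≤
      A * Lr ^ 3 * lam k ^ (1 / 4 - 4 * eps) * |μ₁ - μ₂| + A * Lr ^ 3 * lam k ^ (3 / 4 - 4 * eps) * ‖e₁ - e₂‖
  /-- Lemma 22 for `E_k^*`, Lipschitz form on the half-region -/
  Es_lip : ∀ k (μ₁ μ₂ : ℝ) (e₁ e₂ : E k), |μ₁| ≤ lam k ^ (1 / 2 : ℝ) / 2 → |μ₂| ≤ lam k ^ (1 / 2 : ℝ) / 2 →
    ‖e₁‖ ≤ 1 / 2 → ‖e₂‖ ≤ 1 / 2 →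
    ‖S.Es k μ₁ e₁ - S.Es k μ₂ e₂‖ ≤
      A * Lr ^ 3 * lam k ^ (-1 / 4 - 10 * eps) * |μ₁ - μ₂| + A * Lr ^ 3 * lam k ^ (1 / 4 - 10 * eps) * ‖e₁ - e₂‖

/-- **THE PARAMETER CONDITIONS OF §5, EXPLICIT** — the scale recursion `λ_{k+1} = Lλ_k` (TeX L1936) and every *"for L
large"* / *"for λ_k small"* the printed proof invokes, each as a named inequality required at all levels `k ≤ K`:
`j1`–`j3` = TeX L2880–2883 (*"Here we use that L^{β−3/2} ≤ 1/4 for L large, … that L^{−2}λ_k^{6ε} ≤ 1/4, … and that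
𝒪(1)Lλ_k^{1/4−β−4ε} ≤ 1/2 for λ_k small (depending on L)"*); `e1`–`e2` = TeX L2885–2894 (*"for L sufficiently large …
≤ L^{−β}[λ_{k−1}^{−β}‖E_{k−1}‖] + 𝒪(1)L^{3−β}λ_{k−1}^{1/4−β−10ε} ≤ ½(‖ξ‖ + 1)"*); `c1` = TeX L2956 (*"Altogether then for L
large and λ_k small λ_k^{−½−β}|μ′_{1,k} − μ′_{2,k}| ≤ ½‖ξ₁ − ξ₂‖"*); `c2` = TeX L2995; `half` = the tacit condition putting the
candidate solutions `|μ_k| ≤ λ_k^{1/2+β}`, `‖E_k‖ ≤ λ_k^β` inside the half-region of Lemma 22 (`λ_k^β ≤ ½`); `β_pos` from TeX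
L2801–2804 *"Pick a fixed β satisfying 0 < β < 1/4 − 10ε"* (the upper bound is not a field: for the flow it only makes
the conditions satisfiable; it is the explicit hypothesis `hβ` of Part 4's `vacuumEnergy_step` ∕ `vacuumEnergy_of_flow`,
where the print uses it, TeX L3034). [cite: Dimock2013, §5 (arXiv:1108.1335v2 TeX L2801–2804, L2880–2894, L2956, L2995)] -/
structure FlowSmall (lam : ℕ → ℝ) (Lr A eps β : ℝ) (K : ℕ) : Prop where
  /-- `L > 0` (in print `L` is a large positive integer) -/
  Lr_pos : 0 < Lr
  /-- the `𝒪(1)` of Theorem 14 / Lemma 22 is non-negative -/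
  A_nonneg : 0 ≤ A
  /-- `β > 0` -/
  β_pos : 0 < β
  /-- `λ_k > 0` -/
  lam_pos : ∀ k, 0 < lam k
  /-- `λ_{k+1} = L λ_k` -/
  lam_succ : ∀ k, lam (k + 1) = Lr * lam k
  /-- `λ_k ≤ 1` for `k ≤ K` -/
  lam_le_one : ∀ k, k ≤ K → lam k ≤ 1
  /-- `λ_k^β ≤ ½` for `k ≤ K` (the candidates lie in Lemma 22's half-region) -/
  half : ∀ k, k ≤ K → lam k ^ β ≤ 1 / 2
  /-- *"L^{β−3/2} ≤ 1/4 for L large"* -/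
  j1 : Lr ^ (β - 3 / 2) ≤ 1 / 4
  /-- *"L^{−2}λ_k^{6ε} ≤ 1/4"* -/
  j2 : ∀ k, k ≤ K → (Lr ^ 2)⁻¹ * lam k ^ (6 * eps) ≤ 1 / 4
  /-- *"𝒪(1)Lλ_k^{1/4−β−4ε} ≤ 1/2 for λ_k small (depending on L)"* -/
  j3 : ∀ k, k ≤ K → A * Lr * lam k ^ (1 / 4 - β - 4 * eps) ≤ 1 / 2
  /-- `L^{−β} ≤ ½` (*"for L sufficiently large"*) -/
  e1 : Lr ^ (-β) ≤ 1 / 2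
  /-- `𝒪(1)L^{3−β}λ_k^{1/4−β−10ε} ≤ ½` -/
  e2 : ∀ k, k ≤ K → A * Lr ^ (3 - β) * lam k ^ (1 / 4 - β - 10 * eps) ≤ 1 / 2
  /-- the μ-contraction: `L^{β−3/2} + L^{−2}λ_k^{6ε} + 2·𝒪(1)Lλ_k^{1/4−4ε} ≤ ½` -/
  c1 : ∀ k, k ≤ K →
    Lr ^ (β - 3 / 2) + (Lr ^ 2)⁻¹ * lam k ^ (6 * eps) + 2 * (A * Lr * lam k ^ (1 / 4 - 4 * eps)) ≤ 1 / 2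
  /-- the E-contraction: `L^{−β} + 2·𝒪(1)L^{3−β}λ_k^{1/4−10ε} ≤ ½` -/
  c2 : ∀ k, k ≤ K → Lr ^ (-β) + 2 * (A * Lr ^ (3 - β) * lam k ^ (1 / 4 - 10 * eps)) ≤ 1 / 2

namespace FlowSmall

variable {lam : ℕ → ℝ} {Lr A eps β : ℝ} {K : ℕ}

/-- the μ-weight `λ_k^{1/2+β}` and the E-weight `λ_k^β` are positive. [folklore] -/
theorem wpos (h : FlowSmall lam Lr A eps β K) (k : ℕ) (s : ℝ) : 0 < lam k ^ s :=
  Real.rpow_pos_of_pos (h.lam_pos k) s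

/-- `λ_{k+1}^s = L^s λ_k^s`. [folklore] -/
theorem succ_rpow (h : FlowSmall lam Lr A eps β K) (k : ℕ) (s : ℝ) :
    lam (k + 1) ^ s = Lr ^ s * lam k ^ s := by
  rw [h.lam_succ, Real.mul_rpow h.Lr_pos.le (h.lam_pos k).le]

/-- `λ_k^{1/2+β} ≤ ½ λ_k^{1/2}` for `k ≤ K` (the μ-candidates lie in Lemma 22's half-region). [folklore] -/
theorem w_le_half_sqrt (h : FlowSmall lam Lr A eps β K) {k : ℕ} (hk : k ≤ K) :
    lam k ^ (1 / 2 + β) ≤ lam k ^ (1 / 2 : ℝ) / 2 := by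
  rw [Real.rpow_add (h.lam_pos k)]
  have := h.half k hk
  have h0 : 0 < lam k ^ (1 / 2 : ℝ) := h.wpos k _
  nlinarith

/-- `λ_k^{1/2+β} ≤ λ_k^{1/2}` for `k ≤ K`. [folklore] -/
theorem w_le_sqrt (h : FlowSmall lam Lr A eps β K) {k : ℕ} (hk : k ≤ K) :
    lam k ^ (1 / 2 + β) ≤ lam k ^ (1 / 2 : ℝ) := by
  have := h.w_le_half_sqrt hk
  have h0 : 0 < lam k ^ (1 / 2 : ℝ) := h.wpos k _
  linarith

/-- `λ_k^β ≤ 1` for `k ≤ K`. [folklore] -/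
theorem u_le_one (h : FlowSmall lam Lr A eps β K) {k : ℕ} (hk : k ≤ K) : lam k ^ β ≤ 1 := by
  linarith [h.half k hk]

/-- rpow bookkeeping (a): `(L² λ_k^{1/2+β})⁻¹ · λ_{k+1}^{1/2+β} = L^{β−3/2}`. [folklore] -/
theorem ident_a (h : FlowSmall lam Lr A eps β K) (k : ℕ) :
    (Lr ^ 2 * lam k ^ (1 / 2 + β))⁻¹ * lam (k + 1) ^ (1 / 2 + β) = Lr ^ (β - 3 / 2) := by
  have hw : 0 < lam k ^ (1 / 2 + β) := h.wpos k _
  have hL := h.Lr_pos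
  rw [h.succ_rpow k]
  have e : Lr ^ (β - 3 / 2) = Lr ^ (1 / 2 + β) / Lr ^ (2 : ℝ) := by
    rw [← Real.rpow_sub hL]; congr 1; ring
  rw [e, Real.rpow_two]
  calc (Lr ^ 2 * lam k ^ (1 / 2 + β))⁻¹ * (Lr ^ (1 / 2 + β) * lam k ^ (1 / 2 + β))
      = Lr ^ (1 / 2 + β) / Lr ^ 2 * ((lam k ^ (1 / 2 + β))⁻¹ * lam k ^ (1 / 2 + β)) := by
        rw [mul_inv]; ring
    _ = Lr ^ (1 / 2 + β) / Lr ^ 2 := by rw [inv_mul_cancel₀ hw.ne', mul_one]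

/-- rpow bookkeeping (b): `(L² λ_k^{1/2+β})⁻¹ · λ_k^{1/2+6ε} · λ_k^β = L^{−2} λ_k^{6ε}`. [folklore] -/
theorem ident_b (h : FlowSmall lam Lr A eps β K) (k : ℕ) :
    (Lr ^ 2 * lam k ^ (1 / 2 + β))⁻¹ * (lam k ^ (1 / 2 + 6 * eps) * lam k ^ β)
      = (Lr ^ 2)⁻¹ * lam k ^ (6 * eps) := by
  have hl := h.lam_pos k
  have hw : 0 < lam k ^ (1 / 2 + β) := h.wpos k _
  have hL : 0 < Lr ^ 2 := pow_pos h.Lr_pos 2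
  have e : lam k ^ (1 / 2 + 6 * eps) * lam k ^ β = lam k ^ (1 / 2 + β) * lam k ^ (6 * eps) := by
    rw [← Real.rpow_add hl, ← Real.rpow_add hl]; congr 1; ring
  rw [e]
  field_simp

/-- rpow bookkeeping (c): `(L² λ_k^{1/2+β})⁻¹ · 𝒪(1) L³ λ_k^{3/4−4ε} = 𝒪(1) L λ_k^{1/4−β−4ε}`. [folklore] -/
theorem ident_c (h : FlowSmall lam Lr A eps β K) (k : ℕ) :
    (Lr ^ 2 * lam k ^ (1 / 2 + β))⁻¹ * (A * Lr ^ 3 * lam k ^ (3 / 4 - 4 * eps))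
      = A * Lr * lam k ^ (1 / 4 - β - 4 * eps) := by
  have hl := h.lam_pos k
  have hw : 0 < lam k ^ (1 / 2 + β) := h.wpos k _
  have hL : 0 < Lr := h.Lr_pos
  have e : lam k ^ (3 / 4 - 4 * eps) = lam k ^ (1 / 2 + β) * lam k ^ (1 / 4 - β - 4 * eps) := by
    rw [← Real.rpow_add hl]; congr 1; ring
  rw [e]
  field_simp

/-- rpow bookkeeping (d): `(λ_{k+1}^β)⁻¹ · λ_k^β = L^{−β}`. [folklore] -/
theorem ident_d (h : FlowSmall lam Lr A eps β K) (k : ℕ) :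
    (lam (k + 1) ^ β)⁻¹ * lam k ^ β = Lr ^ (-β) := by
  have hu : 0 < lam k ^ β := h.wpos k _
  have hL := h.Lr_pos
  rw [h.succ_rpow k, Real.rpow_neg hL.le]
  field_simp

/-- rpow bookkeeping (e): `(λ_{k+1}^β)⁻¹ · 𝒪(1) L³ λ_k^{1/4−10ε} = 𝒪(1) L^{3−β} λ_k^{1/4−β−10ε}`. [folklore] -/
theorem ident_e (h : FlowSmall lam Lr A eps β K) (k : ℕ) :
    (lam (k + 1) ^ β)⁻¹ * (A * Lr ^ 3 * lam k ^ (1 / 4 - 10 * eps))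
      = A * Lr ^ (3 - β) * lam k ^ (1 / 4 - β - 10 * eps) := by
  have hl := h.lam_pos k
  have hu : 0 < lam k ^ β := h.wpos k _
  have hL := h.Lr_pos
  rw [h.succ_rpow k]
  have e1 : lam k ^ (1 / 4 - 10 * eps) = lam k ^ β * lam k ^ (1 / 4 - β - 10 * eps) := by
    rw [← Real.rpow_add hl]; congr 1; ring
  have e2 : Lr ^ (3 - β) = Lr ^ (3 : ℝ) / Lr ^ β := by rw [← Real.rpow_sub hL]
  have e3 : Lr ^ (3 : ℝ) = Lr ^ 3 := by exact_mod_cast Real.rpow_natCast Lr 3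
  rw [e1, e2, e3]
  have hLβ : 0 < Lr ^ β := Real.rpow_pos_of_pos hL β
  field_simp

/-- rpow bookkeeping (e′): `(λ_{k+1}^β)⁻¹ · 𝒪(1) L³ λ_k^{−1/4−10ε} · λ_k^{1/2+β} = 𝒪(1) L^{3−β} λ_k^{1/4−10ε}`. [folklore] -/
theorem ident_e' (h : FlowSmall lam Lr A eps β K) (k : ℕ) :
    (lam (k + 1) ^ β)⁻¹ * (A * Lr ^ 3 * lam k ^ (-1 / 4 - 10 * eps) * lam k ^ (1 / 2 + β))
      = A * Lr ^ (3 - β) * lam k ^ (1 / 4 - 10 * eps) := by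
  have hl := h.lam_pos k
  have hu : 0 < lam k ^ β := h.wpos k _
  have hL := h.Lr_pos
  rw [h.succ_rpow k]
  have e1 : lam k ^ (-1 / 4 - 10 * eps) * lam k ^ (1 / 2 + β) = lam k ^ β * lam k ^ (1 / 4 - 10 * eps) := by
    rw [← Real.rpow_add hl, ← Real.rpow_add hl]; congr 1; ring
  have e2 : Lr ^ (3 - β) = Lr ^ (3 : ℝ) / Lr ^ β := by rw [← Real.rpow_sub hL]
  have e3 : Lr ^ (3 : ℝ) = Lr ^ 3 := by exact_mod_cast Real.rpow_natCast Lr 3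
  rw [mul_assoc (A * Lr ^ 3), e1, e2, e3]
  have hLβ : 0 < Lr ^ β := Real.rpow_pos_of_pos hL β
  field_simp

/-- rpow bookkeeping (c′): `(L² λ_k^{1/2+β})⁻¹ · 𝒪(1) L³ λ_k^{1/4−4ε} · λ_k^{1/2+β} = 𝒪(1) L λ_k^{1/4−4ε}` and
`(L² λ_k^{1/2+β})⁻¹ · 𝒪(1) L³ λ_k^{3/4−4ε} · λ_k^{β} = 𝒪(1) L λ_k^{1/4−4ε}`. [folklore] -/
theorem ident_c' (h : FlowSmall lam Lr A eps β K) (k : ℕ) :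
    (Lr ^ 2 * lam k ^ (1 / 2 + β))⁻¹ * (A * Lr ^ 3 * lam k ^ (1 / 4 - 4 * eps) * lam k ^ (1 / 2 + β))
      = A * Lr * lam k ^ (1 / 4 - 4 * eps) ∧
    (Lr ^ 2 * lam k ^ (1 / 2 + β))⁻¹ * (A * Lr ^ 3 * lam k ^ (3 / 4 - 4 * eps) * lam k ^ β)
      = A * Lr * lam k ^ (1 / 4 - 4 * eps) := by
  have hl := h.lam_pos k
  have hw : 0 < lam k ^ (1 / 2 + β) := h.wpos k _
  have hL : 0 < Lr := h.Lr_pos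
  constructor
  · field_simp
  · have e : lam k ^ (3 / 4 - 4 * eps) * lam k ^ β = lam k ^ (1 / 4 - 4 * eps) * lam k ^ (1 / 2 + β) := by
      rw [← Real.rpow_add hl, ← Real.rpow_add hl]; congr 1; ring
    rw [mul_assoc (A * Lr ^ 3), e]
    field_simp

/-- rpow bookkeeping (f): `(λ_{k+1}^β)⁻¹ · 𝒪(1) L³ λ_k^{1/4−10ε} · λ_k^β = 𝒪(1) L^{3−β} λ_k^{1/4−10ε}`. [folklore] -/
theorem ident_f (h : FlowSmall lam Lr A eps β K) (k : ℕ) :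
    (lam (k + 1) ^ β)⁻¹ * (A * Lr ^ 3 * lam k ^ (1 / 4 - 10 * eps) * lam k ^ β)
      = A * Lr ^ (3 - β) * lam k ^ (1 / 4 - 10 * eps) := by
  have hu : 0 < lam k ^ β := h.wpos k _
  have hL := h.Lr_pos
  rw [h.succ_rpow k]
  have e2 : Lr ^ (3 - β) = Lr ^ (3 : ℝ) / Lr ^ β := by rw [← Real.rpow_sub hL]
  have e3 : Lr ^ (3 : ℝ) = Lr ^ 3 := by exact_mod_cast Real.rpow_natCast Lr 3
  rw [e2, e3]
  have hLβ : 0 < Lr ^ β := Real.rpow_pos_of_pos hL β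
  field_simp

end FlowSmall


/-! ## Part 2. The sequence space 𝖡, the map T of (recursive5), `T(𝖡₁) ⊆ 𝖡₁`, and the contraction by ½ -/

section TheMap

variable {E : ℕ → Type*} [∀ k, NormedAddCommGroup (E k)] [∀ k, NormedSpace ℝ (E k)]

/-- THE BANACH SPACE 𝖡 of [Dimock2013] §5 (TeX L2796–2811), verbatim: *"Let ξ_k = (μ_k, E_k) be an element of the real
Banach space ℝ × Re(𝒦_k^{norm}) and consider sequences ξ = (ξ₀, …, ξ_K) … let 𝖡 be the Banach space of all such
sequences with norm ‖ξ‖ = sup_{0≤k≤K} {λ_k^{−½−β}|μ_k|, λ_k^{−β}‖E_k‖_{k,κ}}"* — realised in RESCALED coordinates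
`m_k = λ_k^{−½−β}μ_k`, `e_k = λ_k^{−β}E_k`, so that the printed norm is the sup–max norm of Mathlib's product/pi
instances (complete when every `E k` is). [cite: Dimock2013, §5 (arXiv:1108.1335v2 TeX L2796–2811)] -/
abbrev Seq (K : ℕ) (E : ℕ → Type*) [∀ k, NormedAddCommGroup (E k)] [∀ k, NormedSpace ℝ (E k)] : Type _ :=
  (k : Fin (K + 1)) → ℝ × E k.val

/-- `|m_k| ≤ ‖ξ‖`. [folklore] -/
theorem abs_fst_le {K : ℕ} (ξ : Seq K E) (k : Fin (K + 1)) : |(ξ k).1| ≤ ‖ξ‖ := by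
  rw [← Real.norm_eq_abs]
  exact (norm_fst_le (ξ k)).trans (norm_le_pi_norm ξ k)

/-- `‖e_k‖ ≤ ‖ξ‖`. [folklore] -/
theorem norm_snd_le' {K : ℕ} (ξ : Seq K E) (k : Fin (K + 1)) : ‖(ξ k).2‖ ≤ ‖ξ‖ :=
  (norm_snd_le (ξ k)).trans (norm_le_pi_norm ξ k)

variable (S : StepMaps E) (lam : ℕ → ℝ) (Lr β : ℝ) (K : ℕ)

/-- The level `j` of `Fin K` seen in `Fin (K+1)` (= `j.castSucc`, spelled so that `(prev j).val` is `j.val` by `rfl`). [folklore] -/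
def prev {K : ℕ} (j : Fin K) : Fin (K + 1) := ⟨j.val, Nat.lt_succ_of_lt j.isLt⟩

/-- `(prev j).val = j`. [folklore] -/
theorem prev_val {K : ℕ} (j : Fin K) : (prev j).val = j.val := rfl

/-- `j.succ = ⟨(prev j) + 1, _⟩` in `Fin (K+1)`. [folklore] -/
theorem succ_eq_mk {K : ℕ} (j : Fin K) : j.succ = ⟨(prev j).val + 1, Nat.succ_lt_succ j.isLt⟩ := rfl

/-- THE μ-COMPONENT OF T, eq. (recursive5) (TeX L2827–2832), verbatim: *"μ′_k = L^{−2}(μ_{k+1} − 𝓛₂E_k − μ_k^*)"* for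
`k = 0, …, K−1`, and `μ′_K = 0` (the boundary condition (bc) `μ_K = 0`, TeX L2777–2779) — in rescaled coordinates.
[cite: Dimock2013, §5 eq. (recursive5) (arXiv:1108.1335v2 TeX L2827–2832)] -/
def muNext (ξ : Seq K E) (k : Fin (K + 1)) : ℝ :=
  if hk : k.val + 1 < K + 1 then
    (Lr ^ 2 * lam k.val ^ (1 / 2 + β))⁻¹ *
      (lam (k.val + 1) ^ (1 / 2 + β) * (ξ ⟨k.val + 1, hk⟩).1
        - S.L2 k.val (lam k.val ^ β • (ξ k).2)
        - S.mus k.val (lam k.val ^ (1 / 2 + β) * (ξ k).1) (lam k.val ^ β • (ξ k).2))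
  else 0

/-- THE E-COMPONENT OF T, eq. (recursive5), verbatim: *"E′_k = 𝓛₃E_{k−1} + E^*_{k−1}"* for `k = 1, …, K`, and `E′₀ = 0`
(the boundary condition (bc) `E₀ = 0`) — in rescaled coordinates. [cite: Dimock2013, §5 eq. (recursive5) (arXiv:1108.1335v2 TeX L2827–2832)] -/
def eNext (ξ : Seq K E) : (k : Fin (K + 1)) → E k.val :=
  Fin.cases (motive := fun k => E k.val) (0 : E 0) fun j =>
    (lam ((prev j).val + 1) ^ β)⁻¹ •
      (S.L3 (prev j).val (lam (prev j).val ^ β • (ξ (prev j)).2)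
        + S.Es (prev j).val (lam (prev j).val ^ (1 / 2 + β) * (ξ (prev j)).1)
            (lam (prev j).val ^ β • (ξ (prev j)).2))

/-- THE MAP T of (recursive5): *"Then ξ is a solution of (bc), (recursive4) iff it is a fixed point for T on 𝖡₀"* (TeX
L2833–2834). [cite: Dimock2013, §5 eq. (recursive5) (arXiv:1108.1335v2 TeX L2827–2834)] -/
def T (ξ : Seq K E) : Seq K E := fun k => (muNext S lam Lr β K ξ k, eNext S lam β K ξ k)

variable {S lam Lr β K}

/-- `E′₀ = 0`. [folklore] -/
theorem eNext_zero (ξ : Seq K E) : eNext S lam β K ξ 0 = 0 := rfl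

/-- `E′_{j+1} = λ_{j+1}^{−β}(𝓛₃E_j + E_j^*)` in rescaled coordinates. [folklore] -/
theorem eNext_succ (ξ : Seq K E) (j : Fin K) :
    eNext S lam β K ξ j.succ = (lam ((prev j).val + 1) ^ β)⁻¹ •
      (S.L3 (prev j).val (lam (prev j).val ^ β • (ξ (prev j)).2)
        + S.Es (prev j).val (lam (prev j).val ^ (1 / 2 + β) * (ξ (prev j)).1)
            (lam (prev j).val ^ β • (ξ (prev j)).2)) := rfl

variable {A eps : ℝ}

/-- **LEMMA 23 (1): T MAPS THE CLOSED UNIT BALL 𝖡₁ INTO ITSELF** — [Dimock2013] Lemma 23 (TeX L2854–2860), item 1,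
verbatim: *"The transformation T maps the set 𝖡₁ to itself"*, proof (jelly) TeX L2863–2895: *"λ_k^{−½−β}|μ′_k| ≤
λ_k^{−½−β}L^{−2}(|μ_{k+1}| + λ_k^{1/2+6ε}‖E_k‖_{k,κ} + 𝒪(1)L³λ_k^{3/4−4ε}) ≤ L^{β−3/2}[λ_{k+1}^{−½−β}|μ_{k+1}|] +
L^{−2}λ_k^{1/4+6ε}[sic; = λ_k^{6ε}][λ_k^{−β}‖E_k‖_{k,κ}] + 𝒪(1)Lλ_k^{¼−β−4ε} ≤ ½(‖ξ‖ + 1) ≤ 1"* and *"λ_k^{−β}‖E′_k‖_{k,κ}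
≤ λ_k^{−β}(‖E_{k−1}‖_{k−1,κ} + 𝒪(1)L³λ_{k−1}^{1/4−10ε}) ≤ L^{−β}[λ_{k−1}^{−β}‖E_{k−1}‖_{k−1,κ}] + 𝒪(1)L^{3−β}
λ_{k−1}^{1/4−β−10ε} ≤ ½(‖ξ‖ + 1) ≤ 1"*.  (𝖡₁ is taken CLOSED, reading (iii).) [cite: Dimock2013, §5 Lemma 23 (1) (arXiv:1108.1335v2 TeX L2854–2895)] -/
theorem norm_T_le_one (hB : StepBounds S lam Lr A eps) (h : FlowSmall lam Lr A eps β K) {ξ : Seq K E}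
    (hξ : ‖ξ‖ ≤ 1) : ‖T S lam Lr β K ξ‖ ≤ 1 := by
  refine (pi_norm_le_iff_of_nonneg zero_le_one).2 fun k => ?_
  have hm : ∀ i, |(ξ i).1| ≤ 1 := fun i => (abs_fst_le ξ i).trans hξ
  have he : ∀ i, ‖(ξ i).2‖ ≤ 1 := fun i => (norm_snd_le' ξ i).trans hξ
  rw [T, Prod.norm_def, max_le_iff]
  constructor
  · -- the μ-component
    rw [Real.norm_eq_abs]
    unfold muNext
    split_ifs with hk
    · have hkK : k.val ≤ K := by omega
      set w := lam k.val ^ (1 / 2 + β) with hw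
      set u := lam k.val ^ β with hu
      have hwpos : 0 < w := h.wpos _ _
      have hupos : 0 < u := h.wpos _ _
      have hc : 0 < (Lr ^ 2 * w)⁻¹ := by have := h.Lr_pos; positivity
      have hue : ‖u • (ξ k).2‖ ≤ u := by
        rw [norm_smul, Real.norm_eq_abs, abs_of_pos hupos]
        exact mul_le_of_le_one_right hupos.le (he k)
      have hwm : |w * (ξ k).1| ≤ lam k.val ^ (1 / 2 : ℝ) := by
        rw [abs_mul, abs_of_pos hwpos]
        exact (mul_le_of_le_one_right hwpos.le (hm k)).trans (h.w_le_sqrt hkK)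
      have h1 : |lam (k.val + 1) ^ (1 / 2 + β) * (ξ ⟨k.val + 1, hk⟩).1| ≤ lam (k.val + 1) ^ (1 / 2 + β) := by
        rw [abs_mul, abs_of_pos (h.wpos _ _)]
        exact mul_le_of_le_one_right (h.wpos _ _).le (hm _)
      have h2 : |S.L2 k.val (u • (ξ k).2)| ≤ lam k.val ^ (1 / 2 + 6 * eps) * u :=
        (hB.L2_le _ _).trans (mul_le_mul_of_nonneg_left hue (h.wpos _ _).le)
      have h3 : |S.mus k.val (w * (ξ k).1) (u • (ξ k).2)| ≤ A * Lr ^ 3 * lam k.val ^ (3 / 4 - 4 * eps) :=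
        hB.mus_le _ _ _ hwm (hue.trans (h.u_le_one hkK))
      calc |(Lr ^ 2 * w)⁻¹ * (lam (k.val + 1) ^ (1 / 2 + β) * (ξ ⟨k.val + 1, hk⟩).1 - S.L2 k.val (u • (ξ k).2)
              - S.mus k.val (w * (ξ k).1) (u • (ξ k).2))|
          ≤ (Lr ^ 2 * w)⁻¹ * (lam (k.val + 1) ^ (1 / 2 + β) + lam k.val ^ (1 / 2 + 6 * eps) * u
              + A * Lr ^ 3 * lam k.val ^ (3 / 4 - 4 * eps)) := by
            rw [abs_mul, abs_of_pos hc]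
            refine mul_le_mul_of_nonneg_left ?_ hc.le
            exact (abs_sub _ _).trans (add_le_add ((abs_sub _ _).trans (add_le_add h1 h2)) h3)
        _ = Lr ^ (β - 3 / 2) + (Lr ^ 2)⁻¹ * lam k.val ^ (6 * eps) + A * Lr * lam k.val ^ (1 / 4 - β - 4 * eps) := by
            rw [mul_add, mul_add, hw, h.ident_a, hu, h.ident_b, h.ident_c]
        _ ≤ 1 / 4 + 1 / 4 + 1 / 2 := add_le_add (add_le_add h.j1 (h.j2 _ hkK)) (h.j3 _ hkK)
        _ = 1 := by norm_num
    · simp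
  · -- the E-component
    rcases Fin.eq_zero_or_eq_succ k with rfl | ⟨j, rfl⟩
    · rw [eNext_zero, norm_zero]; exact zero_le_one
    · have hjK : (prev j).val ≤ K := by show j.val ≤ K; omega
      rw [eNext_succ]
      set w := lam (prev j).val ^ (1 / 2 + β) with hw
      set u := lam (prev j).val ^ β with hu
      have hwpos : 0 < w := h.wpos _ _
      have hupos : 0 < u := h.wpos _ _
      have hu1 : 0 < lam ((prev j).val + 1) ^ β := h.wpos _ _
      set ξj := ξ (prev j) with hξj
      have hue : ‖u • ξj.2‖ ≤ u := by
        rw [norm_smul, Real.norm_eq_abs, abs_of_pos hupos]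
        exact mul_le_of_le_one_right hupos.le (he _)
      have hwm : |w * ξj.1| ≤ lam (prev j).val ^ (1 / 2 : ℝ) := by
        rw [abs_mul, abs_of_pos hwpos]
        exact (mul_le_of_le_one_right hwpos.le (hm _)).trans (h.w_le_sqrt hjK)
      have h1 : ‖S.L3 (prev j).val (u • ξj.2)‖ ≤ u := (hB.L3_le _ _).trans hue
      have h2 : ‖S.Es (prev j).val (w * ξj.1) (u • ξj.2)‖ ≤ A * Lr ^ 3 * lam (prev j).val ^ (1 / 4 - 10 * eps) :=
        hB.Es_le _ _ _ hwm (hue.trans (h.u_le_one hjK))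
      calc ‖(lam ((prev j).val + 1) ^ β)⁻¹ • (S.L3 (prev j).val (u • ξj.2) + S.Es (prev j).val (w * ξj.1) (u • ξj.2))‖
          ≤ (lam ((prev j).val + 1) ^ β)⁻¹ * (u + A * Lr ^ 3 * lam (prev j).val ^ (1 / 4 - 10 * eps)) := by
            rw [norm_smul, norm_inv, Real.norm_eq_abs, abs_of_pos hu1]
            exact mul_le_mul_of_nonneg_left ((norm_add_le _ _).trans (add_le_add h1 h2))
              (inv_nonneg.2 hu1.le)
        _ = Lr ^ (-β) + A * Lr ^ (3 - β) * lam (prev j).val ^ (1 / 4 - β - 10 * eps) := by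
            rw [mul_add, hu, h.ident_d, h.ident_e]
        _ ≤ 1 / 2 + 1 / 2 := add_le_add h.e1 (h.e2 _ hjK)
        _ = 1 := by norm_num

/-- **LEMMA 23 (2): T IS A CONTRACTION BY ½ ON 𝖡₁** — verbatim (TeX L2898–2904): *"By the standard fixed point theorem in a
complete metric space it suffices to show that the mapping is a contraction. We show that under our assumptions ‖T(ξ₁) −
T(ξ₂)‖ ≤ ½‖ξ₁ − ξ₂‖"*; proof TeX L2907–2997 (the μ terms: *"The first term is L^{β−3/2}[…] … The second term is L^{−2}λ_k^{6ε}[…]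
… For the last term we write with μ(t) = tμ_{1,k} + (1−t)μ_{2,k} … ≤ 𝒪(1)L³λ_k^{1/4−4ε}‖ξ₁ − ξ₂‖ … Altogether then for L
large and λ_k small λ_k^{−½−β}|μ′_{1,k} − μ′_{2,k}| ≤ ½‖ξ₁ − ξ₂‖"*; the E terms: *"The first term is bounded by
L^{−β}‖ξ₁ − ξ₂‖ … ≤ 𝒪(1)L^{3−β}λ_k^{1/4−10ε}‖ξ₁ − ξ₂‖ … Altogether then for L large and λ_k small we have
λ_k^{−β}‖E′_{1,k} − E′_{2,k}‖_{k,κ} ≤ ½‖ξ₁ − ξ₂‖ which completes the proof"*). [cite: Dimock2013, §5 Lemma 23 (2) (arXiv:1108.1335v2 TeX L2898–2999)] -/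
theorem norm_T_sub_T_le (hB : StepBounds S lam Lr A eps) (h : FlowSmall lam Lr A eps β K) {ξ η : Seq K E}
    (hξ : ‖ξ‖ ≤ 1) (hη : ‖η‖ ≤ 1) :
    ‖T S lam Lr β K ξ - T S lam Lr β K η‖ ≤ 1 / 2 * ‖ξ - η‖ := by
  set D := ‖ξ - η‖ with hD
  have hD0 : 0 ≤ D := norm_nonneg _
  refine (pi_norm_le_iff_of_nonneg (by positivity)).2 fun k => ?_
  have hmξ : ∀ i, |(ξ i).1| ≤ 1 := fun i => (abs_fst_le ξ i).trans hξ
  have heξ : ∀ i, ‖(ξ i).2‖ ≤ 1 := fun i => (norm_snd_le' ξ i).trans hξ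
  have hmη : ∀ i, |(η i).1| ≤ 1 := fun i => (abs_fst_le η i).trans hη
  have heη : ∀ i, ‖(η i).2‖ ≤ 1 := fun i => (norm_snd_le' η i).trans hη
  have hdm : ∀ i, |(ξ i).1 - (η i).1| ≤ D := fun i => by
    have := abs_fst_le (ξ - η) i
    simpa only [Pi.sub_apply, Prod.fst_sub] using this
  have hde : ∀ i, ‖(ξ i).2 - (η i).2‖ ≤ D := fun i => by
    have := norm_snd_le' (ξ - η) i
    simpa only [Pi.sub_apply, Prod.snd_sub] using this
  rw [Pi.sub_apply, T, T, Prod.mk_sub_mk, Prod.norm_def, max_le_iff]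
  constructor
  · -- the μ-component
    rw [Real.norm_eq_abs]
    unfold muNext
    split_ifs with hk
    · have hkK : k.val ≤ K := by omega
      set w := lam k.val ^ (1 / 2 + β) with hw
      set u := lam k.val ^ β with hu
      have hwpos : 0 < w := h.wpos _ _
      have hupos : 0 < u := h.wpos _ _
      have hc : 0 < (Lr ^ 2 * w)⁻¹ := by have := h.Lr_pos; positivity
      -- the region of Lemma 22
      have hwm : ∀ ζ : Seq K E, ‖ζ‖ ≤ 1 → |w * (ζ k).1| ≤ lam k.val ^ (1 / 2 : ℝ) / 2 := fun ζ hζ => by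
        rw [abs_mul, abs_of_pos hwpos]
        exact (mul_le_of_le_one_right hwpos.le ((abs_fst_le ζ k).trans hζ)).trans (h.w_le_half_sqrt hkK)
      have hue : ∀ ζ : Seq K E, ‖ζ‖ ≤ 1 → ‖u • (ζ k).2‖ ≤ 1 / 2 := fun ζ hζ => by
        rw [norm_smul, Real.norm_eq_abs, abs_of_pos hupos]
        exact (mul_le_of_le_one_right hupos.le ((norm_snd_le' ζ k).trans hζ)).trans (h.half _ hkK)
      have h1 : |lam (k.val + 1) ^ (1 / 2 + β) * (ξ ⟨k.val + 1, hk⟩).1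
          - lam (k.val + 1) ^ (1 / 2 + β) * (η ⟨k.val + 1, hk⟩).1| ≤ lam (k.val + 1) ^ (1 / 2 + β) * D := by
        rw [← mul_sub, abs_mul, abs_of_pos (h.wpos _ _)]
        exact mul_le_mul_of_nonneg_left (hdm _) (h.wpos _ _).le
      have h2 : |S.L2 k.val (u • (ξ k).2) - S.L2 k.val (u • (η k).2)| ≤ lam k.val ^ (1 / 2 + 6 * eps) * u * D := by
        rw [← map_sub, ← smul_sub]
        refine (hB.L2_le _ _).trans ?_
        rw [norm_smul, Real.norm_eq_abs, abs_of_pos hupos, mul_assoc]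
        exact mul_le_mul_of_nonneg_left (mul_le_mul_of_nonneg_left (hde k) hupos.le) (h.wpos _ _).le
      have h3 : |S.mus k.val (w * (ξ k).1) (u • (ξ k).2) - S.mus k.val (w * (η k).1) (u • (η k).2)|
          ≤ A * Lr ^ 3 * lam k.val ^ (1 / 4 - 4 * eps) * w * D
            + A * Lr ^ 3 * lam k.val ^ (3 / 4 - 4 * eps) * u * D := by
        refine (hB.mus_lip _ _ _ _ _ (hwm ξ hξ) (hwm η hη) (hue ξ hξ) (hue η hη)).trans ?_
        rw [← mul_sub, abs_mul, abs_of_pos hwpos, ← smul_sub, norm_smul, Real.norm_eq_abs, abs_of_pos hupos]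
        have hA3 : 0 ≤ A * Lr ^ 3 := by have := h.A_nonneg; have := h.Lr_pos; positivity
        have i1 : A * Lr ^ 3 * lam k.val ^ (1 / 4 - 4 * eps) * (w * |(ξ k).1 - (η k).1|)
            ≤ A * Lr ^ 3 * lam k.val ^ (1 / 4 - 4 * eps) * w * D := by
          rw [mul_assoc (A * Lr ^ 3 * lam k.val ^ (1 / 4 - 4 * eps)) w D]
          exact mul_le_mul_of_nonneg_left (mul_le_mul_of_nonneg_left (hdm k) hwpos.le)
            (mul_nonneg hA3 (h.wpos _ _).le)
        have i2 : A * Lr ^ 3 * lam k.val ^ (3 / 4 - 4 * eps) * (u * ‖(ξ k).2 - (η k).2‖)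
            ≤ A * Lr ^ 3 * lam k.val ^ (3 / 4 - 4 * eps) * u * D := by
          rw [mul_assoc (A * Lr ^ 3 * lam k.val ^ (3 / 4 - 4 * eps)) u D]
          exact mul_le_mul_of_nonneg_left (mul_le_mul_of_nonneg_left (hde k) hupos.le)
            (mul_nonneg hA3 (h.wpos _ _).le)
        exact add_le_add i1 i2
      have key : |(Lr ^ 2 * w)⁻¹ * (lam (k.val + 1) ^ (1 / 2 + β) * (ξ ⟨k.val + 1, hk⟩).1
            - S.L2 k.val (u • (ξ k).2) - S.mus k.val (w * (ξ k).1) (u • (ξ k).2))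
          - (Lr ^ 2 * w)⁻¹ * (lam (k.val + 1) ^ (1 / 2 + β) * (η ⟨k.val + 1, hk⟩).1
            - S.L2 k.val (u • (η k).2) - S.mus k.val (w * (η k).1) (u • (η k).2))|
          ≤ (Lr ^ (β - 3 / 2) + (Lr ^ 2)⁻¹ * lam k.val ^ (6 * eps)
              + 2 * (A * Lr * lam k.val ^ (1 / 4 - 4 * eps))) * D := by
        rw [← mul_sub, abs_mul, abs_of_pos hc]
        have hsplit : (lam (k.val + 1) ^ (1 / 2 + β) * (ξ ⟨k.val + 1, hk⟩).1 - S.L2 k.val (u • (ξ k).2)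
              - S.mus k.val (w * (ξ k).1) (u • (ξ k).2))
            - (lam (k.val + 1) ^ (1 / 2 + β) * (η ⟨k.val + 1, hk⟩).1 - S.L2 k.val (u • (η k).2)
              - S.mus k.val (w * (η k).1) (u • (η k).2))
            = (lam (k.val + 1) ^ (1 / 2 + β) * (ξ ⟨k.val + 1, hk⟩).1
                - lam (k.val + 1) ^ (1 / 2 + β) * (η ⟨k.val + 1, hk⟩).1)
              - (S.L2 k.val (u • (ξ k).2) - S.L2 k.val (u • (η k).2))
              - (S.mus k.val (w * (ξ k).1) (u • (ξ k).2) - S.mus k.val (w * (η k).1) (u • (η k).2)) := by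
          ring
        rw [hsplit]
        have habs := (abs_sub _ _).trans (add_le_add ((abs_sub _ _).trans (add_le_add h1 h2)) h3)
        refine (mul_le_mul_of_nonneg_left habs hc.le).trans (le_of_eq ?_)
        have ea := h.ident_a k.val
        have eb := h.ident_b k.val
        have ec := (h.ident_c' k.val).1
        have ec' := (h.ident_c' k.val).2
        rw [← hw] at ea eb ec ec'
        rw [← hu] at eb ec'
        calc (Lr ^ 2 * w)⁻¹ * (lam (k.val + 1) ^ (1 / 2 + β) * D + lam k.val ^ (1 / 2 + 6 * eps) * u * D
              + (A * Lr ^ 3 * lam k.val ^ (1 / 4 - 4 * eps) * w * D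
                + A * Lr ^ 3 * lam k.val ^ (3 / 4 - 4 * eps) * u * D))
            = ((Lr ^ 2 * w)⁻¹ * lam (k.val + 1) ^ (1 / 2 + β)
                + (Lr ^ 2 * w)⁻¹ * (lam k.val ^ (1 / 2 + 6 * eps) * u)
                + ((Lr ^ 2 * w)⁻¹ * (A * Lr ^ 3 * lam k.val ^ (1 / 4 - 4 * eps) * w)
                  + (Lr ^ 2 * w)⁻¹ * (A * Lr ^ 3 * lam k.val ^ (3 / 4 - 4 * eps) * u))) * D := by ring
          _ = (Lr ^ (β - 3 / 2) + (Lr ^ 2)⁻¹ * lam k.val ^ (6 * eps)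
              + 2 * (A * Lr * lam k.val ^ (1 / 4 - 4 * eps))) * D := by
            rw [ea, eb, ec, ec']; ring
      exact key.trans (mul_le_mul_of_nonneg_right (h.c1 _ hkK) hD0)
    · simp [hD0]
  · -- the E-component
    rcases Fin.eq_zero_or_eq_succ k with rfl | ⟨j, rfl⟩
    · rw [eNext_zero, eNext_zero, sub_zero, norm_zero]; positivity
    · have hjK : (prev j).val ≤ K := by show j.val ≤ K; omega
      rw [eNext_succ, eNext_succ]
      set w := lam (prev j).val ^ (1 / 2 + β) with hw
      set u := lam (prev j).val ^ β with hu
      have hwpos : 0 < w := h.wpos _ _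
      have hupos : 0 < u := h.wpos _ _
      have hu1 : 0 < lam ((prev j).val + 1) ^ β := h.wpos _ _
      set ξj := ξ (prev j) with hξj
      set ηj := η (prev j) with hηj
      have hwm : ∀ ζ : Seq K E, ‖ζ‖ ≤ 1 →
          |w * (ζ (prev j)).1| ≤ lam (prev j).val ^ (1 / 2 : ℝ) / 2 := fun ζ hζ => by
        rw [abs_mul, abs_of_pos hwpos]
        exact (mul_le_of_le_one_right hwpos.le ((abs_fst_le ζ _).trans hζ)).trans (h.w_le_half_sqrt hjK)
      have hue : ∀ ζ : Seq K E, ‖ζ‖ ≤ 1 →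
          ‖u • (ζ (prev j)).2‖ ≤ 1 / 2 := fun ζ hζ => by
        rw [norm_smul, Real.norm_eq_abs, abs_of_pos hupos]
        exact (mul_le_of_le_one_right hupos.le ((norm_snd_le' ζ _).trans hζ)).trans (h.half _ hjK)
      have h1 : ‖S.L3 (prev j).val (u • ξj.2) - S.L3 (prev j).val (u • ηj.2)‖ ≤ u * D := by
        rw [← map_sub, ← smul_sub]
        refine (hB.L3_le _ _).trans ?_
        rw [norm_smul, Real.norm_eq_abs, abs_of_pos hupos]
        exact mul_le_mul_of_nonneg_left (hde _) hupos.le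
      have hA3 : 0 ≤ A * Lr ^ 3 := by have := h.A_nonneg; have := h.Lr_pos; positivity
      have h2 : ‖S.Es (prev j).val (w * ξj.1) (u • ξj.2) - S.Es (prev j).val (w * ηj.1) (u • ηj.2)‖
          ≤ A * Lr ^ 3 * lam (prev j).val ^ (-1 / 4 - 10 * eps) * w * D
            + A * Lr ^ 3 * lam (prev j).val ^ (1 / 4 - 10 * eps) * u * D := by
        refine (hB.Es_lip _ _ _ _ _ (hwm ξ hξ) (hwm η hη) (hue ξ hξ) (hue η hη)).trans ?_
        rw [← mul_sub, abs_mul, abs_of_pos hwpos, ← smul_sub, norm_smul, Real.norm_eq_abs, abs_of_pos hupos]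
        have i1 : A * Lr ^ 3 * lam (prev j).val ^ (-1 / 4 - 10 * eps) * (w * |ξj.1 - ηj.1|)
            ≤ A * Lr ^ 3 * lam (prev j).val ^ (-1 / 4 - 10 * eps) * w * D := by
          rw [mul_assoc (A * Lr ^ 3 * lam (prev j).val ^ (-1 / 4 - 10 * eps)) w D]
          exact mul_le_mul_of_nonneg_left (mul_le_mul_of_nonneg_left (hdm _) hwpos.le)
            (mul_nonneg hA3 (h.wpos _ _).le)
        have i2 : A * Lr ^ 3 * lam (prev j).val ^ (1 / 4 - 10 * eps) * (u * ‖ξj.2 - ηj.2‖)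
            ≤ A * Lr ^ 3 * lam (prev j).val ^ (1 / 4 - 10 * eps) * u * D := by
          rw [mul_assoc (A * Lr ^ 3 * lam (prev j).val ^ (1 / 4 - 10 * eps)) u D]
          exact mul_le_mul_of_nonneg_left (mul_le_mul_of_nonneg_left (hde _) hupos.le)
            (mul_nonneg hA3 (h.wpos _ _).le)
        exact add_le_add i1 i2
      have ed := h.ident_d (prev j).val
      have ee := h.ident_e' (prev j).val
      have ef := h.ident_f (prev j).val
      rw [← hu] at ed ef
      rw [← hw] at ee
      calc ‖(lam ((prev j).val + 1) ^ β)⁻¹ • (S.L3 (prev j).val (u • ξj.2) + S.Es (prev j).val (w * ξj.1) (u • ξj.2))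
            - (lam ((prev j).val + 1) ^ β)⁻¹ • (S.L3 (prev j).val (u • ηj.2) + S.Es (prev j).val (w * ηj.1) (u • ηj.2))‖
          = (lam ((prev j).val + 1) ^ β)⁻¹ * ‖(S.L3 (prev j).val (u • ξj.2) - S.L3 (prev j).val (u • ηj.2))
              + (S.Es (prev j).val (w * ξj.1) (u • ξj.2) - S.Es (prev j).val (w * ηj.1) (u • ηj.2))‖ := by
            rw [← smul_sub, norm_smul, norm_inv, Real.norm_eq_abs, abs_of_pos hu1]
            congr 1
            abel_nf
        _ ≤ (lam ((prev j).val + 1) ^ β)⁻¹ * (u * D + (A * Lr ^ 3 * lam (prev j).val ^ (-1 / 4 - 10 * eps) * w * D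
              + A * Lr ^ 3 * lam (prev j).val ^ (1 / 4 - 10 * eps) * u * D)) :=
            mul_le_mul_of_nonneg_left ((norm_add_le _ _).trans (add_le_add h1 h2)) (inv_nonneg.2 hu1.le)
        _ = ((lam ((prev j).val + 1) ^ β)⁻¹ * u
              + ((lam ((prev j).val + 1) ^ β)⁻¹ * (A * Lr ^ 3 * lam (prev j).val ^ (-1 / 4 - 10 * eps) * w)
                + (lam ((prev j).val + 1) ^ β)⁻¹ * (A * Lr ^ 3 * lam (prev j).val ^ (1 / 4 - 10 * eps) * u))) * D := by
            ring
        _ = (Lr ^ (-β) + 2 * (A * Lr ^ (3 - β) * lam (prev j).val ^ (1 / 4 - 10 * eps))) * D := by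
            rw [ed, ee, ef]; ring
        _ ≤ 1 / 2 * D := mul_le_mul_of_nonneg_right (h.c2 _ hjK) hD0

end TheMap



/-! ## Part 3. LEMMA 23 (2) and THEOREM 24 (gsf): the fixed point, existence and uniqueness of the flow -/

section FixedPoint

variable {E : ℕ → Type*} [∀ k, NormedAddCommGroup (E k)] [∀ k, NormedSpace ℝ (E k)]
variable {S : StepMaps E} {lam : ℕ → ℝ} {Lr A eps β : ℝ} {K : ℕ}

/-- **LEMMA 23 (2): THE FIXED POINT EXISTS** — verbatim (TeX L2858): *"There is a unique fixed point Tξ = ξ in this set"*,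
by *"the standard fixed point theorem in a complete metric space"* (TeX L2899; Mathlib's `ContractingWith.exists_fixedPoint'`
on the closed unit ball of the complete space 𝖡, which T maps into itself (`norm_T_le_one`) contracting by ½
(`norm_T_sub_T_le`)). [cite: Dimock2013, §5 Lemma 23 (2) (arXiv:1108.1335v2 TeX L2854–2860, L2898–2904)] -/
theorem exists_fixedPoint [∀ k, CompleteSpace (E k)] (hB : StepBounds S lam Lr A eps)
    (h : FlowSmall lam Lr A eps β K) : ∃ ξ : Seq K E, ‖ξ‖ ≤ 1 ∧ T S lam Lr β K ξ = ξ := by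
  have hsc : IsComplete (Metric.closedBall (0 : Seq K E) 1) := Metric.isClosed_closedBall.isComplete
  have hmaps : Set.MapsTo (T S lam Lr β K) (Metric.closedBall (0 : Seq K E) 1) (Metric.closedBall 0 1) :=
    fun ξ hξ => mem_closedBall_zero_iff.2 (norm_T_le_one hB h (mem_closedBall_zero_iff.1 hξ))
  have hcontr : ContractingWith (1 / 2 : NNReal) (hmaps.restrict _ _ _) := by
    refine ⟨by norm_num, LipschitzWith.of_dist_le_mul fun x y => ?_⟩
    have hx : ‖(x : Seq K E)‖ ≤ 1 := mem_closedBall_zero_iff.1 x.2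
    have hy : ‖(y : Seq K E)‖ ≤ 1 := mem_closedBall_zero_iff.1 y.2
    rw [Subtype.dist_eq, Set.MapsTo.val_restrict_apply, Set.MapsTo.val_restrict_apply, dist_eq_norm,
      Subtype.dist_eq, dist_eq_norm, NNReal.coe_div, NNReal.coe_one, NNReal.coe_two]
    exact norm_T_sub_T_le hB h hx hy
  have h0 : (0 : Seq K E) ∈ Metric.closedBall (0 : Seq K E) 1 := mem_closedBall_zero_iff.2 (by simp)
  obtain ⟨y, hys, hfix, -⟩ := ContractingWith.exists_fixedPoint' hsc hmaps hcontr h0 (edist_ne_top _ _)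
  exact ⟨y, mem_closedBall_zero_iff.1 hys, hfix⟩

/-- **LEMMA 23 (2): THE FIXED POINT IS UNIQUE IN 𝖡₁** (two fixed points at distance `D` are at distance `≤ ½D`).
[cite: Dimock2013, §5 Lemma 23 (2) (arXiv:1108.1335v2 TeX L2854–2860)] -/
theorem fixedPoint_unique (hB : StepBounds S lam Lr A eps) (h : FlowSmall lam Lr A eps β K) {ξ η : Seq K E}
    (hξ : ‖ξ‖ ≤ 1) (hη : ‖η‖ ≤ 1) (hfξ : T S lam Lr β K ξ = ξ) (hfη : T S lam Lr β K η = η) : ξ = η := by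
  have hc := norm_T_sub_T_le hB h hξ hη
  rw [hfξ, hfη] at hc
  have h0 : ‖ξ - η‖ ≤ 0 := by linarith [norm_nonneg (ξ - η)]
  exact sub_eq_zero.1 (norm_le_zero_iff.1 h0)

/-- A SOLUTION OF THE FLOW PROBLEM (bc) + (recursive3) restricted to (μ, E) — [Dimock2013] TeX L2774–2779: *"Thus we look
for solutions ε_k, μ_k, E_k for k = 0, 1, 2, …, K satisfying ε_K = 0, μ_K = 0, E₀ = 0"* with the recursion of Theorem 14
*"μ_{k+1} = L²μ_k + 𝓛₂E_k + μ_k^*(λ_k, μ_k, E_k), E_{k+1} = 𝓛₃E_k + E^*_k(λ_k, μ_k, E_k)"* — in ORIGINAL variables.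
[cite: Dimock2013, §5 eq. (bc) and Theorem 14 eq. (recursive) (arXiv:1108.1335v2 TeX L2774–2779, L1932–1939)] -/
structure IsFlow (S : StepMaps E) (Lr : ℝ) (K : ℕ) (μ : Fin (K + 1) → ℝ) (Ek : (k : Fin (K + 1)) → E k.val) :
    Prop where
  /-- `μ_K = 0` -/
  mu_last : μ (Fin.last K) = 0
  /-- `E₀ = 0` -/
  E_zero : Ek 0 = 0
  /-- `μ_{k+1} = L²μ_k + 𝓛₂E_k + μ_k^*(μ_k, E_k)` -/
  mu_succ : ∀ j : Fin K, μ j.succ =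
    Lr ^ 2 * μ (prev j) + S.L2 (prev j).val (Ek (prev j)) + S.mus (prev j).val (μ (prev j)) (Ek (prev j))
  /-- `E_{k+1} = 𝓛₃E_k + E_k^*(μ_k, E_k)` -/
  E_succ : ∀ j : Fin K, Ek j.succ = S.L3 (prev j).val (Ek (prev j)) + S.Es (prev j).val (μ (prev j)) (Ek (prev j))

/-- THE BOUNDS (somewhat) of Theorem 24: *"|μ_k| ≤ λ_k^{½+β}, ‖E_k‖_{k,κ} ≤ λ_k^β"* (TeX L3010–3013) — i.e. membership of the
rescaled sequence in the closed unit ball 𝖡₁. [cite: Dimock2013, §5 Theorem 24 eq. (somewhat) (arXiv:1108.1335v2 TeX L3006–3013)] -/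
def InBall (lam : ℕ → ℝ) (β : ℝ) (K : ℕ) (μ : Fin (K + 1) → ℝ) (Ek : (k : Fin (K + 1)) → E k.val) : Prop :=
  ∀ k : Fin (K + 1), |μ k| ≤ lam k.val ^ (1 / 2 + β) ∧ ‖Ek k‖ ≤ lam k.val ^ β

/-- From the rescaled sequence to the original variables: `μ_k = λ_k^{½+β} m_k`. [folklore] -/
def unscaleμ (lam : ℕ → ℝ) (β : ℝ) (K : ℕ) (ξ : Seq K E) : Fin (K + 1) → ℝ :=
  fun k => lam k.val ^ (1 / 2 + β) * (ξ k).1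

/-- From the rescaled sequence to the original variables: `E_k = λ_k^β e_k`. [folklore] -/
def unscaleE (lam : ℕ → ℝ) (β : ℝ) (K : ℕ) (ξ : Seq K E) : (k : Fin (K + 1)) → E k.val :=
  fun k => lam k.val ^ β • (ξ k).2

/-- From the original variables to the rescaled sequence. [folklore] -/
def rescale (lam : ℕ → ℝ) (β : ℝ) (K : ℕ) (μ : Fin (K + 1) → ℝ) (Ek : (k : Fin (K + 1)) → E k.val) : Seq K E :=
  fun k => ((lam k.val ^ (1 / 2 + β))⁻¹ * μ k, (lam k.val ^ β)⁻¹ • Ek k)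

/-- A fixed point of T in 𝖡₁ unscales to a flow satisfying the bounds (TeX L2833: *"ξ is a solution of (bc), (recursive4)
iff it is a fixed point for T"* — the "if" half). [cite: Dimock2013, §5 (arXiv:1108.1335v2 TeX L2827–2834)] -/
theorem isFlow_unscale (h : FlowSmall lam Lr A eps β K) {ξ : Seq K E} (hξ : ‖ξ‖ ≤ 1)
    (hfix : T S lam Lr β K ξ = ξ) :
    IsFlow S Lr K (unscaleμ lam β K ξ) (unscaleE lam β K ξ) ∧ InBall lam β K (unscaleμ lam β K ξ) (unscaleE lam β K ξ) := by
  have hfst : ∀ k, muNext S lam Lr β K ξ k = (ξ k).1 := fun k => by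
    have := congrArg (fun ζ => (ζ k).1) hfix; exact this
  have hsnd : ∀ k, eNext S lam β K ξ k = (ξ k).2 := fun k => by
    have := congrArg (fun ζ => (ζ k).2) hfix; exact this
  refine ⟨⟨?_, ?_, ?_, ?_⟩, ?_⟩
  · -- μ_K = 0
    have := hfst (Fin.last K)
    unfold muNext at this
    rw [dif_neg (by simp)] at this
    show lam (Fin.last K).val ^ (1 / 2 + β) * (ξ (Fin.last K)).1 = 0
    rw [← this, mul_zero]
  · -- E₀ = 0
    have := hsnd 0
    show lam (0 : Fin (K + 1)).val ^ β • (ξ 0).2 = 0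
    rw [← this, eNext_zero]
    exact smul_zero _
  · -- μ recursion
    intro j
    have hk : (prev j).val + 1 < K + 1 := by show j.val + 1 < K + 1; omega
    have := hfst (prev j)
    unfold muNext at this
    rw [dif_pos hk] at this
    have hw : 0 < lam (prev j).val ^ (1 / 2 + β) := h.wpos _ _
    have hne : Lr ^ 2 * lam (prev j).val ^ (1 / 2 + β) ≠ 0 := by
      have := h.Lr_pos; positivity
    rw [inv_mul_eq_iff_eq_mul₀ hne] at this
    have e1 : (⟨(prev j).val + 1, hk⟩ : Fin (K + 1)) = j.succ := rfl
    rw [e1] at this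
    show lam (j.succ).val ^ (1 / 2 + β) * (ξ j.succ).1 =
      Lr ^ 2 * (lam (prev j).val ^ (1 / 2 + β) * (ξ (prev j)).1)
        + S.L2 (prev j).val (lam (prev j).val ^ β • (ξ (prev j)).2)
        + S.mus (prev j).val (lam (prev j).val ^ (1 / 2 + β) * (ξ (prev j)).1) (lam (prev j).val ^ β • (ξ (prev j)).2)
    have e2 : lam (j.succ).val ^ (1 / 2 + β) = lam ((prev j).val + 1) ^ (1 / 2 + β) := rfl
    rw [e2]
    linear_combination this
  · -- E recursion
    intro j
    have := hsnd j.succ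
    rw [eNext_succ] at this
    have hu : 0 < lam ((prev j).val + 1) ^ β := h.wpos _ _
    -- restate at the type `E ((prev j).val + 1)` (definitionally `E (j.succ).val`)
    have this' : @Eq (E ((prev j).val + 1))
        ((lam ((prev j).val + 1) ^ β)⁻¹ •
          (S.L3 (prev j).val (lam (prev j).val ^ β • (ξ (prev j)).2)
            + S.Es (prev j).val (lam (prev j).val ^ (1 / 2 + β) * (ξ (prev j)).1)
                (lam (prev j).val ^ β • (ξ (prev j)).2)))
        (ξ j.succ).2 := this
    rw [inv_smul_eq_iff₀ hu.ne'] at this'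
    show @Eq (E ((prev j).val + 1)) (lam ((prev j).val + 1) ^ β • (ξ j.succ).2)
      (S.L3 (prev j).val (lam (prev j).val ^ β • (ξ (prev j)).2)
        + S.Es (prev j).val (lam (prev j).val ^ (1 / 2 + β) * (ξ (prev j)).1) (lam (prev j).val ^ β • (ξ (prev j)).2))
    exact this'.symm
  · -- bounds
    intro k
    have hm := (abs_fst_le ξ k).trans hξ
    have he := (norm_snd_le' ξ k).trans hξ
    have hw : 0 < lam k.val ^ (1 / 2 + β) := h.wpos _ _
    have hu : 0 < lam k.val ^ β := h.wpos _ _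
    constructor
    · show |lam k.val ^ (1 / 2 + β) * (ξ k).1| ≤ lam k.val ^ (1 / 2 + β)
      rw [abs_mul, abs_of_pos hw]; exact mul_le_of_le_one_right hw.le hm
    · show ‖lam k.val ^ β • (ξ k).2‖ ≤ lam k.val ^ β
      rw [norm_smul, Real.norm_eq_abs, abs_of_pos hu]; exact mul_le_of_le_one_right hu.le he

/-- A flow satisfying the bounds rescales to a fixed point of T in 𝖡₁ (the "only if" half of TeX L2833).
[cite: Dimock2013, §5 (arXiv:1108.1335v2 TeX L2827–2834)] -/
theorem rescale_fixed (h : FlowSmall lam Lr A eps β K) {μ : Fin (K + 1) → ℝ} {Ek : (k : Fin (K + 1)) → E k.val}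
    (hF : IsFlow S Lr K μ Ek) (hb : InBall lam β K μ Ek) :
    ‖rescale lam β K μ Ek‖ ≤ 1 ∧ T S lam Lr β K (rescale lam β K μ Ek) = rescale lam β K μ Ek := by
  constructor
  · refine (pi_norm_le_iff_of_nonneg zero_le_one).2 fun k => ?_
    have hw : 0 < lam k.val ^ (1 / 2 + β) := h.wpos _ _
    have hu : 0 < lam k.val ^ β := h.wpos _ _
    rw [rescale, Prod.norm_def, max_le_iff, Real.norm_eq_abs, abs_mul, abs_inv, abs_of_pos hw, norm_smul,
      norm_inv, Real.norm_eq_abs, abs_of_pos hu]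
    constructor
    · rw [inv_mul_le_iff₀ hw, mul_one]; exact (hb k).1
    · rw [inv_mul_le_iff₀ hu, mul_one]; exact (hb k).2
  · funext k
    refine Prod.ext ?_ ?_
    · -- μ-component
      show muNext S lam Lr β K (rescale lam β K μ Ek) k = ((lam k.val ^ (1 / 2 + β))⁻¹ * μ k)
      by_cases hlt : k.val < K
      · obtain ⟨j, rfl⟩ : ∃ j : Fin K, k = prev j := ⟨⟨k.val, hlt⟩, Fin.ext rfl⟩
        have hk : (prev j).val + 1 < K + 1 := by show j.val + 1 < K + 1; omega
        unfold muNext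
        rw [dif_pos hk]
        have e1 : (⟨(prev j).val + 1, hk⟩ : Fin (K + 1)) = j.succ := rfl
        rw [e1]
        have hw : 0 < lam (prev j).val ^ (1 / 2 + β) := h.wpos _ _
        have hw1 : 0 < lam (j.succ).val ^ (1 / 2 + β) := h.wpos _ _
        have hu : 0 < lam (prev j).val ^ β := h.wpos _ _
        have hL : 0 < Lr ^ 2 := pow_pos h.Lr_pos 2
        have e2 : lam ((prev j).val + 1) ^ (1 / 2 + β) = lam (j.succ).val ^ (1 / 2 + β) := rfl
        show (Lr ^ 2 * lam (prev j).val ^ (1 / 2 + β))⁻¹ *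
            (lam ((prev j).val + 1) ^ (1 / 2 + β) * ((lam (j.succ).val ^ (1 / 2 + β))⁻¹ * μ j.succ)
              - S.L2 (prev j).val (lam (prev j).val ^ β • (lam (prev j).val ^ β)⁻¹ • Ek (prev j))
              - S.mus (prev j).val (lam (prev j).val ^ (1 / 2 + β) * ((lam (prev j).val ^ (1 / 2 + β))⁻¹ * μ (prev j)))
                  (lam (prev j).val ^ β • (lam (prev j).val ^ β)⁻¹ • Ek (prev j)))
          = (lam (prev j).val ^ (1 / 2 + β))⁻¹ * μ (prev j)
        have hL0 : Lr ≠ 0 := h.Lr_pos.ne'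
        rw [e2, smul_smul, mul_inv_cancel₀ hu.ne', one_smul, ← mul_assoc, mul_inv_cancel₀ hw1.ne', one_mul,
          ← mul_assoc (lam (prev j).val ^ (1 / 2 + β)), mul_inv_cancel₀ hw.ne', one_mul, hF.mu_succ j]
        field_simp
        ring
      · have hlast : k = Fin.last K := by
          apply Fin.ext; rw [Fin.val_last]; omega
        unfold muNext
        rw [dif_neg (by omega)]
        rw [hlast]  -- only `μ k` and `lam k.val` remain
        show (0 : ℝ) = (lam (Fin.last K).val ^ (1 / 2 + β))⁻¹ * μ (Fin.last K)
        rw [hF.mu_last, mul_zero]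
    · -- E-component
      show eNext S lam β K (rescale lam β K μ Ek) k = (lam k.val ^ β)⁻¹ • Ek k
      rcases Fin.eq_zero_or_eq_succ k with rfl | ⟨j, rfl⟩
      · show (0 : E 0) = (lam (0 : Fin (K + 1)).val ^ β)⁻¹ • Ek 0
        rw [hF.E_zero]
        exact (smul_zero _).symm
      · rw [eNext_succ]
        have hw : 0 < lam (prev j).val ^ (1 / 2 + β) := h.wpos _ _
        have hu : 0 < lam (prev j).val ^ β := h.wpos _ _
        have e2 : lam ((prev j).val + 1) ^ β = lam (j.succ).val ^ β := rfl
        show (lam ((prev j).val + 1) ^ β)⁻¹ •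
            (S.L3 (prev j).val (lam (prev j).val ^ β • (lam (prev j).val ^ β)⁻¹ • Ek (prev j))
              + S.Es (prev j).val (lam (prev j).val ^ (1 / 2 + β) * ((lam (prev j).val ^ (1 / 2 + β))⁻¹ * μ (prev j)))
                (lam (prev j).val ^ β • (lam (prev j).val ^ β)⁻¹ • Ek (prev j)))
            = (lam (j.succ).val ^ β)⁻¹ • Ek j.succ
        rw [e2, smul_smul, mul_inv_cancel₀ hu.ne', one_smul, ← mul_assoc, mul_inv_cancel₀ hw.ne', one_mul]
        exact congrArg (fun v => (lam (j.succ).val ^ β)⁻¹ • v) (hF.E_succ j).symm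

/-- **THEOREM 24 (gsf) — EXISTENCE AND UNIQUENESS OF THE SMALL-FIELD RG FLOW**, [Dimock2013] verbatim (TeX L3006–3013):
*"Let λ_K = L^{−Δ}λ be sufficiently small. Then for N ≥ Δ there is a unique sequence ε_k, μ_k, E_k for k = 0, 1, 2, …, K =
𝖭 − Δ satisfying of [sic] the dynamical equation (recursive3), the boundary conditions (bc), and |μ_k| ≤ λ_k^{½+β},
‖E_k‖_{k,κ} ≤ λ_k^β"* (*"This solution is the fixed point from the previous lemma and the bounds (somewhat) are a
consequence"*, TeX L3021–3022).  PROVED for the (μ, E) system over ABSTRACT Banach spaces `E k` from the hypothesis shapes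
`StepBounds` (Theorem 14 + Lemma 22) and the explicit parameter conditions `FlowSmall`: existence of a flow in the ball
and uniqueness among flows in the ball (the ε-component, which *"does not afffect [sic] the others"* (TeX L2782–2783), is
`vacuumEnergy_bound` below). [cite: Dimock2013, §5 Theorem 24 (arXiv:1108.1335v2 TeX L3006–3022)] -/
theorem flow_exists_unique [∀ k, CompleteSpace (E k)] (hB : StepBounds S lam Lr A eps)
    (h : FlowSmall lam Lr A eps β K) :
    ∃ μ : Fin (K + 1) → ℝ, ∃ Ek : (k : Fin (K + 1)) → E k.val,
      IsFlow S Lr K μ Ek ∧ InBall lam β K μ Ek ∧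
        ∀ μ' : Fin (K + 1) → ℝ, ∀ Ek' : (k : Fin (K + 1)) → E k.val,
          IsFlow S Lr K μ' Ek' → InBall lam β K μ' Ek' → μ' = μ ∧ Ek' = Ek := by
  obtain ⟨ξ, hξ, hfix⟩ := exists_fixedPoint hB h
  obtain ⟨hF, hb⟩ := isFlow_unscale (S := S) h hξ hfix
  refine ⟨unscaleμ lam β K ξ, unscaleE lam β K ξ, hF, hb, fun μ' Ek' hF' hb' => ?_⟩
  obtain ⟨hξ', hfix'⟩ := rescale_fixed (S := S) h hF' hb'
  have heq : rescale lam β K μ' Ek' = ξ := fixedPoint_unique hB h hξ' hξ hfix' hfix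
  constructor
  · funext k
    have hw : 0 < lam k.val ^ (1 / 2 + β) := h.wpos _ _
    have := congrArg (fun ζ => (ζ k).1) heq
    show μ' k = lam k.val ^ (1 / 2 + β) * (ξ k).1
    rw [← this]
    show μ' k = lam k.val ^ (1 / 2 + β) * ((lam k.val ^ (1 / 2 + β))⁻¹ * μ' k)
    rw [← mul_assoc, mul_inv_cancel₀ hw.ne', one_mul]
  · funext k
    have hu : 0 < lam k.val ^ β := h.wpos _ _
    have := congrArg (fun ζ => (ζ k).2) heq
    show Ek' k = lam k.val ^ β • (ξ k).2
    rw [← this]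
    show Ek' k = lam k.val ^ β • (lam k.val ^ β)⁻¹ • Ek' k
    rw [smul_smul, mul_inv_cancel₀ hu.ne', one_smul]

end FixedPoint

/-! ## Part 4. THE VACUUM ENERGY: the bound (eg) by the backward recursion (out) -/

section VacuumEnergy

/-- **(out) ⇒ (eg)** — [Dimock2013] TeX L3024–3053, verbatim: *"Once μ_k, E_k are fixed ε_k is determined by ε_{k+1} =
L³ε_k + 𝓛₁(E_k) + ε_k^*(μ_k, λ_k, E_k) or by ε_k = L^{−3}(ε_{k+1} − 𝓛₁(E_k) − ε_k^*) starting with ε_K = 0. We have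
|𝓛₁(E_k)| ≤ ‖E_k‖_{k,κ} ≤ λ_k^β and |L^{−3}ε_k^*| ≤ 𝒪(1)λ_k^{¼−10ε} ≤ 𝒪(1)λ_k^β. Therefore for some constant b = 𝒪(1)
|ε_k| ≤ L^{−3}|ε_{k+1}| + bλ_k^β. … We claim that in general |ε_{K−n}| ≤ b(Σ_{j=0}^{n−1} L^{(β−3)j}) λ_{K−n}^β … Here we
used λ_{K−n}^β = L^β λ_{K−n−1}^β. … this implies the result (eg) since the series converges."*  PROVED as a statement about
real sequences: the one-step inequality with `ε_K = 0` and `λ_{k+1} = Lλ_k` forces `|ε_k| ≤ (b / (1 − L^{β−3})) λ_k^β`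
for all `k ≤ K` (the printed partial sums majorised by the full geometric series, `L^{β−3} < 1`).
[cite: Dimock2013, §5 Theorem 24 eq. (eg), (out) (arXiv:1108.1335v2 TeX L3015–3053)] -/
theorem vacuumEnergy_bound {K : ℕ} {lam : ℕ → ℝ} {Lr β b : ℝ} {x : ℕ → ℝ} (hL : 0 < Lr) (hq : Lr ^ (β - 3) < 1)
    (hb : 0 ≤ b) (hlam : ∀ k, 0 < lam k) (hsucc : ∀ k, lam (k + 1) = Lr * lam k) (hK : x K = 0)
    (hstep : ∀ k, k < K → |x k| ≤ (Lr ^ 3)⁻¹ * |x (k + 1)| + b * lam k ^ β) :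
    ∀ k, k ≤ K → |x k| ≤ b / (1 - Lr ^ (β - 3)) * lam k ^ β := by
  set q := Lr ^ (β - 3) with hqdef
  have hq0 : 0 < q := Real.rpow_pos_of_pos hL _
  have hden : 0 < 1 - q := by linarith
  -- the geometric factor: L^{−3} λ_{k+1}^β = q λ_k^β
  have h3 : q = Lr ^ β * (Lr ^ 3)⁻¹ := by
    rw [hqdef, Real.rpow_sub hL, div_eq_mul_inv]
    congr 2
    exact_mod_cast Real.rpow_natCast Lr 3
  have hgeo : ∀ k, (Lr ^ 3)⁻¹ * lam (k + 1) ^ β = q * lam k ^ β := by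
    intro k
    rw [hsucc, Real.mul_rpow hL.le (hlam k).le, h3]
    ring
  -- downward induction on n = K − k
  suffices H : ∀ n k, k + n = K → |x k| ≤ b / (1 - q) * lam k ^ β by
    intro k hk
    exact H (K - k) k (by omega)
  intro n
  induction n with
  | zero =>
    intro k hk
    rw [Nat.add_zero] at hk
    rw [hk, hK, abs_zero]
    exact mul_nonneg (div_nonneg hb hden.le) (Real.rpow_pos_of_pos (hlam K) β).le
  | succ n ih =>
    intro k hk
    have hkK : k < K := by omega
    have hnext := ih (k + 1) (by omega)
    have hl : 0 < lam k ^ β := Real.rpow_pos_of_pos (hlam k) β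
    have hL3 : 0 ≤ (Lr ^ 3)⁻¹ := by positivity
    calc |x k| ≤ (Lr ^ 3)⁻¹ * |x (k + 1)| + b * lam k ^ β := hstep k hkK
      _ ≤ (Lr ^ 3)⁻¹ * (b / (1 - q) * lam (k + 1) ^ β) + b * lam k ^ β := by
          have := mul_le_mul_of_nonneg_left hnext hL3
          linarith
      _ = (b / (1 - q) * q + b) * lam k ^ β := by
          rw [show (Lr ^ 3)⁻¹ * (b / (1 - q) * lam (k + 1) ^ β) = b / (1 - q) * ((Lr ^ 3)⁻¹ * lam (k + 1) ^ β) by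
            ring, hgeo]
          ring
      _ = b / (1 - q) * lam k ^ β := by
          field_simp
          ring

/-- THE ONE-STEP INEQUALITY behind (out) from the shapes: if `|𝓛₁E_k| ≤ ‖E_k‖ ≤ λ_k^β` and `|ε_k^*| ≤ 𝒪(1)L³λ_k^{¼−10ε}`
with `λ_k^{¼−10ε} ≤ λ_k^β` (β ≤ ¼ − 10ε, λ_k ≤ 1), then `ε_k = L^{−3}(ε_{k+1} − 𝓛₁E_k − ε_k^*)` gives `|ε_k| ≤
L^{−3}|ε_{k+1}| + bλ_k^β` with `b = 1 + 𝒪(1)` (print: *"for some constant b = 𝒪(1)"*; `L^{−3} ≤ 1` absorbed).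
[cite: Dimock2013, §5 proof of Theorem 24 (arXiv:1108.1335v2 TeX L3024–3037)] -/
theorem vacuumEnergy_step {Lr A eps β l e1 es x x' : ℝ} (hL : 1 ≤ Lr) (hA : 0 ≤ A) (hl : 0 < l) (hl1 : l ≤ 1)
    (hβ : β ≤ 1 / 4 - 10 * eps) (he1 : |e1| ≤ l ^ β) (hes : |es| ≤ A * Lr ^ 3 * l ^ (1 / 4 - 10 * eps))
    (hx : x = (Lr ^ 3)⁻¹ * (x' - e1 - es)) :
    |x| ≤ (Lr ^ 3)⁻¹ * |x'| + (1 + A) * l ^ β := by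
  have hL3 : 1 ≤ Lr ^ 3 := one_le_pow₀ hL
  have hL3pos : 0 < Lr ^ 3 := by positivity
  have hinv : (Lr ^ 3)⁻¹ ≤ 1 := inv_le_one_of_one_le₀ hL3
  have hinv0 : 0 ≤ (Lr ^ 3)⁻¹ := by positivity
  have hmono : l ^ (1 / 4 - 10 * eps) ≤ l ^ β := Real.rpow_le_rpow_of_exponent_ge hl hl1 hβ
  have hlβ : 0 ≤ l ^ β := (Real.rpow_pos_of_pos hl β).le
  rw [hx, abs_mul, abs_inv, abs_of_pos hL3pos]
  have t0 : |x' - e1 - es| ≤ |x'| + |e1| + |es| :=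
    (abs_sub _ _).trans (add_le_add (abs_sub _ _) le_rfl)
  have t1 : (Lr ^ 3)⁻¹ * |e1| ≤ l ^ β := by
    calc (Lr ^ 3)⁻¹ * |e1| ≤ 1 * l ^ β := mul_le_mul hinv he1 (abs_nonneg _) zero_le_one
      _ = l ^ β := one_mul _
  have t2 : (Lr ^ 3)⁻¹ * |es| ≤ A * l ^ β := by
    calc (Lr ^ 3)⁻¹ * |es| ≤ (Lr ^ 3)⁻¹ * (A * Lr ^ 3 * l ^ (1 / 4 - 10 * eps)) :=
          mul_le_mul_of_nonneg_left hes hinv0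
      _ = A * l ^ (1 / 4 - 10 * eps) := by field_simp
      _ ≤ A * l ^ β := mul_le_mul_of_nonneg_left hmono hA
  have t3 := mul_le_mul_of_nonneg_left t0 hinv0
  calc (Lr ^ 3)⁻¹ * |x' - e1 - es| ≤ (Lr ^ 3)⁻¹ * (|x'| + |e1| + |es|) := t3
    _ = (Lr ^ 3)⁻¹ * |x'| + (Lr ^ 3)⁻¹ * |e1| + (Lr ^ 3)⁻¹ * |es| := by ring
    _ ≤ (Lr ^ 3)⁻¹ * |x'| + l ^ β + A * l ^ β := by linarith
    _ = (Lr ^ 3)⁻¹ * |x'| + (1 + A) * l ^ β := by ring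

end VacuumEnergy


section VacuumEnergyOfFlow

variable {E : ℕ → Type*} [∀ k, NormedAddCommGroup (E k)] [∀ k, NormedSpace ℝ (E k)]
variable {S : StepMaps E} {lam : ℕ → ℝ} {Lr A eps β : ℝ} {K : ℕ}

/-- **(eg) OF THEOREM 24 — *"Furthermore |ε_k| ≤ 𝒪(1)λ_k^β"*** (TeX L3014–3017), ASSEMBLED: for any (μ, E) in the ball
(`InBall`, e.g. the flow of `flow_exists_unique`) and any ε solving the backward recursion *"ε_k = L^{−3}(ε_{k+1} − 𝓛₁(E_k) −
ε_k^*) starting with ε_K = 0"* (TeX L3026–3031), the shapes `StepBounds.L1_le` / `eps_le` give the one-step inequality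
(`vacuumEnergy_step`, `b = 1 + 𝒪(1)`) and `vacuumEnergy_bound` gives `|ε_k| ≤ (1 + 𝒪(1))/(1 − L^{β−3}) · λ_k^β` for every
`k ≤ K` — the printed `𝒪(1) = b Σ_j L^{(β−3)j}`.  Extra explicit hypotheses: `L ≥ 1`, `β ≤ ¼ − 10ε` (TeX L2803: *"0 < β <
1/4 − 10ε"*), `L^{β−3} < 1` (*"since the series converges"*, TeX L3053). [cite: Dimock2013, §5 Theorem 24 eq. (eg) (arXiv:1108.1335v2 TeX L3014–3053)] -/
theorem vacuumEnergy_of_flow (hB : StepBounds S lam Lr A eps) (h : FlowSmall lam Lr A eps β K) (hL1 : 1 ≤ Lr)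
    (hβ : β ≤ 1 / 4 - 10 * eps) (hq : Lr ^ (β - 3) < 1) {μ : Fin (K + 1) → ℝ}
    {Ek : (k : Fin (K + 1)) → E k.val} (hb : InBall lam β K μ Ek) {ε : Fin (K + 1) → ℝ}
    (hεK : ε (Fin.last K) = 0)
    (hrec : ∀ j : Fin K, ε (prev j) = (Lr ^ 3)⁻¹ *
      (ε j.succ - S.L1 (prev j).val (Ek (prev j)) - S.eps (prev j).val (μ (prev j)) (Ek (prev j)))) :
    ∀ k : Fin (K + 1), |ε k| ≤ (1 + A) / (1 - Lr ^ (β - 3)) * lam k.val ^ β := by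
  -- extend ε to ℕ
  set x : ℕ → ℝ := fun i => if hi : i < K + 1 then ε ⟨i, hi⟩ else 0 with hx
  have hxK : x K = 0 := by
    rw [hx]; simp only [dif_pos (Nat.lt_succ_self K)]; exact hεK
  have hstep : ∀ k, k < K → |x k| ≤ (Lr ^ 3)⁻¹ * |x (k + 1)| + (1 + A) * lam k ^ β := by
    intro k hk
    set j : Fin K := ⟨k, hk⟩ with hj
    have exk : x k = ε (prev j) := by rw [hx]; simp only [dif_pos (Nat.lt_succ_of_lt hk)]; rfl
    have exk1 : x (k + 1) = ε j.succ := by rw [hx]; simp only [dif_pos (Nat.succ_lt_succ hk)]; rfl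
    rw [exk, exk1]
    have hkK : (prev j).val ≤ K := by show k ≤ K; omega
    have hw : 0 < lam (prev j).val ^ (1 / 2 + β) := h.wpos _ _
    -- the region of Theorem 14 for (μ_k, E_k)
    have hμ : |μ (prev j)| ≤ lam (prev j).val ^ (1 / 2 : ℝ) := ((hb _).1).trans (h.w_le_sqrt hkK)
    have hE : ‖Ek (prev j)‖ ≤ 1 := ((hb _).2).trans (h.u_le_one hkK)
    exact vacuumEnergy_step hL1 h.A_nonneg (h.lam_pos _) (h.lam_le_one _ hkK) hβ
      (((hB.L1_le _ _).trans (hb _).2)) (hB.eps_le _ _ _ hμ hE) (hrec j)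
  have main := vacuumEnergy_bound h.Lr_pos hq (by linarith [h.A_nonneg]) h.lam_pos h.lam_succ hxK hstep
  intro k
  have := main k.val (by omega)
  have exk : x k.val = ε k := by rw [hx]; simp only [dif_pos k.isLt]
  rw [exk] at this
  exact this

end VacuumEnergyOfFlow

/-! ## Part 5. A SANITY INSTANCE of the single-step shape (the parameter REGIME — joint satisfiability of `FlowSmall`
with explicit `L₀(β)`, `λ₀(L, 𝒪(1), β, ε)`, and the necessity of `β < ¼ − 10ε` — is the sibling leaf
`…Dimock2011to13.SmallFieldFlowRegime`: `flowSmall_regime`, `exists_flowSmall`, `flow_exists_unique_regime`,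
`quarter10_of_flowSmall`) -/

section Inhabited

variable {E : ℕ → Type*} [∀ k, NormedAddCommGroup (E k)] [∀ k, NormedSpace ℝ (E k)]

/-- SANITY INSTANCE (not Dimock's step): on ANY family of spaces the ZERO single-step data satisfy the shape
`StepBounds` for every positive scale sequence, `A ≥ 0`, `L ≥ 0` — so the hypothesis shape of Theorem 14 ∕ Lemma 22 is
consistent with `FlowSmall` at every `K` (whose own satisfiability, with the thresholds written out, is the sibling leaf
`SmallFieldFlowRegime.exists_flowSmall` ∕ `flow_exists_unique_regime`).  Dimock's actual step (the fluctuation integral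
of §4 on the spaces `Re 𝒦_k^{norm}`) is NOT constructed anywhere in the tree; this instance only rules out vacuity of the
typed implication (an inhabitant of the SHAPE of Theorem 14 ∕ Lemma 22, not a statement of the print).
[cite: Dimock2013, Theorem 14 and Lemma 22 (arXiv:1108.1335v2 TeX L1924–1952, L2693–2703)] -/
theorem StepBounds.zero (lam : ℕ → ℝ) {Lr A eps : ℝ} (hlam : ∀ k, 0 < lam k) (hA : 0 ≤ A) (hL : 0 ≤ Lr) :
    StepBounds (⟨fun _ => 0, fun _ => 0, fun _ => 0, fun _ _ _ => 0, fun _ _ _ => 0, fun _ _ _ => 0⟩ : StepMaps E)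
      lam Lr A eps := by
  have hnn : ∀ (k : ℕ) (s : ℝ), 0 ≤ A * Lr ^ 3 * lam k ^ s := fun k s =>
    mul_nonneg (mul_nonneg hA (pow_nonneg hL 3)) (Real.rpow_pos_of_pos (hlam k) s).le
  refine
    { L1_le := fun k e => by simp
      L2_le := fun k e => by
        simpa using mul_nonneg (Real.rpow_pos_of_pos (hlam k) _).le (norm_nonneg e)
      L3_le := fun k e => by simp
      eps_le := fun k μ e _ _ => by simpa using hnn k _
      mus_le := fun k μ e _ _ => by simpa using hnn k _
      Es_le := fun k μ e _ _ => by simpa using hnn k _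
      mus_lip := fun k μ₁ μ₂ e₁ e₂ _ _ _ _ => by
        have := add_nonneg (mul_nonneg (hnn k (1 / 4 - 4 * eps)) (abs_nonneg (μ₁ - μ₂)))
          (mul_nonneg (hnn k (3 / 4 - 4 * eps)) (norm_nonneg (e₁ - e₂)))
        simpa using this
      Es_lip := fun k μ₁ μ₂ e₁ e₂ _ _ _ _ => by
        have := add_nonneg (mul_nonneg (hnn k (-1 / 4 - 10 * eps)) (abs_nonneg (μ₁ - μ₂)))
          (mul_nonneg (hnn k (1 / 4 - 10 * eps)) (norm_nonneg (e₁ - e₂)))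
        simpa using this }

end Inhabited

/-! ## Part 6. The selected counterterms depend Lipschitz-continuously on the single-step data (companion of
Lemma 23 (2)'s contraction; the abstract half of any uniformity of `(μ_k, E_k)` in data the print keeps silent about) -/

section Dependence

variable {E : ℕ → Type*} [∀ k, NormedAddCommGroup (E k)] [∀ k, NormedSpace ℝ (E k)]
variable {S S' : StepMaps E} {lam : ℕ → ℝ} {Lr A eps β : ℝ} {K : ℕ}

/-- **THE FIXED POINT OF LEMMA 23 DEPENDS LIPSCHITZ-CONTINUOUSLY ON THE STEP DATA** (the standard companion of the
contraction argument TeX L2899 *"By the standard fixed point theorem in a complete metric space it suffices to show that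
the mapping is a contraction"* with constant `½`, Lemma 23 (2)): if two single-step data `S`, `S′` both obey the shape
`StepBounds` and their maps `T`, `T′` of (recursive5) differ by at most `δ` in the 𝖡-norm on the closed unit ball, then
their fixed points in the ball differ by at most `2δ` — `‖ξ − ξ′‖ = ‖Tξ − T′ξ′‖ ≤ ½‖ξ − ξ′‖ + δ`.  (This is the
abstract mechanism by which any dependence of the selected counterterms `(μ_k, E_k)` on data the print keeps silent
about — e.g. the volume exponent `𝖬` of the tori `𝕋⁰_{𝖬+𝖭−k}` on which the step maps live, TeX L2756–2757 — is
controlled by the corresponding dependence of the step maps; nothing about that dependence is asserted here.)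
[cite: Dimock2013, §5 Lemma 23 (2) (arXiv:1108.1335v2 TeX L2854–2860, L2898–2904)] -/
theorem fixedPoint_sub_fixedPoint_le (hB : StepBounds S lam Lr A eps) (h : FlowSmall lam Lr A eps β K)
    {ξ ξ' : Seq K E} (hξ : ‖ξ‖ ≤ 1) (hξ' : ‖ξ'‖ ≤ 1) (hfix : T S lam Lr β K ξ = ξ)
    (hfix' : T S' lam Lr β K ξ' = ξ') {δ : ℝ}
    (hδ : ∀ ζ : Seq K E, ‖ζ‖ ≤ 1 → ‖T S lam Lr β K ζ - T S' lam Lr β K ζ‖ ≤ δ) :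
    ‖ξ - ξ'‖ ≤ 2 * δ := by
  have h1 : ‖ξ - ξ'‖ ≤ ‖T S lam Lr β K ξ - T S lam Lr β K ξ'‖ + ‖T S lam Lr β K ξ' - T S' lam Lr β K ξ'‖ := by
    conv_lhs => rw [← hfix, ← hfix']
    exact norm_sub_le_norm_sub_add_norm_sub _ _ _
  have h2 := norm_T_sub_T_le hB h hξ hξ'
  have h3 := hδ ξ' hξ'
  linarith

/-- The same in the ORIGINAL variables, for the flows of Theorem 24: two flows `(μ, E)`, `(μ′, E′)` in the ball
(`IsFlow` + `InBall`) for step data `S` obeying `StepBounds` and ANY step data `S′`, whose maps `T`, `T′` differ by at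
most `δ` on the unit ball of 𝖡, satisfy `|μ_k − μ′_k| ≤ 2δ·λ_k^{½+β}` and `‖E_k − E′_k‖ ≤ 2δ·λ_k^β` at every level.
[cite: Dimock2013, §5 Lemma 23 (2) and Theorem 24 (arXiv:1108.1335v2 TeX L2854–2860, L3006–3022)] -/
theorem flow_sub_flow_le (hB : StepBounds S lam Lr A eps)
    (h : FlowSmall lam Lr A eps β K) {μ μ' : Fin (K + 1) → ℝ} {Ek Ek' : (k : Fin (K + 1)) → E k.val}
    (hF : IsFlow S Lr K μ Ek) (hb : InBall lam β K μ Ek) (hF' : IsFlow S' Lr K μ' Ek') (hb' : InBall lam β K μ' Ek')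
    {δ : ℝ} (hδ : ∀ ζ : Seq K E, ‖ζ‖ ≤ 1 → ‖T S lam Lr β K ζ - T S' lam Lr β K ζ‖ ≤ δ) (k : Fin (K + 1)) :
    |μ k - μ' k| ≤ 2 * δ * lam k.val ^ (1 / 2 + β) ∧ ‖Ek k - Ek' k‖ ≤ 2 * δ * lam k.val ^ β := by
  obtain ⟨hξ, hfix⟩ := rescale_fixed (S := S) h hF hb
  obtain ⟨hξ', hfix'⟩ := rescale_fixed (S := S') h hF' hb'
  have hd := fixedPoint_sub_fixedPoint_le hB h hξ hξ' hfix hfix' hδ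
  have hw : 0 < lam k.val ^ (1 / 2 + β) := h.wpos _ _
  have hu : 0 < lam k.val ^ β := h.wpos _ _
  have hk := norm_le_pi_norm (rescale lam β K μ Ek - rescale lam β K μ' Ek') k
  rw [Pi.sub_apply] at hk
  have hk1 := (norm_fst_le _).trans hk
  have hk2 := (norm_snd_le _).trans hk
  simp only [rescale, Prod.fst_sub, Prod.snd_sub, Real.norm_eq_abs] at hk1 hk2
  constructor
  · have : μ k - μ' k = lam k.val ^ (1 / 2 + β) * ((lam k.val ^ (1 / 2 + β))⁻¹ * μ k - (lam k.val ^ (1 / 2 + β))⁻¹ * μ' k) := by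
      rw [← mul_sub, ← mul_assoc, mul_inv_cancel₀ hw.ne', one_mul]
    rw [this, abs_mul, abs_of_pos hw]
    nlinarith
  · have : Ek k - Ek' k = lam k.val ^ β • ((lam k.val ^ β)⁻¹ • Ek k - (lam k.val ^ β)⁻¹ • Ek' k) := by
      rw [← smul_sub, smul_smul, mul_inv_cancel₀ hu.ne', one_smul]
    rw [this, norm_smul, Real.norm_eq_abs, abs_of_pos hu]
    nlinarith

end Dependence

/-! ## Part 7. TEMPERED CONTRACTION: `T` contracts by `ρ/2` in every `ρ`-tempered weighted sup-norm (`1 ≤ ρ < 2`),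
so the level-`k` counterterms depend on the level-`i` single-step data with the discount `ρ^{−|k−i|}` — the ultraviolet
counterterms forget the infrared step data and the infrared end of the trajectory forgets the ultraviolet step data,
geometrically (scale-localised form of Lemma 23 (2) and of Part 6; NOT a statement of the print) -/

section Tempered

variable {E : ℕ → Type*} [∀ k, NormedAddCommGroup (E k)] [∀ k, NormedSpace ℝ (E k)]
variable {S S' : StepMaps E} {lam : ℕ → ℝ} {Lr A eps β : ℝ} {K : ℕ}

/-- **LEVEL-BY-LEVEL FORM OF THE μ-HALF OF LEMMA 23 (2)** (the BANDED structure of (recursive5): *"μ′_k =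
L^{−2}(μ_{k+1} − 𝓛₂E_k − μ_k^*)"*, TeX L2827–2832 — level `k` of `Tξ` is fed by level `k + 1`, with the printed coefficient
`L^{β−3/2}` of TeX L2921–2924 *"The first term is L^{β−3/2}[λ_{k+1}^{−½−β}|μ_{1,k+1} − μ_{2,k+1}|] ≤ L^{β−3/2}‖ξ₁ −
ξ₂‖"*, and by level `k` itself, with the remaining
coefficient `L^{−2}λ_k^{6ε} + 2·𝒪(1)Lλ_k^{1/4−4ε} ≤ ½ − L^{β−3/2}` of `FlowSmall.c1`): for `ξ, η` in the closed unit ball and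
`k < K`, `|m′_k(ξ) − m′_k(η)| ≤ L^{β−3/2}‖ξ_{k+1} − η_{k+1}‖ + (½ − L^{β−3/2})‖ξ_k − η_k‖` (rescaled coordinates; the level
norm is the max norm of `ℝ × E_k`).  The print states and uses only the supremum over levels (`norm_T_sub_T_le`); the proof
is the printed one, verbatim, with the two level differences kept apart. [cite: Dimock2013, §5 Lemma 23 (2) (arXiv:1108.1335v2 TeX L2901–2956)] -/
theorem muNext_sub_muNext_le (hB : StepBounds S lam Lr A eps) (h : FlowSmall lam Lr A eps β K)
    {ξ η : Seq K E} (hξ : ‖ξ‖ ≤ 1) (hη : ‖η‖ ≤ 1) (k : Fin (K + 1)) (hk : k.val + 1 < K + 1) :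
    |muNext S lam Lr β K ξ k - muNext S lam Lr β K η k| ≤
      Lr ^ (β - 3 / 2) * ‖ξ ⟨k.val + 1, hk⟩ - η ⟨k.val + 1, hk⟩‖
        + (1 / 2 - Lr ^ (β - 3 / 2)) * ‖ξ k - η k‖ := by
  have hkK : k.val ≤ K := by omega
  set w := lam k.val ^ (1 / 2 + β) with hw
  set u := lam k.val ^ β with hu
  have hwpos : 0 < w := h.wpos _ _
  have hupos : 0 < u := h.wpos _ _
  have hc : 0 < (Lr ^ 2 * w)⁻¹ := by have := h.Lr_pos; positivity
  set D₁ := ‖ξ ⟨k.val + 1, hk⟩ - η ⟨k.val + 1, hk⟩‖ with hD₁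
  set D₀ := ‖ξ k - η k‖ with hD₀
  have hD₀0 : 0 ≤ D₀ := norm_nonneg _
  have hdm1 : |(ξ ⟨k.val + 1, hk⟩).1 - (η ⟨k.val + 1, hk⟩).1| ≤ D₁ := by
    have := norm_fst_le (ξ ⟨k.val + 1, hk⟩ - η ⟨k.val + 1, hk⟩)
    simpa only [Prod.fst_sub, Real.norm_eq_abs] using this
  have hdm : |(ξ k).1 - (η k).1| ≤ D₀ := by
    have := norm_fst_le (ξ k - η k)
    simpa only [Prod.fst_sub, Real.norm_eq_abs] using this
  have hde : ‖(ξ k).2 - (η k).2‖ ≤ D₀ := by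
    have := norm_snd_le (ξ k - η k)
    simpa only [Prod.snd_sub] using this
  have hwm : ∀ ζ : Seq K E, ‖ζ‖ ≤ 1 → |w * (ζ k).1| ≤ lam k.val ^ (1 / 2 : ℝ) / 2 := fun ζ hζ => by
    rw [abs_mul, abs_of_pos hwpos]
    exact (mul_le_of_le_one_right hwpos.le ((abs_fst_le ζ k).trans hζ)).trans (h.w_le_half_sqrt hkK)
  have hue : ∀ ζ : Seq K E, ‖ζ‖ ≤ 1 → ‖u • (ζ k).2‖ ≤ 1 / 2 := fun ζ hζ => by
    rw [norm_smul, Real.norm_eq_abs, abs_of_pos hupos]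
    exact (mul_le_of_le_one_right hupos.le ((norm_snd_le' ζ k).trans hζ)).trans (h.half _ hkK)
  unfold muNext
  rw [dif_pos hk, dif_pos hk]
  have h1 : |lam (k.val + 1) ^ (1 / 2 + β) * (ξ ⟨k.val + 1, hk⟩).1
      - lam (k.val + 1) ^ (1 / 2 + β) * (η ⟨k.val + 1, hk⟩).1| ≤ lam (k.val + 1) ^ (1 / 2 + β) * D₁ := by
    rw [← mul_sub, abs_mul, abs_of_pos (h.wpos _ _)]
    exact mul_le_mul_of_nonneg_left hdm1 (h.wpos _ _).le
  have h2 : |S.L2 k.val (u • (ξ k).2) - S.L2 k.val (u • (η k).2)| ≤ lam k.val ^ (1 / 2 + 6 * eps) * u * D₀ := by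
    rw [← map_sub, ← smul_sub]
    refine (hB.L2_le _ _).trans ?_
    rw [norm_smul, Real.norm_eq_abs, abs_of_pos hupos, mul_assoc]
    exact mul_le_mul_of_nonneg_left (mul_le_mul_of_nonneg_left hde hupos.le) (h.wpos _ _).le
  have h3 : |S.mus k.val (w * (ξ k).1) (u • (ξ k).2) - S.mus k.val (w * (η k).1) (u • (η k).2)|
      ≤ A * Lr ^ 3 * lam k.val ^ (1 / 4 - 4 * eps) * w * D₀
        + A * Lr ^ 3 * lam k.val ^ (3 / 4 - 4 * eps) * u * D₀ := by
    refine (hB.mus_lip _ _ _ _ _ (hwm ξ hξ) (hwm η hη) (hue ξ hξ) (hue η hη)).trans ?_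
    rw [← mul_sub, abs_mul, abs_of_pos hwpos, ← smul_sub, norm_smul, Real.norm_eq_abs, abs_of_pos hupos]
    have hA3 : 0 ≤ A * Lr ^ 3 := by have := h.A_nonneg; have := h.Lr_pos; positivity
    have i1 : A * Lr ^ 3 * lam k.val ^ (1 / 4 - 4 * eps) * (w * |(ξ k).1 - (η k).1|)
        ≤ A * Lr ^ 3 * lam k.val ^ (1 / 4 - 4 * eps) * w * D₀ := by
      rw [mul_assoc (A * Lr ^ 3 * lam k.val ^ (1 / 4 - 4 * eps)) w D₀]
      exact mul_le_mul_of_nonneg_left (mul_le_mul_of_nonneg_left hdm hwpos.le)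
        (mul_nonneg hA3 (h.wpos _ _).le)
    have i2 : A * Lr ^ 3 * lam k.val ^ (3 / 4 - 4 * eps) * (u * ‖(ξ k).2 - (η k).2‖)
        ≤ A * Lr ^ 3 * lam k.val ^ (3 / 4 - 4 * eps) * u * D₀ := by
      rw [mul_assoc (A * Lr ^ 3 * lam k.val ^ (3 / 4 - 4 * eps)) u D₀]
      exact mul_le_mul_of_nonneg_left (mul_le_mul_of_nonneg_left hde hupos.le)
        (mul_nonneg hA3 (h.wpos _ _).le)
    exact add_le_add i1 i2
  rw [← mul_sub, abs_mul, abs_of_pos hc]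
  have hsplit : (lam (k.val + 1) ^ (1 / 2 + β) * (ξ ⟨k.val + 1, hk⟩).1 - S.L2 k.val (u • (ξ k).2)
        - S.mus k.val (w * (ξ k).1) (u • (ξ k).2))
      - (lam (k.val + 1) ^ (1 / 2 + β) * (η ⟨k.val + 1, hk⟩).1 - S.L2 k.val (u • (η k).2)
        - S.mus k.val (w * (η k).1) (u • (η k).2))
      = (lam (k.val + 1) ^ (1 / 2 + β) * (ξ ⟨k.val + 1, hk⟩).1
          - lam (k.val + 1) ^ (1 / 2 + β) * (η ⟨k.val + 1, hk⟩).1)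
        - (S.L2 k.val (u • (ξ k).2) - S.L2 k.val (u • (η k).2))
        - (S.mus k.val (w * (ξ k).1) (u • (ξ k).2) - S.mus k.val (w * (η k).1) (u • (η k).2)) := by
    ring
  rw [hsplit]
  have habs := (abs_sub _ _).trans (add_le_add ((abs_sub _ _).trans (add_le_add h1 h2)) h3)
  refine (mul_le_mul_of_nonneg_left habs hc.le).trans ?_
  have ea := h.ident_a k.val
  have eb := h.ident_b k.val
  have ec := (h.ident_c' k.val).1
  have ec' := (h.ident_c' k.val).2
  rw [← hw] at ea eb ec ec'
  rw [← hu] at eb ec'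
  have hval : (Lr ^ 2 * w)⁻¹ * (lam (k.val + 1) ^ (1 / 2 + β) * D₁ + lam k.val ^ (1 / 2 + 6 * eps) * u * D₀
        + (A * Lr ^ 3 * lam k.val ^ (1 / 4 - 4 * eps) * w * D₀
          + A * Lr ^ 3 * lam k.val ^ (3 / 4 - 4 * eps) * u * D₀))
      = Lr ^ (β - 3 / 2) * D₁ + ((Lr ^ 2)⁻¹ * lam k.val ^ (6 * eps)
          + 2 * (A * Lr * lam k.val ^ (1 / 4 - 4 * eps))) * D₀ := by
    calc (Lr ^ 2 * w)⁻¹ * (lam (k.val + 1) ^ (1 / 2 + β) * D₁ + lam k.val ^ (1 / 2 + 6 * eps) * u * D₀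
          + (A * Lr ^ 3 * lam k.val ^ (1 / 4 - 4 * eps) * w * D₀
            + A * Lr ^ 3 * lam k.val ^ (3 / 4 - 4 * eps) * u * D₀))
        = ((Lr ^ 2 * w)⁻¹ * lam (k.val + 1) ^ (1 / 2 + β)) * D₁
            + ((Lr ^ 2 * w)⁻¹ * (lam k.val ^ (1 / 2 + 6 * eps) * u)
              + ((Lr ^ 2 * w)⁻¹ * (A * Lr ^ 3 * lam k.val ^ (1 / 4 - 4 * eps) * w)
                + (Lr ^ 2 * w)⁻¹ * (A * Lr ^ 3 * lam k.val ^ (3 / 4 - 4 * eps) * u))) * D₀ := by ring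
      _ = Lr ^ (β - 3 / 2) * D₁ + ((Lr ^ 2)⁻¹ * lam k.val ^ (6 * eps)
          + 2 * (A * Lr * lam k.val ^ (1 / 4 - 4 * eps))) * D₀ := by rw [ea, eb, ec, ec']; ring
  rw [hval]
  have hrest : (Lr ^ 2)⁻¹ * lam k.val ^ (6 * eps) + 2 * (A * Lr * lam k.val ^ (1 / 4 - 4 * eps))
      ≤ 1 / 2 - Lr ^ (β - 3 / 2) := by linarith [h.c1 _ hkK]
  exact add_le_add le_rfl (mul_le_mul_of_nonneg_right hrest hD₀0)

/-- At the last level the μ-component of `T` is the boundary value `μ′_K = 0` for every argument. [folklore] -/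
private theorem muNext_eq_zero_of_not {ξ : Seq K E} (k : Fin (K + 1)) (hk : ¬ k.val + 1 < K + 1) :
    muNext S lam Lr β K ξ k = 0 := by
  unfold muNext; rw [dif_neg hk]

/-- **LEVEL-BY-LEVEL FORM OF THE E-HALF OF LEMMA 23 (2)** (*"E′_k = 𝓛₃E_{k−1} + E^*_{k−1}"*, TeX L2827–2832 —
level `k` of `Tξ` is fed by level `k − 1` only, with total coefficient `L^{−β} + 2·𝒪(1)L^{3−β}λ_{k−1}^{1/4−10ε} ≤ ½` of
`FlowSmall.c2`, TeX L2960–2997): `‖e′_{j+1}(ξ) − e′_{j+1}(η)‖ ≤ ½‖ξ_j − η_j‖` for `ξ, η` in the closed unit ball.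
[cite: Dimock2013, §5 Lemma 23 (2) (arXiv:1108.1335v2 TeX L2960–2997)] -/
theorem eNext_sub_eNext_le (hB : StepBounds S lam Lr A eps) (h : FlowSmall lam Lr A eps β K)
    {ξ η : Seq K E} (hξ : ‖ξ‖ ≤ 1) (hη : ‖η‖ ≤ 1) (j : Fin K) :
    ‖eNext S lam β K ξ j.succ - eNext S lam β K η j.succ‖ ≤ 1 / 2 * ‖ξ (prev j) - η (prev j)‖ := by
  have hjK : (prev j).val ≤ K := by show j.val ≤ K; omega
  rw [eNext_succ, eNext_succ]
  set w := lam (prev j).val ^ (1 / 2 + β) with hw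
  set u := lam (prev j).val ^ β with hu
  have hwpos : 0 < w := h.wpos _ _
  have hupos : 0 < u := h.wpos _ _
  have hu1 : 0 < lam ((prev j).val + 1) ^ β := h.wpos _ _
  set ξj := ξ (prev j) with hξj
  set ηj := η (prev j) with hηj
  set D := ‖ξj - ηj‖ with hD
  have hD0 : 0 ≤ D := norm_nonneg _
  have hdm : |ξj.1 - ηj.1| ≤ D := by
    have := norm_fst_le (ξj - ηj)
    simpa only [Prod.fst_sub, Real.norm_eq_abs] using this
  have hde : ‖ξj.2 - ηj.2‖ ≤ D := by
    have := norm_snd_le (ξj - ηj)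
    simpa only [Prod.snd_sub] using this
  have hwm : ∀ ζ : Seq K E, ‖ζ‖ ≤ 1 →
      |w * (ζ (prev j)).1| ≤ lam (prev j).val ^ (1 / 2 : ℝ) / 2 := fun ζ hζ => by
    rw [abs_mul, abs_of_pos hwpos]
    exact (mul_le_of_le_one_right hwpos.le ((abs_fst_le ζ _).trans hζ)).trans (h.w_le_half_sqrt hjK)
  have hue : ∀ ζ : Seq K E, ‖ζ‖ ≤ 1 →
      ‖u • (ζ (prev j)).2‖ ≤ 1 / 2 := fun ζ hζ => by
    rw [norm_smul, Real.norm_eq_abs, abs_of_pos hupos]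
    exact (mul_le_of_le_one_right hupos.le ((norm_snd_le' ζ _).trans hζ)).trans (h.half _ hjK)
  have h1 : ‖S.L3 (prev j).val (u • ξj.2) - S.L3 (prev j).val (u • ηj.2)‖ ≤ u * D := by
    rw [← map_sub, ← smul_sub]
    refine (hB.L3_le _ _).trans ?_
    rw [norm_smul, Real.norm_eq_abs, abs_of_pos hupos]
    exact mul_le_mul_of_nonneg_left hde hupos.le
  have hA3 : 0 ≤ A * Lr ^ 3 := by have := h.A_nonneg; have := h.Lr_pos; positivity
  have h2 : ‖S.Es (prev j).val (w * ξj.1) (u • ξj.2) - S.Es (prev j).val (w * ηj.1) (u • ηj.2)‖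
      ≤ A * Lr ^ 3 * lam (prev j).val ^ (-1 / 4 - 10 * eps) * w * D
        + A * Lr ^ 3 * lam (prev j).val ^ (1 / 4 - 10 * eps) * u * D := by
    refine (hB.Es_lip _ _ _ _ _ (hwm ξ hξ) (hwm η hη) (hue ξ hξ) (hue η hη)).trans ?_
    rw [← mul_sub, abs_mul, abs_of_pos hwpos, ← smul_sub, norm_smul, Real.norm_eq_abs, abs_of_pos hupos]
    have i1 : A * Lr ^ 3 * lam (prev j).val ^ (-1 / 4 - 10 * eps) * (w * |ξj.1 - ηj.1|)
        ≤ A * Lr ^ 3 * lam (prev j).val ^ (-1 / 4 - 10 * eps) * w * D := by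
      rw [mul_assoc (A * Lr ^ 3 * lam (prev j).val ^ (-1 / 4 - 10 * eps)) w D]
      exact mul_le_mul_of_nonneg_left (mul_le_mul_of_nonneg_left hdm hwpos.le)
        (mul_nonneg hA3 (h.wpos _ _).le)
    have i2 : A * Lr ^ 3 * lam (prev j).val ^ (1 / 4 - 10 * eps) * (u * ‖ξj.2 - ηj.2‖)
        ≤ A * Lr ^ 3 * lam (prev j).val ^ (1 / 4 - 10 * eps) * u * D := by
      rw [mul_assoc (A * Lr ^ 3 * lam (prev j).val ^ (1 / 4 - 10 * eps)) u D]
      exact mul_le_mul_of_nonneg_left (mul_le_mul_of_nonneg_left hde hupos.le)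
        (mul_nonneg hA3 (h.wpos _ _).le)
    exact add_le_add i1 i2
  have ed := h.ident_d (prev j).val
  have ee := h.ident_e' (prev j).val
  have ef := h.ident_f (prev j).val
  rw [← hu] at ed ef
  rw [← hw] at ee
  calc ‖(lam ((prev j).val + 1) ^ β)⁻¹ • (S.L3 (prev j).val (u • ξj.2) + S.Es (prev j).val (w * ξj.1) (u • ξj.2))
        - (lam ((prev j).val + 1) ^ β)⁻¹ • (S.L3 (prev j).val (u • ηj.2) + S.Es (prev j).val (w * ηj.1) (u • ηj.2))‖
      = (lam ((prev j).val + 1) ^ β)⁻¹ * ‖(S.L3 (prev j).val (u • ξj.2) - S.L3 (prev j).val (u • ηj.2))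
          + (S.Es (prev j).val (w * ξj.1) (u • ξj.2) - S.Es (prev j).val (w * ηj.1) (u • ηj.2))‖ := by
        rw [← smul_sub, norm_smul, norm_inv, Real.norm_eq_abs, abs_of_pos hu1]
        congr 1
        abel_nf
    _ ≤ (lam ((prev j).val + 1) ^ β)⁻¹ * (u * D + (A * Lr ^ 3 * lam (prev j).val ^ (-1 / 4 - 10 * eps) * w * D
          + A * Lr ^ 3 * lam (prev j).val ^ (1 / 4 - 10 * eps) * u * D)) :=
        mul_le_mul_of_nonneg_left ((norm_add_le _ _).trans (add_le_add h1 h2)) (inv_nonneg.2 hu1.le)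
    _ = ((lam ((prev j).val + 1) ^ β)⁻¹ * u
          + ((lam ((prev j).val + 1) ^ β)⁻¹ * (A * Lr ^ 3 * lam (prev j).val ^ (-1 / 4 - 10 * eps) * w)
            + (lam ((prev j).val + 1) ^ β)⁻¹ * (A * Lr ^ 3 * lam (prev j).val ^ (1 / 4 - 10 * eps) * u))) * D := by
        ring
    _ = (Lr ^ (-β) + 2 * (A * Lr ^ (3 - β) * lam (prev j).val ^ (1 / 4 - 10 * eps))) * D := by
        rw [ed, ee, ef]; ring
    _ ≤ 1 / 2 * D := mul_le_mul_of_nonneg_right (h.c2 _ hjK) hD0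

/-- **TEMPERED CONTRACTION** (NOT a statement of the print — the standard weighted-norm refinement of Lemma 23 (2),
which is the case `ρ = 1`, `w ≡ 1`): for every `ρ ≥ 1` and every non-negative weight sequence `w` that is `ρ`-TEMPERED
(`w_i ≤ ρ·w_{i+1}` and `w_{i+1} ≤ ρ·w_i`), the map `T` of (recursive5) satisfies, on the closed unit ball of 𝖡 and level by
level, `w_k‖(Tξ)_k − (Tη)_k‖ ≤ (ρ/2)·sup_i w_i‖ξ_i − η_i‖`.  Mechanism: the banded structure — the μ-component at level `k`
pulls from level `k + 1` with coefficient `L^{β−3/2} ≤ ¼` (`FlowSmall.j1`, TeX L2880 *"we use that L^{β−3/2} ≤ 1/4 for L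
large"*) and from level `k` with coefficient `≤ ½ − L^{β−3/2}`, so its weighted coefficient is
`L^{β−3/2}ρ + (½ − L^{β−3/2}) = ½ + L^{β−3/2}(ρ − 1) ≤ ½ + ¼(ρ − 1) ≤ ρ/2`; the E-component at level `k` pulls from level
`k − 1` with coefficient `≤ ½`, weighted `≤ ρ/2`.  Hence `T` is a strict contraction in every `ρ`-tempered norm with `ρ < 2`:
a perturbation at one level is felt at scale distance `n` with a discount `ρ^{−n}`, for any `ρ < 2`. [cite: Dimock2013, §5 Lemma 23 (2) (arXiv:1108.1335v2 TeX L2854–2860, L2898–2999)] -/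
theorem tempered_T_sub_T_le (hB : StepBounds S lam Lr A eps) (h : FlowSmall lam Lr A eps β K)
    {ξ η : Seq K E} (hξ : ‖ξ‖ ≤ 1) (hη : ‖η‖ ≤ 1) {ρ : ℝ} (hρ : 1 ≤ ρ) {w : ℕ → ℝ} (hw0 : ∀ i, 0 ≤ w i)
    (hup : ∀ i, w i ≤ ρ * w (i + 1)) (hdn : ∀ i, w (i + 1) ≤ ρ * w i) {M : ℝ}
    (hM : ∀ i : Fin (K + 1), w i.val * ‖ξ i - η i‖ ≤ M) (k : Fin (K + 1)) :
    w k.val * ‖T S lam Lr β K ξ k - T S lam Lr β K η k‖ ≤ ρ / 2 * M := by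
  have hM0 : 0 ≤ M := (mul_nonneg (hw0 _) (norm_nonneg _)).trans (hM 0)
  have hρ0 : 0 ≤ ρ := zero_le_one.trans hρ
  rw [T, T, Prod.mk_sub_mk, Prod.norm_def, mul_max_of_nonneg _ _ (hw0 _), max_le_iff]
  constructor
  · -- the μ-component: level k is fed by levels k + 1 (weight ratio ≤ ρ, coefficient ≤ ¼) and k
    rw [Real.norm_eq_abs]
    by_cases hk : k.val + 1 < K + 1
    · have hloc := muNext_sub_muNext_le hB h hξ hη k hk
      have ha0 : 0 ≤ Lr ^ (β - 3 / 2) := (Real.rpow_pos_of_pos h.Lr_pos _).le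
      have ha := h.j1
      have hnext : w k.val * ‖ξ ⟨k.val + 1, hk⟩ - η ⟨k.val + 1, hk⟩‖ ≤ ρ * M := by
        calc w k.val * ‖ξ ⟨k.val + 1, hk⟩ - η ⟨k.val + 1, hk⟩‖
            ≤ ρ * w (k.val + 1) * ‖ξ ⟨k.val + 1, hk⟩ - η ⟨k.val + 1, hk⟩‖ :=
              mul_le_mul_of_nonneg_right (hup _) (norm_nonneg _)
          _ = ρ * (w (k.val + 1) * ‖ξ ⟨k.val + 1, hk⟩ - η ⟨k.val + 1, hk⟩‖) := by ring
          _ ≤ ρ * M := mul_le_mul_of_nonneg_left (hM ⟨k.val + 1, hk⟩) hρ0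
      have hhere : w k.val * ‖ξ k - η k‖ ≤ M := hM k
      calc w k.val * |muNext S lam Lr β K ξ k - muNext S lam Lr β K η k|
          ≤ w k.val * (Lr ^ (β - 3 / 2) * ‖ξ ⟨k.val + 1, hk⟩ - η ⟨k.val + 1, hk⟩‖
              + (1 / 2 - Lr ^ (β - 3 / 2)) * ‖ξ k - η k‖) := mul_le_mul_of_nonneg_left hloc (hw0 _)
        _ = Lr ^ (β - 3 / 2) * (w k.val * ‖ξ ⟨k.val + 1, hk⟩ - η ⟨k.val + 1, hk⟩‖)
              + (1 / 2 - Lr ^ (β - 3 / 2)) * (w k.val * ‖ξ k - η k‖) := by ring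
        _ ≤ Lr ^ (β - 3 / 2) * (ρ * M) + (1 / 2 - Lr ^ (β - 3 / 2)) * M :=
              add_le_add (mul_le_mul_of_nonneg_left hnext ha0)
                (mul_le_mul_of_nonneg_left hhere (by linarith))
        _ ≤ ρ / 2 * M := by
              have key : 0 ≤ (1 / 2 - Lr ^ (β - 3 / 2)) * (ρ - 1) * M :=
                mul_nonneg (mul_nonneg (by linarith) (by linarith)) hM0
              nlinarith [key]
    · rw [muNext_eq_zero_of_not k hk, muNext_eq_zero_of_not k hk, sub_zero, abs_zero, mul_zero]
      positivity
  · -- the E-component: level j + 1 is fed by level j (weight ratio ≤ ρ, coefficient ≤ ½)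
    rcases Fin.eq_zero_or_eq_succ k with rfl | ⟨j, rfl⟩
    · rw [eNext_zero, eNext_zero, sub_zero, norm_zero, mul_zero]; positivity
    · have hloc := eNext_sub_eNext_le hB h hξ hη j
      have hval : (j.succ).val = (prev j).val + 1 := rfl
      calc w j.succ.val * ‖eNext S lam β K ξ j.succ - eNext S lam β K η j.succ‖
          ≤ w j.succ.val * (1 / 2 * ‖ξ (prev j) - η (prev j)‖) := mul_le_mul_of_nonneg_left hloc (hw0 _)
        _ ≤ ρ * w (prev j).val * (1 / 2 * ‖ξ (prev j) - η (prev j)‖) := by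
              rw [hval]
              exact mul_le_mul_of_nonneg_right (hdn _) (by positivity)
        _ = ρ / 2 * (w (prev j).val * ‖ξ (prev j) - η (prev j)‖) := by ring
        _ ≤ ρ / 2 * M := mul_le_mul_of_nonneg_left (hM _) (by positivity)

/-- **TEMPERED DEPENDENCE OF THE FIXED POINT ON THE SINGLE-STEP DATA** (scale-localised form of Part 6's
`fixedPoint_sub_fixedPoint_le`, which is the case `ρ = 1`, `w ≡ 1`; NOT a statement of the print): let `S` obey `StepBounds`,
let `S′` be ANY single-step data, and let `ξ`, `ξ′` be fixed points of their maps `T`, `T′` in the closed unit ball of 𝖡.  If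
the two maps differ at level `k` by at most `δ_k` on the ball, then for every `ρ ∈ [1, 2)` and every non-negative `ρ`-tempered
weight `w` with `w_kδ_k ≤ D` for all `k`:  `w_k‖ξ_k − ξ′_k‖ ≤ (1 − ρ/2)⁻¹·D` at every level — from `M ≤ (ρ/2)M + D` for the
maximal weighted level distance `M` (`tempered_T_sub_T_le`).  (The abstract mechanism by which a dependence of the step maps
on data the print keeps silent about — e.g. the volume exponent `𝖬` of the tori `𝕋⁰_{𝖬+𝖭−k}`, TeX L2756–2757, cell record
Q-TM98-1 — is inherited by the selected counterterms WITH A GEOMETRIC DISCOUNT in the scale distance; nothing about such a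
dependence of Dimock's step maps is asserted here.) [cite: Dimock2013, §5 Lemma 23 (2) (arXiv:1108.1335v2 TeX L2854–2860, L2898–2904)] -/
theorem tempered_fixedPoint_sub_le (hB : StepBounds S lam Lr A eps) (h : FlowSmall lam Lr A eps β K)
    {ξ ξ' : Seq K E} (hξ : ‖ξ‖ ≤ 1) (hξ' : ‖ξ'‖ ≤ 1) (hfix : T S lam Lr β K ξ = ξ)
    (hfix' : T S' lam Lr β K ξ' = ξ') {ρ : ℝ} (hρ : 1 ≤ ρ) (hρ2 : ρ < 2) {w : ℕ → ℝ} (hw0 : ∀ i, 0 ≤ w i)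
    (hup : ∀ i, w i ≤ ρ * w (i + 1)) (hdn : ∀ i, w (i + 1) ≤ ρ * w i) {δ : ℕ → ℝ}
    (hδ : ∀ ζ : Seq K E, ‖ζ‖ ≤ 1 → ∀ k : Fin (K + 1), ‖T S lam Lr β K ζ k - T S' lam Lr β K ζ k‖ ≤ δ k.val)
    {D : ℝ} (hD : ∀ k : Fin (K + 1), w k.val * δ k.val ≤ D) (k : Fin (K + 1)) :
    w k.val * ‖ξ k - ξ' k‖ ≤ (1 - ρ / 2)⁻¹ * D := by
  -- the weighted distance attains its maximum `M` at some level `k₀`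
  obtain ⟨k₀, -, hk₀⟩ := Finset.exists_max_image Finset.univ (fun i : Fin (K + 1) => w i.val * ‖ξ i - ξ' i‖)
    Finset.univ_nonempty
  set M := w k₀.val * ‖ξ k₀ - ξ' k₀‖ with hM
  have hMi : ∀ i : Fin (K + 1), w i.val * ‖ξ i - ξ' i‖ ≤ M := fun i => hk₀ i (Finset.mem_univ i)
  -- `M ≤ ρ/2 · M + D`
  have hstep : ∀ i : Fin (K + 1), w i.val * ‖ξ i - ξ' i‖ ≤ ρ / 2 * M + D := fun i => by
    have e : ξ i - ξ' i = (T S lam Lr β K ξ i - T S lam Lr β K ξ' i) + (T S lam Lr β K ξ' i - T S' lam Lr β K ξ' i) := by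
      conv_lhs => rw [← hfix, ← hfix']
      abel
    calc w i.val * ‖ξ i - ξ' i‖
        ≤ w i.val * (‖T S lam Lr β K ξ i - T S lam Lr β K ξ' i‖ + ‖T S lam Lr β K ξ' i - T S' lam Lr β K ξ' i‖) := by
          rw [e]; exact mul_le_mul_of_nonneg_left (norm_add_le _ _) (hw0 _)
      _ = w i.val * ‖T S lam Lr β K ξ i - T S lam Lr β K ξ' i‖
            + w i.val * ‖T S lam Lr β K ξ' i - T S' lam Lr β K ξ' i‖ := by ring
      _ ≤ ρ / 2 * M + D := add_le_add (tempered_T_sub_T_le hB h hξ hξ' hρ hw0 hup hdn hMi i)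
            ((mul_le_mul_of_nonneg_left (hδ ξ' hξ' i) (hw0 _)).trans (hD i))
  have hMle : M ≤ ρ / 2 * M + D := hstep k₀
  have hgap : 0 < 1 - ρ / 2 := by linarith
  have hMbound : M ≤ (1 - ρ / 2)⁻¹ * D := by
    rw [le_inv_mul_iff₀ hgap]; nlinarith
  exact (hMi k).trans hMbound

/-- If the single-step DATA `(𝓛₂, μ^*, 𝓛₃, E^*)` agree at every level `i < j`, the maps `T`, `T′` agree at every level `k < j`
(level `k` of `T` reads `𝓛₂, μ^*` at level `k` and `𝓛₃, E^*` at level `k − 1`). [folklore] -/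
private theorem T_apply_eq_below {j : ℕ} (h2 : ∀ i, i < j → S.L2 i = S'.L2 i)
    (hm : ∀ i, i < j → S.mus i = S'.mus i) (h3 : ∀ i, i < j → S.L3 i = S'.L3 i)
    (hE : ∀ i, i < j → S.Es i = S'.Es i) (ζ : Seq K E) (k : Fin (K + 1)) (hk : k.val < j) :
    T S lam Lr β K ζ k = T S' lam Lr β K ζ k := by
  refine Prod.ext ?_ ?_
  · show muNext S lam Lr β K ζ k = muNext S' lam Lr β K ζ k
    unfold muNext
    split_ifs with hk'
    · rw [h2 _ hk, hm _ hk]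
    · rfl
  · show eNext S lam β K ζ k = eNext S' lam β K ζ k
    rcases Fin.eq_zero_or_eq_succ k with rfl | ⟨i, rfl⟩
    · rfl
    · have hi : (prev i).val < j := by
        have : (i.succ).val = (prev i).val + 1 := rfl
        omega
      rw [eNext_succ, eNext_succ, h3 _ hi, hE _ hi]

/-- If the single-step DATA agree at every level `i ≥ j`, the maps `T`, `T′` agree at every level `k > j`. [folklore] -/
private theorem T_apply_eq_above {j : ℕ} (h2 : ∀ i, j ≤ i → S.L2 i = S'.L2 i)
    (hm : ∀ i, j ≤ i → S.mus i = S'.mus i) (h3 : ∀ i, j ≤ i → S.L3 i = S'.L3 i)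
    (hE : ∀ i, j ≤ i → S.Es i = S'.Es i) (ζ : Seq K E) (k : Fin (K + 1)) (hk : j < k.val) :
    T S lam Lr β K ζ k = T S' lam Lr β K ζ k := by
  refine Prod.ext ?_ ?_
  · show muNext S lam Lr β K ζ k = muNext S' lam Lr β K ζ k
    unfold muNext
    split_ifs with hk'
    · rw [h2 _ hk.le, hm _ hk.le]
    · rfl
  · show eNext S lam β K ζ k = eNext S' lam β K ζ k
    rcases Fin.eq_zero_or_eq_succ k with rfl | ⟨i, rfl⟩
    · rfl
    · have hi : j ≤ (prev i).val := by
        have : (i.succ).val = (prev i).val + 1 := rfl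
        omega
      rw [eNext_succ, eNext_succ, h3 _ hi, hE _ hi]

/-- The geometric weights `ρ^{(j − i)₊}` and `ρ^{(i − j)₊}` (truncated subtraction) are non-negative and `ρ`-tempered for
`ρ ≥ 1`. [folklore] -/
private theorem geom_tempered {ρ : ℝ} (hρ : 1 ≤ ρ) (j : ℕ) :
    (∀ i, 0 ≤ ρ ^ (j - i)) ∧ (∀ i, ρ ^ (j - i) ≤ ρ * ρ ^ (j - (i + 1))) ∧
      (∀ i, ρ ^ (j - (i + 1)) ≤ ρ * ρ ^ (j - i)) ∧
    (∀ i, 0 ≤ ρ ^ (i - j)) ∧ (∀ i, ρ ^ (i - j) ≤ ρ * ρ ^ (i + 1 - j)) ∧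
      (∀ i, ρ ^ (i + 1 - j) ≤ ρ * ρ ^ (i - j)) := by
  have hρ0 : 0 ≤ ρ := zero_le_one.trans hρ
  have hmono : ∀ a b : ℕ, a ≤ b + 1 → ρ ^ a ≤ ρ * ρ ^ b := fun a b hab => by
    rw [← pow_succ']
    exact pow_le_pow_right₀ hρ hab
  refine ⟨fun i => pow_nonneg hρ0 _, fun i => hmono _ _ (by omega), fun i => hmono _ _ (by omega),
    fun i => pow_nonneg hρ0 _, fun i => hmono _ _ (by omega), fun i => hmono _ _ (by omega)⟩

/-- **THE ULTRAVIOLET COUNTERTERMS FORGET THE INFRARED STEP DATA GEOMETRICALLY** (NOT a statement of the print; a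
consequence of `tempered_fixedPoint_sub_le` with the weight `ρ^{(j−k)₊}`): if `S` obeys `StepBounds`, the single-step data
`S`, `S′` AGREE AT EVERY LEVEL `i < j`, and their maps differ by at most `δ` on the closed unit ball of 𝖡 (as in Part 6),
then fixed points `ξ`, `ξ′` in the ball satisfy `ρ^{j−k}‖ξ_k − ξ′_k‖ ≤ (1 − ρ/2)⁻¹δ` for every `ρ ∈ [1, 2)` — at the levels
`k ≤ j` below the first modified step map the two counterterm trajectories differ by at most `(1 − ρ/2)⁻¹δ·ρ^{−(j−k)}`; in
particular the INITIAL counterterm (level 0; the `μ^𝖭_0` of I Theorem 1, selected here by the final condition `μ_K = 0`,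
TeX L2777–2780 *"This is non-perturbative renormalization - the initial values for ε, μ will depend on K and hence N"*) is
determined up to `(1 − ρ/2)⁻¹δρ^{−j}` by the first `j` step maps.  Recorded for cell record Q-TM98-1 (the tori
`𝕋⁰_{𝖬+𝖭−k}` carrying the step maps, TeX L2756–2757, depend on the volume exponent `𝖬` at every level; I Theorem 1 indexes
the counterterms by `𝖭` alone, TeX L237–249): an `𝖬`-dependence of the step maps confined to the infrared levels `≥ j`
moves the ultraviolet counterterms by at most `ρ^{−j}` times its size — the abstract half only; nothing about the
`𝖬`-dependence of Dimock's step maps is asserted. [cite: Dimock2013, §5 Lemma 23 (2) and Theorem 24 (arXiv:1108.1335v2 TeX L2854–2860, L3006–3022)] -/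
theorem fixedPoint_sub_le_of_agree_below (hB : StepBounds S lam Lr A eps) (h : FlowSmall lam Lr A eps β K)
    {ξ ξ' : Seq K E} (hξ : ‖ξ‖ ≤ 1) (hξ' : ‖ξ'‖ ≤ 1) (hfix : T S lam Lr β K ξ = ξ)
    (hfix' : T S' lam Lr β K ξ' = ξ') {j : ℕ} (h2 : ∀ i, i < j → S.L2 i = S'.L2 i)
    (hm : ∀ i, i < j → S.mus i = S'.mus i) (h3 : ∀ i, i < j → S.L3 i = S'.L3 i)
    (hE : ∀ i, i < j → S.Es i = S'.Es i) {δ : ℝ}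
    (hδ : ∀ ζ : Seq K E, ‖ζ‖ ≤ 1 → ‖T S lam Lr β K ζ - T S' lam Lr β K ζ‖ ≤ δ)
    {ρ : ℝ} (hρ : 1 ≤ ρ) (hρ2 : ρ < 2) (k : Fin (K + 1)) :
    ρ ^ (j - k.val) * ‖ξ k - ξ' k‖ ≤ (1 - ρ / 2)⁻¹ * δ := by
  obtain ⟨hw0, hup, hdn, -, -, -⟩ := geom_tempered hρ j
  have hδ0 : 0 ≤ δ := (norm_nonneg _).trans (hδ 0 (by simp))
  refine tempered_fixedPoint_sub_le hB h hξ hξ' hfix hfix' hρ hρ2 hw0 hup hdn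
    (δ := fun i => if i < j then 0 else δ) (fun ζ hζ i => ?_) (fun i => ?_) k
  · by_cases hi : i.val < j
    · rw [if_pos hi, T_apply_eq_below h2 hm h3 hE ζ i hi, sub_self, norm_zero]
    · rw [if_neg hi]
      exact (norm_le_pi_norm (T S lam Lr β K ζ - T S' lam Lr β K ζ) i).trans (hδ ζ hζ)
  · by_cases hi : i.val < j
    · rw [if_pos hi, mul_zero]; exact hδ0
    · rw [if_neg hi, Nat.sub_eq_zero_of_le (not_lt.1 hi), pow_zero, one_mul]

/-- **THE INFRARED END OF THE TRAJECTORY FORGETS THE ULTRAVIOLET STEP DATA GEOMETRICALLY** (NOT a statement of the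
print; `tempered_fixedPoint_sub_le` with the weight `ρ^{(k−j)₊}`): if `S` obeys `StepBounds`, the data `S`, `S′` AGREE AT
EVERY LEVEL `i ≥ j`, and their maps differ by at most `δ` on the closed unit ball, then fixed points in the ball satisfy
`ρ^{k−j}‖ξ_k − ξ′_k‖ ≤ (1 − ρ/2)⁻¹δ` for every `ρ ∈ [1, 2)`: a modification of the step maps confined to the ultraviolet
levels `< j` is felt at level `k ≥ j` with the discount `ρ^{−(k−j)}`.  This is the Markovian-template form of a FADING
MEMORY across scales: in the template it is a THEOREM of the hyperbolic structure of (recursive5) (modulo the single-step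
shapes `StepBounds`), whereas for Bałaban's history-dependent one-step functionals the cell's T⁴ spine can only HYPOTHESISE
it (`…Balaban1983to89.T4OutputRate.FadingMemory`, node U3, not printed; cell records C1-TM3, GAPS G-t4-U3-3) — an analogy of
mechanism, not an input to that node. [cite: Dimock2013, §5 Lemma 23 (2) and Theorem 24 (arXiv:1108.1335v2 TeX L2854–2860, L3006–3022)] -/
theorem fixedPoint_sub_le_of_agree_above (hB : StepBounds S lam Lr A eps) (h : FlowSmall lam Lr A eps β K)
    {ξ ξ' : Seq K E} (hξ : ‖ξ‖ ≤ 1) (hξ' : ‖ξ'‖ ≤ 1) (hfix : T S lam Lr β K ξ = ξ)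
    (hfix' : T S' lam Lr β K ξ' = ξ') {j : ℕ} (h2 : ∀ i, j ≤ i → S.L2 i = S'.L2 i)
    (hm : ∀ i, j ≤ i → S.mus i = S'.mus i) (h3 : ∀ i, j ≤ i → S.L3 i = S'.L3 i)
    (hE : ∀ i, j ≤ i → S.Es i = S'.Es i) {δ : ℝ}
    (hδ : ∀ ζ : Seq K E, ‖ζ‖ ≤ 1 → ‖T S lam Lr β K ζ - T S' lam Lr β K ζ‖ ≤ δ)
    {ρ : ℝ} (hρ : 1 ≤ ρ) (hρ2 : ρ < 2) (k : Fin (K + 1)) :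
    ρ ^ (k.val - j) * ‖ξ k - ξ' k‖ ≤ (1 - ρ / 2)⁻¹ * δ := by
  obtain ⟨-, -, -, hw0, hup, hdn⟩ := geom_tempered hρ j
  have hδ0 : 0 ≤ δ := (norm_nonneg _).trans (hδ 0 (by simp))
  refine tempered_fixedPoint_sub_le hB h hξ hξ' hfix hfix' hρ hρ2 hw0 hup hdn
    (δ := fun i => if j < i then 0 else δ) (fun ζ hζ i => ?_) (fun i => ?_) k
  · by_cases hi : j < i.val
    · rw [if_pos hi, T_apply_eq_above h2 hm h3 hE ζ i hi, sub_self, norm_zero]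
    · rw [if_neg hi]
      exact (norm_le_pi_norm (T S lam Lr β K ζ - T S' lam Lr β K ζ) i).trans (hδ ζ hζ)
  · by_cases hi : j < i.val
    · rw [if_pos hi, mul_zero]; exact hδ0
    · rw [if_neg hi, Nat.sub_eq_zero_of_le (not_lt.1 hi), pow_zero, one_mul]

/-- `fixedPoint_sub_le_of_agree_below` in the ORIGINAL variables with `ρ = 3/2` (so `(1 − ρ/2)⁻¹ = 4`), for the flows of
Theorem 24 (`IsFlow` + `InBall`; `S` obeying `StepBounds`, `S′` arbitrary): if the single-step data agree at every level
`i < j` and the maps differ by at most `δ` on the unit ball of 𝖡, then at every level `k`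
`|μ_k − μ′_k| ≤ 4δ·(2/3)^{j−k}·λ_k^{½+β}` and `‖E_k − E′_k‖ ≤ 4δ·(2/3)^{j−k}·λ_k^β` (truncated exponent: for `k ≥ j` the factor
is `1` and the bound is Part 6's up to the constant). [cite: Dimock2013, §5 Theorem 24 (arXiv:1108.1335v2 TeX L3006–3022)] -/
theorem flow_sub_flow_le_of_agree_below (hB : StepBounds S lam Lr A eps) (h : FlowSmall lam Lr A eps β K)
    {μ μ' : Fin (K + 1) → ℝ} {Ek Ek' : (k : Fin (K + 1)) → E k.val}
    (hF : IsFlow S Lr K μ Ek) (hb : InBall lam β K μ Ek) (hF' : IsFlow S' Lr K μ' Ek') (hb' : InBall lam β K μ' Ek')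
    {j : ℕ} (h2 : ∀ i, i < j → S.L2 i = S'.L2 i) (hm : ∀ i, i < j → S.mus i = S'.mus i)
    (h3 : ∀ i, i < j → S.L3 i = S'.L3 i) (hE : ∀ i, i < j → S.Es i = S'.Es i) {δ : ℝ}
    (hδ : ∀ ζ : Seq K E, ‖ζ‖ ≤ 1 → ‖T S lam Lr β K ζ - T S' lam Lr β K ζ‖ ≤ δ) (k : Fin (K + 1)) :
    |μ k - μ' k| ≤ 4 * δ * (2 / 3) ^ (j - k.val) * lam k.val ^ (1 / 2 + β) ∧
      ‖Ek k - Ek' k‖ ≤ 4 * δ * (2 / 3) ^ (j - k.val) * lam k.val ^ β := by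
  obtain ⟨hξ, hfix⟩ := rescale_fixed (S := S) h hF hb
  obtain ⟨hξ', hfix'⟩ := rescale_fixed (S := S') h hF' hb'
  have hd := fixedPoint_sub_le_of_agree_below hB h hξ hξ' hfix hfix' h2 hm h3 hE hδ
    (ρ := 3 / 2) (by norm_num) (by norm_num) k
  have hd' : ‖rescale lam β K μ Ek k - rescale lam β K μ' Ek' k‖ ≤ 4 * δ * (2 / 3) ^ (j - k.val) := by
    have h4 : (1 - (3 : ℝ) / 2 / 2)⁻¹ = 4 := by norm_num
    rw [h4] at hd
    have hinv : (2 / 3 : ℝ) ^ (j - k.val) * (3 / 2) ^ (j - k.val) = 1 := by rw [← mul_pow]; norm_num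
    calc ‖rescale lam β K μ Ek k - rescale lam β K μ' Ek' k‖
        = (2 / 3 : ℝ) ^ (j - k.val) * ((3 / 2) ^ (j - k.val) * ‖rescale lam β K μ Ek k - rescale lam β K μ' Ek' k‖) := by
          rw [← mul_assoc, hinv, one_mul]
      _ ≤ (2 / 3 : ℝ) ^ (j - k.val) * (4 * δ) := mul_le_mul_of_nonneg_left hd (pow_nonneg (by norm_num) _)
      _ = 4 * δ * (2 / 3) ^ (j - k.val) := by ring
  have hw : 0 < lam k.val ^ (1 / 2 + β) := h.wpos _ _
  have hu : 0 < lam k.val ^ β := h.wpos _ _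
  have hk1 := (norm_fst_le _).trans hd'
  have hk2 := (norm_snd_le _).trans hd'
  simp only [rescale, Prod.fst_sub, Prod.snd_sub, Real.norm_eq_abs] at hk1 hk2
  have hC : 0 ≤ 4 * δ * (2 / 3 : ℝ) ^ (j - k.val) := by
    have hδ0 : 0 ≤ δ := (norm_nonneg _).trans (hδ 0 (by simp))
    positivity
  constructor
  · have : μ k - μ' k = lam k.val ^ (1 / 2 + β) * ((lam k.val ^ (1 / 2 + β))⁻¹ * μ k - (lam k.val ^ (1 / 2 + β))⁻¹ * μ' k) := by
      rw [← mul_sub, ← mul_assoc, mul_inv_cancel₀ hw.ne', one_mul]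
    rw [this, abs_mul, abs_of_pos hw]
    nlinarith
  · have : Ek k - Ek' k = lam k.val ^ β • ((lam k.val ^ β)⁻¹ • Ek k - (lam k.val ^ β)⁻¹ • Ek' k) := by
      rw [← smul_sub, smul_smul, mul_inv_cancel₀ hu.ne', one_smul]
    rw [this, norm_smul, Real.norm_eq_abs, abs_of_pos hu]
    nlinarith

/-- `fixedPoint_sub_le_of_agree_above` in the ORIGINAL variables with `ρ = 3/2`: if the single-step data agree at every
level `i ≥ j` and the maps differ by at most `δ` on the unit ball of 𝖡, then two flows of Theorem 24 satisfy, at every level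
`k`, `|μ_k − μ′_k| ≤ 4δ·(2/3)^{k−j}·λ_k^{½+β}` and `‖E_k − E′_k‖ ≤ 4δ·(2/3)^{k−j}·λ_k^β` (truncated exponent).
[cite: Dimock2013, §5 Theorem 24 (arXiv:1108.1335v2 TeX L3006–3022)] -/
theorem flow_sub_flow_le_of_agree_above (hB : StepBounds S lam Lr A eps) (h : FlowSmall lam Lr A eps β K)
    {μ μ' : Fin (K + 1) → ℝ} {Ek Ek' : (k : Fin (K + 1)) → E k.val}
    (hF : IsFlow S Lr K μ Ek) (hb : InBall lam β K μ Ek) (hF' : IsFlow S' Lr K μ' Ek') (hb' : InBall lam β K μ' Ek')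
    {j : ℕ} (h2 : ∀ i, j ≤ i → S.L2 i = S'.L2 i) (hm : ∀ i, j ≤ i → S.mus i = S'.mus i)
    (h3 : ∀ i, j ≤ i → S.L3 i = S'.L3 i) (hE : ∀ i, j ≤ i → S.Es i = S'.Es i) {δ : ℝ}
    (hδ : ∀ ζ : Seq K E, ‖ζ‖ ≤ 1 → ‖T S lam Lr β K ζ - T S' lam Lr β K ζ‖ ≤ δ) (k : Fin (K + 1)) :
    |μ k - μ' k| ≤ 4 * δ * (2 / 3) ^ (k.val - j) * lam k.val ^ (1 / 2 + β) ∧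
      ‖Ek k - Ek' k‖ ≤ 4 * δ * (2 / 3) ^ (k.val - j) * lam k.val ^ β := by
  obtain ⟨hξ, hfix⟩ := rescale_fixed (S := S) h hF hb
  obtain ⟨hξ', hfix'⟩ := rescale_fixed (S := S') h hF' hb'
  have hd := fixedPoint_sub_le_of_agree_above hB h hξ hξ' hfix hfix' h2 hm h3 hE hδ
    (ρ := 3 / 2) (by norm_num) (by norm_num) k
  have hd' : ‖rescale lam β K μ Ek k - rescale lam β K μ' Ek' k‖ ≤ 4 * δ * (2 / 3) ^ (k.val - j) := by
    have h4 : (1 - (3 : ℝ) / 2 / 2)⁻¹ = 4 := by norm_num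
    rw [h4] at hd
    have hinv : (2 / 3 : ℝ) ^ (k.val - j) * (3 / 2) ^ (k.val - j) = 1 := by
      rw [← mul_pow]; norm_num
    calc ‖rescale lam β K μ Ek k - rescale lam β K μ' Ek' k‖
        = (2 / 3 : ℝ) ^ (k.val - j)
            * ((3 / 2) ^ (k.val - j) * ‖rescale lam β K μ Ek k - rescale lam β K μ' Ek' k‖) := by
          rw [← mul_assoc, hinv, one_mul]
      _ ≤ (2 / 3 : ℝ) ^ (k.val - j) * (4 * δ) := mul_le_mul_of_nonneg_left hd (pow_nonneg (by norm_num) _)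
      _ = 4 * δ * (2 / 3) ^ (k.val - j) := by ring
  have hw : 0 < lam k.val ^ (1 / 2 + β) := h.wpos _ _
  have hu : 0 < lam k.val ^ β := h.wpos _ _
  have hk1 := (norm_fst_le _).trans hd'
  have hk2 := (norm_snd_le _).trans hd'
  simp only [rescale, Prod.fst_sub, Prod.snd_sub, Real.norm_eq_abs] at hk1 hk2
  have hC : 0 ≤ 4 * δ * (2 / 3 : ℝ) ^ (k.val - j) := by
    have hδ0 : 0 ≤ δ := (norm_nonneg _).trans (hδ 0 (by simp))
    positivity
  constructor
  · have : μ k - μ' k = lam k.val ^ (1 / 2 + β) * ((lam k.val ^ (1 / 2 + β))⁻¹ * μ k - (lam k.val ^ (1 / 2 + β))⁻¹ * μ' k) := by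
      rw [← mul_sub, ← mul_assoc, mul_inv_cancel₀ hw.ne', one_mul]
    rw [this, abs_mul, abs_of_pos hw]
    nlinarith
  · have : Ek k - Ek' k = lam k.val ^ β • ((lam k.val ^ β)⁻¹ • Ek k - (lam k.val ^ β)⁻¹ • Ek' k) := by
      rw [← smul_sub, smul_smul, mul_inv_cancel₀ hu.ne', one_smul]
    rw [this, norm_smul, Real.norm_eq_abs, abs_of_pos hu]
    nlinarith

end Tempered

/-! ## Part 8. THE SHARP ULTRAVIOLET RATE: two-ratio tempering — the μ-chain reads level `k + 1` with coefficient
`L^{β−3/2}`, so weights may DEcrease towards the infrared `½L^{3/2−β}`-fold per level; the ultraviolet counterterms forget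
the infrared step data at the power-counting rate `(4L^{β−3/2})^{distance}` (NOT a statement of the print) -/

section TemperedSharp

variable {E : ℕ → Type*} [∀ k, NormedAddCommGroup (E k)] [∀ k, NormedSpace ℝ (E k)]
variable {S S' : StepMaps E} {lam : ℕ → ℝ} {Lr A eps β : ℝ} {K : ℕ}

/-- **TWO-RATIO TEMPERED CONTRACTION** (NOT a statement of the print; refines `tempered_T_sub_T_le`, which is the case
`ρᵤ = ρ_d = ρ`, `θ = ρ/2`): if the non-negative weights satisfy `w_i ≤ ρᵤ·w_{i+1}` (the ratio seen by the μ-component,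
which reads level `k + 1` with the printed coefficient `L^{β−3/2}`, TeX L2921–2924) and `w_{i+1} ≤ ρ_d·w_i` (the ratio seen by
the E-component, which reads level `k − 1` with coefficient `≤ ½`), then level by level on the closed unit ball
`w_k‖(Tξ)_k − (Tη)_k‖ ≤ θ·sup_i w_i‖ξ_i − η_i‖` for any `θ ≥ max(L^{β−3/2}ρᵤ + ½ − L^{β−3/2}, ρ_d/2)`.  In particular
weights decreasing towards the infrared (`ρ_d ≤ 1`) are admissible with `ρᵤ` as large as `1 + ½L^{3/2−β}` — the
relevant direction's hyperbolic rate. [cite: Dimock2013, §5 Lemma 23 (2) (arXiv:1108.1335v2 TeX L2854–2860, L2898–2999)] -/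
theorem tempered₂_T_sub_T_le (hB : StepBounds S lam Lr A eps) (h : FlowSmall lam Lr A eps β K)
    {ξ η : Seq K E} (hξ : ‖ξ‖ ≤ 1) (hη : ‖η‖ ≤ 1) {ρu ρd θ : ℝ} (hρu : 0 ≤ ρu) (hρd : 0 ≤ ρd)
    (hθμ : Lr ^ (β - 3 / 2) * ρu + (1 / 2 - Lr ^ (β - 3 / 2)) ≤ θ) (hθE : ρd / 2 ≤ θ)
    {w : ℕ → ℝ} (hw0 : ∀ i, 0 ≤ w i) (hup : ∀ i, w i ≤ ρu * w (i + 1)) (hdn : ∀ i, w (i + 1) ≤ ρd * w i)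
    {M : ℝ} (hM : ∀ i : Fin (K + 1), w i.val * ‖ξ i - η i‖ ≤ M) (k : Fin (K + 1)) :
    w k.val * ‖T S lam Lr β K ξ k - T S lam Lr β K η k‖ ≤ θ * M := by
  have hM0 : 0 ≤ M := (mul_nonneg (hw0 _) (norm_nonneg _)).trans (hM 0)
  have hθ0 : 0 ≤ θ := le_trans (by positivity) hθE
  rw [T, T, Prod.mk_sub_mk, Prod.norm_def, mul_max_of_nonneg _ _ (hw0 _), max_le_iff]
  constructor
  · rw [Real.norm_eq_abs]
    by_cases hk : k.val + 1 < K + 1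
    · have hloc := muNext_sub_muNext_le hB h hξ hη k hk
      have ha0 : 0 ≤ Lr ^ (β - 3 / 2) := (Real.rpow_pos_of_pos h.Lr_pos _).le
      have hkK : k.val ≤ K := by omega
      have hb0 : 0 ≤ 1 / 2 - Lr ^ (β - 3 / 2) := by
        have := h.c1 _ hkK
        have h2 : 0 ≤ (Lr ^ 2)⁻¹ * lam k.val ^ (6 * eps) := by
          have := h.Lr_pos; have := h.wpos k.val (6 * eps); positivity
        have h3 : 0 ≤ 2 * (A * Lr * lam k.val ^ (1 / 4 - 4 * eps)) := by
          have := h.Lr_pos; have := h.A_nonneg; have := h.wpos k.val (1 / 4 - 4 * eps); positivity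
        linarith
      have hnext : w k.val * ‖ξ ⟨k.val + 1, hk⟩ - η ⟨k.val + 1, hk⟩‖ ≤ ρu * M := by
        calc w k.val * ‖ξ ⟨k.val + 1, hk⟩ - η ⟨k.val + 1, hk⟩‖
            ≤ ρu * w (k.val + 1) * ‖ξ ⟨k.val + 1, hk⟩ - η ⟨k.val + 1, hk⟩‖ :=
              mul_le_mul_of_nonneg_right (hup _) (norm_nonneg _)
          _ = ρu * (w (k.val + 1) * ‖ξ ⟨k.val + 1, hk⟩ - η ⟨k.val + 1, hk⟩‖) := by ring
          _ ≤ ρu * M := mul_le_mul_of_nonneg_left (hM ⟨k.val + 1, hk⟩) hρu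
      have hhere : w k.val * ‖ξ k - η k‖ ≤ M := hM k
      calc w k.val * |muNext S lam Lr β K ξ k - muNext S lam Lr β K η k|
          ≤ w k.val * (Lr ^ (β - 3 / 2) * ‖ξ ⟨k.val + 1, hk⟩ - η ⟨k.val + 1, hk⟩‖
              + (1 / 2 - Lr ^ (β - 3 / 2)) * ‖ξ k - η k‖) := mul_le_mul_of_nonneg_left hloc (hw0 _)
        _ = Lr ^ (β - 3 / 2) * (w k.val * ‖ξ ⟨k.val + 1, hk⟩ - η ⟨k.val + 1, hk⟩‖)
              + (1 / 2 - Lr ^ (β - 3 / 2)) * (w k.val * ‖ξ k - η k‖) := by ring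
        _ ≤ Lr ^ (β - 3 / 2) * (ρu * M) + (1 / 2 - Lr ^ (β - 3 / 2)) * M :=
              add_le_add (mul_le_mul_of_nonneg_left hnext ha0) (mul_le_mul_of_nonneg_left hhere hb0)
        _ = (Lr ^ (β - 3 / 2) * ρu + (1 / 2 - Lr ^ (β - 3 / 2))) * M := by ring
        _ ≤ θ * M := mul_le_mul_of_nonneg_right hθμ hM0
    · rw [muNext_eq_zero_of_not k hk, muNext_eq_zero_of_not k hk, sub_zero, abs_zero, mul_zero]
      positivity
  · rcases Fin.eq_zero_or_eq_succ k with rfl | ⟨j, rfl⟩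
    · rw [eNext_zero, eNext_zero, sub_zero, norm_zero, mul_zero]; positivity
    · have hloc := eNext_sub_eNext_le hB h hξ hη j
      have hval : (j.succ).val = (prev j).val + 1 := rfl
      calc w j.succ.val * ‖eNext S lam β K ξ j.succ - eNext S lam β K η j.succ‖
          ≤ w j.succ.val * (1 / 2 * ‖ξ (prev j) - η (prev j)‖) := mul_le_mul_of_nonneg_left hloc (hw0 _)
        _ ≤ ρd * w (prev j).val * (1 / 2 * ‖ξ (prev j) - η (prev j)‖) := by
              rw [hval]
              exact mul_le_mul_of_nonneg_right (hdn _) (by positivity)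
        _ = ρd / 2 * (w (prev j).val * ‖ξ (prev j) - η (prev j)‖) := by ring
        _ ≤ ρd / 2 * M := mul_le_mul_of_nonneg_left (hM _) (by positivity)
        _ ≤ θ * M := mul_le_mul_of_nonneg_right hθE hM0

/-- **TWO-RATIO TEMPERED DEPENDENCE OF THE FIXED POINT ON THE SINGLE-STEP DATA** (refines `tempered_fixedPoint_sub_le`;
NOT a statement of the print): with weights as in `tempered₂_T_sub_T_le` and a contraction number `θ < 1`, fixed points
`ξ`, `ξ′` in the closed unit ball of the maps `T`, `T′` of `S` (obeying `StepBounds`) and of ANY `S′`, whose maps differ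
by at most `δ_k` at level `k` on the ball with `w_kδ_k ≤ D`, satisfy `w_k‖ξ_k − ξ′_k‖ ≤ (1 − θ)⁻¹·D` at every level.
[cite: Dimock2013, §5 Lemma 23 (2) (arXiv:1108.1335v2 TeX L2854–2860, L2898–2904)] -/
theorem tempered₂_fixedPoint_sub_le (hB : StepBounds S lam Lr A eps) (h : FlowSmall lam Lr A eps β K)
    {ξ ξ' : Seq K E} (hξ : ‖ξ‖ ≤ 1) (hξ' : ‖ξ'‖ ≤ 1) (hfix : T S lam Lr β K ξ = ξ)
    (hfix' : T S' lam Lr β K ξ' = ξ') {ρu ρd θ : ℝ} (hρu : 0 ≤ ρu) (hρd : 0 ≤ ρd)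
    (hθμ : Lr ^ (β - 3 / 2) * ρu + (1 / 2 - Lr ^ (β - 3 / 2)) ≤ θ) (hθE : ρd / 2 ≤ θ) (hθ1 : θ < 1)
    {w : ℕ → ℝ} (hw0 : ∀ i, 0 ≤ w i) (hup : ∀ i, w i ≤ ρu * w (i + 1)) (hdn : ∀ i, w (i + 1) ≤ ρd * w i)
    {δ : ℕ → ℝ}
    (hδ : ∀ ζ : Seq K E, ‖ζ‖ ≤ 1 → ∀ k : Fin (K + 1), ‖T S lam Lr β K ζ k - T S' lam Lr β K ζ k‖ ≤ δ k.val)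
    {D : ℝ} (hD : ∀ k : Fin (K + 1), w k.val * δ k.val ≤ D) (k : Fin (K + 1)) :
    w k.val * ‖ξ k - ξ' k‖ ≤ (1 - θ)⁻¹ * D := by
  obtain ⟨k₀, -, hk₀⟩ := Finset.exists_max_image Finset.univ (fun i : Fin (K + 1) => w i.val * ‖ξ i - ξ' i‖)
    Finset.univ_nonempty
  set M := w k₀.val * ‖ξ k₀ - ξ' k₀‖ with hM
  have hMi : ∀ i : Fin (K + 1), w i.val * ‖ξ i - ξ' i‖ ≤ M := fun i => hk₀ i (Finset.mem_univ i)
  have hstep : ∀ i : Fin (K + 1), w i.val * ‖ξ i - ξ' i‖ ≤ θ * M + D := fun i => by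
    have e : ξ i - ξ' i = (T S lam Lr β K ξ i - T S lam Lr β K ξ' i) + (T S lam Lr β K ξ' i - T S' lam Lr β K ξ' i) := by
      conv_lhs => rw [← hfix, ← hfix']
      abel
    calc w i.val * ‖ξ i - ξ' i‖
        ≤ w i.val * (‖T S lam Lr β K ξ i - T S lam Lr β K ξ' i‖ + ‖T S lam Lr β K ξ' i - T S' lam Lr β K ξ' i‖) := by
          rw [e]; exact mul_le_mul_of_nonneg_left (norm_add_le _ _) (hw0 _)
      _ = w i.val * ‖T S lam Lr β K ξ i - T S lam Lr β K ξ' i‖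
            + w i.val * ‖T S lam Lr β K ξ' i - T S' lam Lr β K ξ' i‖ := by ring
      _ ≤ θ * M + D := add_le_add (tempered₂_T_sub_T_le hB h hξ hξ' hρu hρd hθμ hθE hw0 hup hdn hMi i)
            ((mul_le_mul_of_nonneg_left (hδ ξ' hξ' i) (hw0 _)).trans (hD i))
  have hMle : M ≤ θ * M + D := hstep k₀
  have hgap : 0 < 1 - θ := by linarith
  have hMbound : M ≤ (1 - θ)⁻¹ * D := by
    rw [le_inv_mul_iff₀ hgap]; nlinarith
  exact (hMi k).trans hMbound

/-- **THE SHARP ULTRAVIOLET RATE** (NOT a statement of the print; `tempered₂_fixedPoint_sub_le` with the weight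
`ρ^{(j−k)₊}`, `ρᵤ = ρ`, `ρ_d = 1`): if `S` obeys `StepBounds`, the single-step data `S`, `S′` agree at every level `i < j`
and their maps are `δ`-close on the closed unit ball, then fixed points in the ball satisfy
`ρ^{j−k}‖ξ_k − ξ′_k‖ ≤ (½ − L^{β−3/2}(ρ − 1))⁻¹δ` for EVERY `ρ ≥ 1` with `L^{β−3/2}(ρ − 1) < ½` — i.e. up to
`ρ < 1 + ½L^{3/2−β}`, the hyperbolic rate of the relevant (mass) direction, in place of the `ρ < 2` of
`fixedPoint_sub_le_of_agree_below` (which the E-direction imposes only on propagation TOWARDS the infrared).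
[cite: Dimock2013, §5 Lemma 23 (2) and Theorem 24 (arXiv:1108.1335v2 TeX L2854–2860, L3006–3022)] -/
theorem fixedPoint_sub_le_of_agree_below_sharp (hB : StepBounds S lam Lr A eps) (h : FlowSmall lam Lr A eps β K)
    {ξ ξ' : Seq K E} (hξ : ‖ξ‖ ≤ 1) (hξ' : ‖ξ'‖ ≤ 1) (hfix : T S lam Lr β K ξ = ξ)
    (hfix' : T S' lam Lr β K ξ' = ξ') {j : ℕ} (h2 : ∀ i, i < j → S.L2 i = S'.L2 i)
    (hm : ∀ i, i < j → S.mus i = S'.mus i) (h3 : ∀ i, i < j → S.L3 i = S'.L3 i)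
    (hE : ∀ i, i < j → S.Es i = S'.Es i) {δ : ℝ}
    (hδ : ∀ ζ : Seq K E, ‖ζ‖ ≤ 1 → ‖T S lam Lr β K ζ - T S' lam Lr β K ζ‖ ≤ δ)
    {ρ : ℝ} (hρ : 1 ≤ ρ) (hρa : Lr ^ (β - 3 / 2) * (ρ - 1) < 1 / 2) (k : Fin (K + 1)) :
    ρ ^ (j - k.val) * ‖ξ k - ξ' k‖ ≤ (1 / 2 - Lr ^ (β - 3 / 2) * (ρ - 1))⁻¹ * δ := by
  obtain ⟨hw0, hup, -, -, -, -⟩ := geom_tempered hρ j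
  have hδ0 : 0 ≤ δ := (norm_nonneg _).trans (hδ 0 (by simp))
  have hρ0 : 0 ≤ ρ := zero_le_one.trans hρ
  -- the weight `ρ^{(j−i)₊}` does not increase towards the infrared: `ρ_d = 1`
  have hdn : ∀ i, ρ ^ (j - (i + 1)) ≤ 1 * ρ ^ (j - i) := fun i => by
    rw [one_mul]; exact pow_le_pow_right₀ hρ (by omega)
  have ha0 : 0 ≤ Lr ^ (β - 3 / 2) := (Real.rpow_pos_of_pos h.Lr_pos _).le
  have haρ : Lr ^ (β - 3 / 2) ≤ Lr ^ (β - 3 / 2) * ρ := le_mul_of_one_le_right ha0 hρ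
  have hθ : (1 : ℝ) - (Lr ^ (β - 3 / 2) * ρ + (1 / 2 - Lr ^ (β - 3 / 2))) = 1 / 2 - Lr ^ (β - 3 / 2) * (ρ - 1) := by
    ring
  have key := tempered₂_fixedPoint_sub_le hB h hξ hξ' hfix hfix' hρ0 zero_le_one
    (θ := Lr ^ (β - 3 / 2) * ρ + (1 / 2 - Lr ^ (β - 3 / 2))) le_rfl (by linarith) (by linarith) hw0 hup hdn
    (δ := fun i => if i < j then 0 else δ) (fun ζ hζ i => ?_) (fun i => ?_) k (D := δ)
  · rw [hθ] at key; exact key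
  · by_cases hi : i.val < j
    · rw [if_pos hi, T_apply_eq_below h2 hm h3 hE ζ i hi, sub_self, norm_zero]
    · rw [if_neg hi]
      exact (norm_le_pi_norm (T S lam Lr β K ζ - T S' lam Lr β K ζ) i).trans (hδ ζ hζ)
  · by_cases hi : i.val < j
    · rw [if_pos hi, mul_zero]; exact hδ0
    · rw [if_neg hi, Nat.sub_eq_zero_of_le (not_lt.1 hi), pow_zero, one_mul]

/-- **THE SHARP ULTRAVIOLET RATE IN THE ORIGINAL VARIABLES** (`ρ = ¼L^{3/2−β}`, admissible by `FlowSmall.j1`; NOT a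
statement of the print): for two flows of Theorem 24 whose single-step data agree at every level `i < j` and whose maps
are `δ`-close on the unit ball of 𝖡 (`S` obeying `StepBounds`, `S′` arbitrary), at every level `k`
`|μ_k − μ′_k| ≤ 4δ·(4L^{β−3/2})^{j−k}·λ_k^{½+β}` and `‖E_k − E′_k‖ ≤ 4δ·(4L^{β−3/2})^{j−k}·λ_k^β` (truncated exponent) —
a modification of the step maps at scale distance `n` below a level moves that level's counterterms by the power-counting
factor `(4L^{−(3/2−β)})^{n}` of the relevant direction (compare `(2/3)^n` in `flow_sub_flow_le_of_agree_below`; the two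
bounds coexist, the present one is the stronger as soon as `L^{3/2−β} > 6`).  For cell record Q-TM98-1: an `𝖬`-dependence of
Dimock's step maps confined to the last `n` (infrared) levels would move the initial counterterm `μ^𝖭_0` by at most
`4·(4L^{β−3/2})^{K−n}` times its size in the natural unit `λ_0^{½+β}` — nothing about that dependence is asserted.
[cite: Dimock2013, §5 Theorem 24 (arXiv:1108.1335v2 TeX L3006–3022)] -/
theorem flow_sub_flow_le_of_agree_below_sharp (hB : StepBounds S lam Lr A eps) (h : FlowSmall lam Lr A eps β K)
    {μ μ' : Fin (K + 1) → ℝ} {Ek Ek' : (k : Fin (K + 1)) → E k.val}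
    (hF : IsFlow S Lr K μ Ek) (hb : InBall lam β K μ Ek) (hF' : IsFlow S' Lr K μ' Ek') (hb' : InBall lam β K μ' Ek')
    {j : ℕ} (h2 : ∀ i, i < j → S.L2 i = S'.L2 i) (hm : ∀ i, i < j → S.mus i = S'.mus i)
    (h3 : ∀ i, i < j → S.L3 i = S'.L3 i) (hE : ∀ i, i < j → S.Es i = S'.Es i) {δ : ℝ}
    (hδ : ∀ ζ : Seq K E, ‖ζ‖ ≤ 1 → ‖T S lam Lr β K ζ - T S' lam Lr β K ζ‖ ≤ δ) (k : Fin (K + 1)) :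
    |μ k - μ' k| ≤ 4 * δ * (4 * Lr ^ (β - 3 / 2)) ^ (j - k.val) * lam k.val ^ (1 / 2 + β) ∧
      ‖Ek k - Ek' k‖ ≤ 4 * δ * (4 * Lr ^ (β - 3 / 2)) ^ (j - k.val) * lam k.val ^ β := by
  obtain ⟨hξ, hfix⟩ := rescale_fixed (S := S) h hF hb
  obtain ⟨hξ', hfix'⟩ := rescale_fixed (S := S') h hF' hb'
  set a := Lr ^ (β - 3 / 2) with ha
  have ha0 : 0 < a := Real.rpow_pos_of_pos h.Lr_pos _
  have ha4 : a ≤ 1 / 4 := h.j1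
  -- ρ = (4a)⁻¹ ≥ 1 and a(ρ − 1) = ¼ − a < ½
  have hρ : (1 : ℝ) ≤ (4 * a)⁻¹ := by
    rw [le_inv_comm₀ zero_lt_one (by positivity), inv_one]; linarith
  have h4a : a * (4 * a)⁻¹ = 1 / 4 := by
    rw [mul_comm 4 a, mul_inv, ← mul_assoc, mul_inv_cancel₀ ha0.ne', one_mul]; norm_num
  have hq : a * ((4 * a)⁻¹ - 1) = 1 / 4 - a := by rw [mul_sub, h4a, mul_one]
  have hρa : a * ((4 * a)⁻¹ - 1) < 1 / 2 := by rw [hq]; linarith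
  have hd := fixedPoint_sub_le_of_agree_below_sharp hB h hξ hξ' hfix hfix' h2 hm h3 hE hδ hρ hρa k
  have hδ0 : 0 ≤ δ := (norm_nonneg _).trans (hδ 0 (by simp))
  have hcoef : (1 / 2 - a * ((4 * a)⁻¹ - 1))⁻¹ ≤ 4 := by
    have e : 1 / 2 - a * ((4 * a)⁻¹ - 1) = 1 / 4 + a := by rw [hq]; ring
    rw [e, inv_le_comm₀ (by positivity) (by norm_num)]
    linarith
  have hinv : (4 * a) ^ (j - k.val) * (4 * a)⁻¹ ^ (j - k.val) = 1 := by
    rw [← mul_pow, mul_inv_cancel₀ (by positivity), one_pow]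
  have hd' : ‖rescale lam β K μ Ek k - rescale lam β K μ' Ek' k‖ ≤ 4 * δ * (4 * a) ^ (j - k.val) := by
    have h1 : (4 * a)⁻¹ ^ (j - k.val) * ‖rescale lam β K μ Ek k - rescale lam β K μ' Ek' k‖ ≤ 4 * δ :=
      hd.trans (mul_le_mul_of_nonneg_right hcoef hδ0)
    calc ‖rescale lam β K μ Ek k - rescale lam β K μ' Ek' k‖
        = (4 * a) ^ (j - k.val) * ((4 * a)⁻¹ ^ (j - k.val) * ‖rescale lam β K μ Ek k - rescale lam β K μ' Ek' k‖) := by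
          rw [← mul_assoc, hinv, one_mul]
      _ ≤ (4 * a) ^ (j - k.val) * (4 * δ) := mul_le_mul_of_nonneg_left h1 (pow_nonneg (by positivity) _)
      _ = 4 * δ * (4 * a) ^ (j - k.val) := by ring
  have hw : 0 < lam k.val ^ (1 / 2 + β) := h.wpos _ _
  have hu : 0 < lam k.val ^ β := h.wpos _ _
  have hk1 := (norm_fst_le _).trans hd'
  have hk2 := (norm_snd_le _).trans hd'
  simp only [rescale, Prod.fst_sub, Prod.snd_sub, Real.norm_eq_abs] at hk1 hk2
  have hC : 0 ≤ 4 * δ * (4 * a) ^ (j - k.val) := by positivity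
  constructor
  · have : μ k - μ' k = lam k.val ^ (1 / 2 + β) * ((lam k.val ^ (1 / 2 + β))⁻¹ * μ k - (lam k.val ^ (1 / 2 + β))⁻¹ * μ' k) := by
      rw [← mul_sub, ← mul_assoc, mul_inv_cancel₀ hw.ne', one_mul]
    rw [this, abs_mul, abs_of_pos hw]
    nlinarith
  · have : Ek k - Ek' k = lam k.val ^ β • ((lam k.val ^ β)⁻¹ • Ek k - (lam k.val ^ β)⁻¹ • Ek' k) := by
      rw [← smul_sub, smul_smul, mul_inv_cancel₀ hu.ne', one_smul]
    rw [this, norm_smul, Real.norm_eq_abs, abs_of_pos hu]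
    nlinarith

end TemperedSharp

/-! ## Part 9. δ-FREE FORMS: two ADMISSIBLE single-step data (both obeying `StepBounds`) that coincide on one side of a
level select counterterm trajectories that agree on that side up to `8·rate^{distance}` — whatever the data are on the
other side (NOT a statement of the print) -/

section Admissible

variable {E : ℕ → Type*} [∀ k, NormedAddCommGroup (E k)] [∀ k, NormedSpace ℝ (E k)]
variable {S S' : StepMaps E} {lam : ℕ → ℝ} {Lr A eps β : ℝ} {K : ℕ}

/-- Two admissible step data have maps `2`-close on the closed unit ball (both map it into itself, Lemma 23 (1)).
[cite: Dimock2013, §5 Lemma 23 (1) (arXiv:1108.1335v2 TeX L2854–2895)] -/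
theorem norm_T_sub_T'_le_two (hB : StepBounds S lam Lr A eps) (hB' : StepBounds S' lam Lr A eps)
    (h : FlowSmall lam Lr A eps β K) (ζ : Seq K E) (hζ : ‖ζ‖ ≤ 1) :
    ‖T S lam Lr β K ζ - T S' lam Lr β K ζ‖ ≤ 2 := by
  have h1 := norm_T_le_one hB h hζ
  have h2 := norm_T_le_one hB' h hζ
  linarith [norm_sub_le (T S lam Lr β K ζ) (T S' lam Lr β K ζ)]

/-- **THE ULTRAVIOLET COUNTERTERMS ARE DETERMINED BY THE ULTRAVIOLET STEP DATA** (NOT a statement of the print): two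
ADMISSIBLE single-step data `S`, `S′` (both obeying the shape `StepBounds` of Theorem 14 ∕ Lemma 22, same parameters)
that COINCIDE AT EVERY LEVEL `i < j` select flows of Theorem 24 with, at every level `k`,
`|μ_k − μ′_k| ≤ 8·(4L^{β−3/2})^{j−k}·λ_k^{½+β}` and `‖E_k − E′_k‖ ≤ 8·(4L^{β−3/2})^{j−k}·λ_k^β` (truncated exponent) —
WHATEVER the two data are at the levels `≥ j`.  In particular the initial counterterm (level `0`; the `μ^𝖭_0` of I
Theorem 1, selected by the final condition `μ_K = 0`) is determined by the first `j` step maps up to the fraction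
`8·(4L^{β−3/2})^{j}` of its natural size `λ_0^{½+β}`, uniformly over all admissible infrared completions of the data (e.g.
over the volume exponent `𝖬` of the tori `𝕋⁰_{𝖬+𝖭−k}`, TeX L2756–2757, IF the step maps at the levels `< j` do not see it —
cell record Q-TM98-1; nothing about Dimock's actual step maps is asserted). [cite: Dimock2013, §5 Theorem 24 (arXiv:1108.1335v2 TeX L3006–3022)] -/
theorem flow_sub_flow_le_of_agree_below_adm (hB : StepBounds S lam Lr A eps) (hB' : StepBounds S' lam Lr A eps)
    (h : FlowSmall lam Lr A eps β K) {μ μ' : Fin (K + 1) → ℝ} {Ek Ek' : (k : Fin (K + 1)) → E k.val}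
    (hF : IsFlow S Lr K μ Ek) (hb : InBall lam β K μ Ek) (hF' : IsFlow S' Lr K μ' Ek') (hb' : InBall lam β K μ' Ek')
    {j : ℕ} (h2 : ∀ i, i < j → S.L2 i = S'.L2 i) (hm : ∀ i, i < j → S.mus i = S'.mus i)
    (h3 : ∀ i, i < j → S.L3 i = S'.L3 i) (hE : ∀ i, i < j → S.Es i = S'.Es i) (k : Fin (K + 1)) :
    |μ k - μ' k| ≤ 8 * (4 * Lr ^ (β - 3 / 2)) ^ (j - k.val) * lam k.val ^ (1 / 2 + β) ∧
      ‖Ek k - Ek' k‖ ≤ 8 * (4 * Lr ^ (β - 3 / 2)) ^ (j - k.val) * lam k.val ^ β := by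
  have := flow_sub_flow_le_of_agree_below_sharp hB h hF hb hF' hb' h2 hm h3 hE
    (δ := 2) (fun ζ hζ => norm_T_sub_T'_le_two hB hB' h ζ hζ) k
  constructor
  · calc |μ k - μ' k| ≤ 4 * 2 * (4 * Lr ^ (β - 3 / 2)) ^ (j - k.val) * lam k.val ^ (1 / 2 + β) := this.1
      _ = 8 * (4 * Lr ^ (β - 3 / 2)) ^ (j - k.val) * lam k.val ^ (1 / 2 + β) := by norm_num
  · calc ‖Ek k - Ek' k‖ ≤ 4 * 2 * (4 * Lr ^ (β - 3 / 2)) ^ (j - k.val) * lam k.val ^ β := this.2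
      _ = 8 * (4 * Lr ^ (β - 3 / 2)) ^ (j - k.val) * lam k.val ^ β := by norm_num

/-- The same with the `L`-independent rate `(2/3)^{j−k}` of Part 7 (stronger than the preceding bound only when
`L^{3/2−β} < 6`). [cite: Dimock2013, §5 Theorem 24 (arXiv:1108.1335v2 TeX L3006–3022)] -/
theorem flow_sub_flow_le_of_agree_below_adm' (hB : StepBounds S lam Lr A eps) (hB' : StepBounds S' lam Lr A eps)
    (h : FlowSmall lam Lr A eps β K) {μ μ' : Fin (K + 1) → ℝ} {Ek Ek' : (k : Fin (K + 1)) → E k.val}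
    (hF : IsFlow S Lr K μ Ek) (hb : InBall lam β K μ Ek) (hF' : IsFlow S' Lr K μ' Ek') (hb' : InBall lam β K μ' Ek')
    {j : ℕ} (h2 : ∀ i, i < j → S.L2 i = S'.L2 i) (hm : ∀ i, i < j → S.mus i = S'.mus i)
    (h3 : ∀ i, i < j → S.L3 i = S'.L3 i) (hE : ∀ i, i < j → S.Es i = S'.Es i) (k : Fin (K + 1)) :
    |μ k - μ' k| ≤ 8 * (2 / 3) ^ (j - k.val) * lam k.val ^ (1 / 2 + β) ∧
      ‖Ek k - Ek' k‖ ≤ 8 * (2 / 3) ^ (j - k.val) * lam k.val ^ β := by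
  have := flow_sub_flow_le_of_agree_below hB h hF hb hF' hb' h2 hm h3 hE
    (δ := 2) (fun ζ hζ => norm_T_sub_T'_le_two hB hB' h ζ hζ) k
  constructor
  · calc |μ k - μ' k| ≤ 4 * 2 * (2 / 3) ^ (j - k.val) * lam k.val ^ (1 / 2 + β) := this.1
      _ = 8 * (2 / 3) ^ (j - k.val) * lam k.val ^ (1 / 2 + β) := by norm_num
  · calc ‖Ek k - Ek' k‖ ≤ 4 * 2 * (2 / 3) ^ (j - k.val) * lam k.val ^ β := this.2
      _ = 8 * (2 / 3) ^ (j - k.val) * lam k.val ^ β := by norm_num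

/-- **THE INFRARED END OF THE TRAJECTORY IS DETERMINED BY THE INFRARED STEP DATA** (NOT a statement of the print): two
admissible single-step data that COINCIDE AT EVERY LEVEL `i ≥ j` select flows of Theorem 24 with, at every level `k`,
`|μ_k − μ′_k| ≤ 8·(2/3)^{k−j}·λ_k^{½+β}` and `‖E_k − E′_k‖ ≤ 8·(2/3)^{k−j}·λ_k^β` (truncated exponent) — WHATEVER the two
data are at the ultraviolet levels `< j`.  Reading: prepending or altering ultraviolet steps (e.g. comparing the
trajectories of two cut-offs whose step maps coincide, level by level, from some scale on — an IDEALISATION: in the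
print the level-`k` maps also depend on the fine lattice spacing `L^{−k}` of `𝕋^{−k}_{𝖬+𝖭−k}`, the η-effect the cell
records as C1-TM2 ∕ NE5) moves the infrared end of the counterterm trajectory geometrically little: the Markovian
template's form of the convergence of renormalised trajectories at fixed infrared scale.
[cite: Dimock2013, §5 Theorem 24 (arXiv:1108.1335v2 TeX L3006–3022)] -/
theorem flow_sub_flow_le_of_agree_above_adm (hB : StepBounds S lam Lr A eps) (hB' : StepBounds S' lam Lr A eps)
    (h : FlowSmall lam Lr A eps β K) {μ μ' : Fin (K + 1) → ℝ} {Ek Ek' : (k : Fin (K + 1)) → E k.val}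
    (hF : IsFlow S Lr K μ Ek) (hb : InBall lam β K μ Ek) (hF' : IsFlow S' Lr K μ' Ek') (hb' : InBall lam β K μ' Ek')
    {j : ℕ} (h2 : ∀ i, j ≤ i → S.L2 i = S'.L2 i) (hm : ∀ i, j ≤ i → S.mus i = S'.mus i)
    (h3 : ∀ i, j ≤ i → S.L3 i = S'.L3 i) (hE : ∀ i, j ≤ i → S.Es i = S'.Es i) (k : Fin (K + 1)) :
    |μ k - μ' k| ≤ 8 * (2 / 3) ^ (k.val - j) * lam k.val ^ (1 / 2 + β) ∧
      ‖Ek k - Ek' k‖ ≤ 8 * (2 / 3) ^ (k.val - j) * lam k.val ^ β := by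
  have := flow_sub_flow_le_of_agree_above hB h hF hb hF' hb' h2 hm h3 hE
    (δ := 2) (fun ζ hζ => norm_T_sub_T'_le_two hB hB' h ζ hζ) k
  constructor
  · calc |μ k - μ' k| ≤ 4 * 2 * (2 / 3) ^ (k.val - j) * lam k.val ^ (1 / 2 + β) := this.1
      _ = 8 * (2 / 3) ^ (k.val - j) * lam k.val ^ (1 / 2 + β) := by norm_num
  · calc ‖Ek k - Ek' k‖ ≤ 4 * 2 * (2 / 3) ^ (k.val - j) * lam k.val ^ β := this.2
      _ = 8 * (2 / 3) ^ (k.val - j) * lam k.val ^ β := by norm_num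

end Admissible

end Literature.MathematicalPhysics.QuantumFieldTheory.Dimock2011to13.SmallFieldFlow

end
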